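import Literature.NumberTheory.LFunctions.CertifiedLFunctionGammaFactorBound
import Literature.NumberTheory.LFunctions.ZetaZeroReciprocalSumsExplicit
import Literature.NumberTheory.Transcendental.EulerTailProduct
import Literature.NumberTheory.LFunctions.ZetaHalfLineHiaryPatelYang
import Literature.NumberTheory.LFunctions.CertifiedLFunctionTimeAliasingBound
import Mathlib.Analysis.SpecialFunctions.Log.Monotone
import Mathlib.Analysis.SumIntegralComparisons
import Mathlib.Topology.Algebra.InfiniteSum.Real
import Mathlib.Topology.Algebra.InfiniteSum.NatInt
import Mathlib.NumberTheory.Harmonic.ZetaAsymp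
import Literature.NumberTheory.LFunctions.LehmanCriticalLineBoundProofs
import Mathlib.Analysis.SpecialFunctions.Gaussian.GaussianIntegral
import Mathlib.MeasureTheory.Integral.IntegralEqImproper
import Mathlib.MeasureTheory.Integral.Gamma
import Mathlib.MeasureTheory.Measure.Lebesgue.Integral
import Mathlib.Analysis.SpecialFunctions.Gamma.Beta
import Mathlib.Analysis.SpecialFunctions.Gamma.BohrMollerup
import Mathlib.Analysis.Complex.ExponentialBounds
import Mathlib.Analysis.Real.Pi.Bounds
import HarnessLib

/-!
# Platt 2017, *Isolating some non-trivial zeros of zeta*, Appendix A: the Gamma-side bounds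
# (Lemma A.1 — the incomplete-Gamma substitution; Lemma A.2 — `|Γ((σ+it)/2)| e^{πt/4}`;
# Lemma A.4 — the trivial bound `|Γ((1/2+ix)/2)| e^{πx/4} < 4` and `|g(t;k)|`) and the growth
# lemmas A.10 / C.2 for `f` and `W` (modulo an explicit `|ζ(1/2+it)|` bound); Lemmas A.5 and A.11 — the
# aliasing errors of steps (2) and (8), both tails; Lemma C.3 — the up-sampling truncation, both tails;
# Lemma B.2 — the Gaussian moment behind the Taylor tail; Lemma A.3 — the closed-form majorant
# `C(σ,t₀,h,k)` in the (corrected) form its printed proof yields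

Topic `Literature/NumberTheory/LFunctions`; namespace `Literature.NumberTheory.LFunctions`, engine
sub-namespace `Platt2017` (the paper). Source: D. J. Platt, *Isolating some non-trivial zeros of
zeta*, Math. Comp. **86** (2017), no. 307, 2449–2467 [Platt2017] (journal pdf held as
`paper:platt2017-isolating-some-non-trivial-zeros-zeta`, read in full this session; Appendix A
«Bounds for steps 2, 4, 6 and 8» = pp. 2456–2463). This is the INSTRUMENT of the rigorous
verification of the Riemann hypothesis to height `3·10¹²` — D. Platt, T. Trudgian, Bull. LMS **53**
(2021) 792–797 [PlattTrudgianBLMS2021], §2 (arXiv:2004.09765v1 pp. 2–3): «We used the algorithm described in [21]» and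
«a minor improvement to our bound for `|Γ((σ+it)/2)| exp(πt/4)` (A.2 in [21])», `[21]` = this paper —
whose Theorem 1 is the tree's named fact `Literature.NumberTheory.LFunctions.platt_trudgian_numerical_rh`
(`RHWave0.lean`). Typed for the parity-realchar cell (D-0088 (4) literature-typing layer, row «Platt
2016 / Platt–Trudgian 2021 / Booker 2006»: instrument provenance of the Platt–Trudgian computation);
everything in this file is PROVED (kernel lane): no definitions, no named facts (Lemmas A.10 / C.2 take
the `|ζ(1/2+it)|` bound they rest on — (A.2) of the paper = Platt–Trudgian 2015 — as an explicit
hypothesis, and are instantiated with the tree's named fact `zeta_half_line_hiary_patel_yang`).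

## The algorithm being certified (§3 pp. 2450–2451, for orientation)

`Λ(t) := π^{−it/2} Γ((1/2+it)/2) ζ(1/2+it)` (real-valued by the functional equation),
`f(t) := Λ(t+t₀) exp(π(t+t₀)/4 − t²/(2h²))` (3.1), and in step (1)
`g(t; k) := Γ((1/2+i(t+t₀))/2) exp(π(t+t₀)/4 − t²/(2h²)) (−2πit)^k`; steps (2), (4), (6), (8) replace
`g`, `G^{(k)}`, `F`, `f` by their `B`- resp. `A`-periodisations, and Appendix A bounds the four aliasing
errors. The lemmas typed here are the Gamma-side inputs of all of them.

## The statements (pp. 2456–2459, verbatim) and what is proved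

* **Lemma A.1** (p. 2456). «Define the incomplete Gamma function for `Re s > 0` by
  `Γ(s, x) := ∫_x^∞ t^{s−1} e^{−t} dt`. Then, given `κ > −1` and `x, h > 0`, we have
  `∫_x^∞ w^κ exp(−w²/(2h²)) dw = 2^{(κ−1)/2} h^{κ+1} Γ((κ+1)/2, x²/(2h²))`.» — `platt2017_lemmaA1`,
  PROVED as printed (`Γ(s, x)` = the tree's `upperIncGamma`, the substitution `t = w²/(2h²)` =
  Mathlib's `integral_comp_mul_deriv_Ioi`).
* **Lemma A.2** (p. 2457). «Let `t ≥ σ ≥ 1`. Then we have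
  `|Γ((σ+it)/2)| exp(πt/4) < 2^{(3−σ)/4} √π t^{(σ−1)/2} exp((1+2√2)/(6t))`.» — `platt2017_lemmaA2`,
  PROVED as printed (strict). Printed proof: Stirling with Olver's error bound
  `|E| < √2(σ+t)/(6(σ²+t²)) < √2/(3t)`, `πt/4 − (t/2) arctan(t/σ) − σ/2 < 0`, and
  `|(σ+it)/2| < t/√2`-type bookkeeping; executed here with the tree's uniform Stirling formula
  `GammaStirling.abs_log_norm_Gamma_sub_le` (remainder `(1/12)(1/|w|² + π/(2|w|)) ≤ (4+π)/(12t)`,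
  and `(4+π)/12 < (1+2√2)/6`) and `(t/2)(π/2 − arg w) ≤ σ/2` (`tan(π/2 − arg w) = σ/t`,
  `φ ≤ tan φ`), the pattern of `GammaFactorBound.log_norm_Gamma_add_le`.
* **Lemma A.3** (p. 2457, proof p. 2458; full text in the docstring of `platt2017_lemmaA3_corrected`).
  `C(σ,t₀,h,k) := (2π)^k ∫_ℝ |Γ((σ+i(t+t₀))/2) e^{π(t+t₀)/4 − t²/(2h²)} (1/2+σ−it)^k| dt` for odd
  `σ ≥ 3`, `σ + 1/2 ≤ t₀`, `h > 0`, is bounded by two closed-form terms. — `platt2017_lemmaA3_corrected`: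
  PROVED IN THE FORM THE PRINTED PROOF YIELDS, which carries `π^{k+1}` and `π^{(2k+1)/2}` where the
  statement prints `π^k` and `π^{(2k−1)/2}`; **the printed inequality is false** (numerically, at
  `σ = 3, t₀ = 100, h = 1, k = 0`: `C ≈ 314.2 > 147.4`), the corrected one is a theorem. The fold
  «since `σ ≥ 3`» of the printed proof is `Platt2017.norm_Gamma_mul_exp_monotone`
  (`τ ↦ |Γ((σ+iτ)/2)| e^{πτ/4}` is nondecreasing for `σ ≥ 2`) from `Platt2017.im_digamma_le_half_pi`
  (`Im ψ(w) ≤ π/2` for `Re w ≥ 1`, by telescoping the series `Im ψ(w) = Σ_k Im w/|w+k|²` against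
  `arctan` increments).
* **Lemma A.4** (pp. 2458–2459). «For `k ∈ ℤ_{≥0}`, `t ∈ ℝ` and `t₀, h > 0`, recall that we define
  `g` by `g(t; k) := Γ((1/2+i(t+t₀))/2) exp(π(t+t₀)/4 − t²/(2h²)) (−2πit)^k`. Then
  `|g(t; k)| ≤ 4 (2π|t|)^k exp(−t²/(2h²))`. *Proof.* … and the result follows from the trivial bound
  `|Γ((1/2+ix)/2)| e^{πx/4} < 4`.» — `platt2017_lemmaA4`, PROVED as printed (the hypotheses
  `t₀, h > 0` are not used), from `Platt2017.norm_Gamma_half_line_mul_exp_lt_four`: **the trivial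
  bound, PROVED for every real `x`**. It is not a triviality: the left side is `Γ(1/4) = 3.6256…` at
  `x = 0`, rises to its maximum `3.9163…` at `x ≈ 0.213` and decays like `√(2π)(x/2)^{−1/4}`; the tree's
  Platt 2016 Lemma 8.3 (`platt2016_lemma83`, `a_χ = 0`) only gives `4.7666`. Proof here: `x ≤ 0` —
  `|Γ(1/4+iy)| ≤ Γ(1/4) ≤ 3.632`; `0 ≤ x ≤ 7/5` — nineteen rational mesh cells of
  `|Γ(w)| = |Γ(w+2)|/(|w||w+1|)`, `|Γ(w+2)| ≤ Γ(9/4) ≤ 1.1347` (margins ≥ 0.01 %, pre-checked in exact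
  arithmetic); `x ≥ 7/5` — Stirling (`≤ 3.8`). The enclosure **`Γ(9/4) ≤ 1.1347`**
  (`Platt2017.Gamma_nine_quarters_le`; true value `1.13300`) comes from log-convexity of `Γ`
  (Mathlib `Real.convexOn_log_Gamma`) at the midpoint `89/4` of `22` and `45/2` after the shift
  `Γ(9/4) ∏_{j<20} (9/4+j) = Γ(89/4)`, with `Γ(22) = 21!`, `Γ(45/2) = √π ∏_{j<22}(1/2+j)`, `√π ≤ 1.77246`.

* **Lemma A.5** (p. 2459). «Let `n ∈ [−N/2, N/2 − 1]` and `B > h√k`. Then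
  `|Σ_{l∈ℤ≠0} g(n/A + lB; k)| ≤ 8(πB)^k [exp(−B²/(8h²)) + 2^{(3k−1)/2} (h/B)^{k+1} Γ((k+1)/2, B²/(8h²))]`.
  *Proof.* We consider the right tail from `n = −N/2`. The first term missing is `g(B/2; k)` and `B/2` is
  sufficiently large such that our bound for `g(t;k)` (Lemma A.4) is decreasing. Thus, we can split off
  the first term and majorize the balance with an integral. … so we can apply Lemma A.1 and the result
  follows.» — `platt2017_lemmaA5` (Platt's `g`) and `platt2017_lemmaA5_of_bound` (any `g` with the
  Lemma A.4 bound), PROVED IN THE FORM THE PRINTED PROOF YIELDS: for real `x` with `|x| ≤ B/2` (covers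
  `x = n/A`, `N = AB`) and under the proviso **`2h√k ≤ B`** — the printed proof's monotonicity of
  `4(2πt)^k e^{−t²/(2h²)}` on `[B/2, ∞)` needs `B/2 ≥ h√k`, not the printed `B > h√k` (Platt's parameters
  §5 p. 2456: `B = 5476`, `h = 176431/2048 ≈ 86.1`, `k ≤ K = 44` give `2h√k ≤ 1143 < B`, so the
  computation is untouched; recorded, not silent). Conclusion typed as: `l ↦ g(x+lB)` summable over `ℤ`
  and `‖Σ_{l∈ℤ} g(x+lB) − g(x)‖ ≤` the printed right-hand side (`Γ(s,x)` = `upperIncGamma`).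
* **Lemma A.10** (p. 2462). «Let `f(t)` be as defined at (3.1), take `t ≥ 0`, `t₀ > exp(e)` and set
  `β = 1/6 + log log t₀ / log t₀`. Then `|f(t)| ≤ 3 (t+t₀)^β exp(−t²/(2h²))`. *Proof.* …
  `|f(t)| = |Γ((1/2+i(t+t₀))/2) exp(πt/4) ζ(1/2+i(t+t₀))| exp(−t²/(2h²))`. Now by [22] we have for
  `t + t₀ > 2`, (A.2) `|ζ(1/2+i(t+t₀))| ≤ 0.732 (t+t₀)^{1/6} log(t+t₀)` and with `(t+t₀) > exp(e)`
  and `β` defined as above `(t+t₀)^{1/6} log(t+t₀) ≤ (t+t₀)^β`. We bound the Gamma factor trivially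
  again with `4` and round `2.928` up to `3`.» ([22] = Platt–Trudgian, J. Number Theory 147 (2015)
  842–851.) — `platt2017_lemmaA10`: PROVED with the `ζ`-bound as an explicit hypothesis
  `∀ u ≥ t₀, |ζ(1/2+iu)| ≤ A u^{1/6} log u` for any `A ≤ 3/4` (so that `4A ≤ 3`);
  `platt2017_lemmaA10_of_plattTrudgian2015` = the printed form, hypothesis (A.2) verbatim
  (`A = 0.732`, `t + t₀ > 2`); `platt2017_lemmaA10_of_hpy` = the same conclusion from the tree's named
  fact `zeta_half_line_hiary_patel_yang` (Hiary–Patel–Yang 2024: `0.618`, `t ≥ 3`). The step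
  `(t+t₀)^{1/6} log(t+t₀) ≤ (t+t₀)^β` is `Platt2017.log_le_rpow_loglog` (`log u ≤ u^{log log t₀/log t₀}`
  for `u ≥ t₀ ≥ e^e`, from the monotonicity of `log x / x` on `[e, ∞)`); `f` is written out:
  `f(t) = π^{−i(t+t₀)/2} Γ((1/2+i(t+t₀))/2) ζ(1/2+i(t+t₀)) exp(π(t+t₀)/4 − t²/(2h²))`.
* **Lemma A.11** (p. 2463). «For `t ≥ 0` and `t₀ > exp(e)` set `β = 1/6 + log log t₀/log t₀`. Then
  providing `βh²/t₀ ≤ B/2 ≤ t₀` and `n ∈ [0, N−1]` we have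
  `|Σ_{l∈ℤ≠0} f((n−N/2)/A + lB)| ≤ 6(X + (2^β h/B)(Y + Z))`, where `X = (B/2+t₀)^β exp(−B²/(8h²))`,
  `Y = 2^{−1/2} t₀^β Γ(1/2, B²/(8h²))`, and `Z = 2^{β−1/2} h^β Γ((β+1)/2, t₀²/(2h²))`. *Proof.* The lower
  bound on `B` ensures that the bound of Lemma A.10 is decreasing for `t ≥ B/2`. The worst case is when
  `n = 0` and for any `n`, the right tail majorizes the left. The first missing term to the right is
  `f(B/2)` and the remaining terms are majorized by [an integral] ≤ (3/B)|∫_{B/2}^{t₀}(2t₀)^β e^{−t²/(2h²)}dt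
  + ∫_{t₀}^∞ (2t)^β e^{−t²/(2h²)}dt|. The result follows from Lemma A.1.» — `platt2017_lemmaA11`
  (explicit `ζ`-hypothesis on `[3, ∞)`, any `A ≤ 3/4`), `platt2017_lemmaA11_of_plattTrudgian2015`
  (hypothesis (A.2) verbatim), `platt2017_lemmaA11_of_hpy` (from `zeta_half_line_hiary_patel_yang`):
  **PROVED, BOTH TAILS**, for real `x` with `|x| ≤ B/2` (covers `x = (n−N/2)/A`). The right tail is the
  printed argument (`Platt2017.lattice_two_sided` + `profile_antitone` + Lemma A.1 with `κ = 0` and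
  `κ = β`; the proof yields `2^{(β−1)/2}` where `Z` prints the larger `2^{β−1/2}` — the printed `Z` is
  kept). The LEFT tail («the right tail majorizes the left», asserted without proof; Lemma A.10 does not
  apply at `t < 0`) is `Platt2017.norm_Lambda_reflected_le`: the profile `3(|t|+t₀)^β e^{−t²/(2h²)}`
  dominates `|f(t)|` for `t ≤ 0` too — by the `ζ`-bound at the reflected ordinate when `|t+t₀| ≥ 3`
  (`|ζ(1/2−iv)| = |ζ(1/2+iv)|`, Mathlib `riemannZeta_conj`) and by `|ζ(1/2+iv)| ≤ 3.33` for `|v| ≤ 3`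
  (the tree's `norm_riemannZeta_half_line_le_of_abs_le_one` and certified Riemann–Siegel runs
  `norm_riemannZeta_half_le_of_le_404`) together with `(s+t₀)^β ≥ 27^{1/6} log t₀ ≥ 1.732·2.718` when
  `|t₀ − s| ≤ 3` (`e^e ≥ 15`, `Platt2017.fifteen_le_exp_exp_one`).
* **Lemma B.2** (p. 2464). «Let `w ∈ [−ξ, ξ]`. Then we have
  `|Σ_{k=K}^∞ G^{(k)}(u) w^k/k!| ≤ 2^{K+5/2} π^{K+1/2} h^{K+1} ξ^K / Γ((K+2)/2)`. *Proof.*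
  `… ≤ sup_{u'∈(u−ξ,u+ξ]} |G^{(K)}(u') ξ^K/K!| ≤ sup |∫ g(t;K) ξ^K e(−u't)/K! dt| ≤ 8∫_0^∞ (2πtξ)^K/K!
  exp(−t²/(2h²)) dt = 2^{(3K+5)/2} π^K ξ^K h^{K+1} Γ((K+1)/2)/Γ(K+1)`, and the result follows from the
  duplication formula for `Γ`.» — typed in three pieces: `platt2017_lemmaB2_moment` (the displayed
  Gaussian-moment evaluation, PROVED), `platt2017_lemmaB2_duplication` (the duplication step: the
  computation gives `2^{(K+5)/2} π^{K+1/2} h^{K+1} ξ^K/Γ((K+2)/2)`, which is `≤` the printed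
  `2^{K+5/2} …` — the printed exponent is the weaker one; recorded), and `platt2017_lemmaB2_of_bound`
  (`∫_ℝ ‖g(t)‖ |w|^K/K! dt ≤` the printed right-hand side for any `g` under the Lemma A.4 bound and
  `|w| ≤ ξ`). NOT typed: the identification of the Taylor tail with `G^{(K)}(u') w^K/K!` and of `G^{(K)}`
  with the Fourier transform of `g(·;K)`. Also `platt2017_sum_inv_sqrt_le`: `Σ_{j=1}^J 1/√j ≤ 2√J − 1`
  («we multiply it by `2√J − 1`», p. 2464).
* **Lemma C.2** (p. 2465; `W(t) := Λ(t) exp(πt/4 − (t−t₀)²/(2H²))`, p. 2464). «Let `t ≥ e` and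
  `β = 1/6 + log log t / log t`. Then we have `|W(t)| ≤ 3 t^β exp(−(t−t₀)²/(2H²))`. *Proof.* The
  proof is almost identical to that of Lemma A.10.» — `platt2017_lemmaC2` (explicit `ζ`-hypothesis on
  `[T, ∞)`, `T > 1`, any `A ≤ 3/4`; here `t^β = t^{1/6} log t` exactly, `Platt2017.rpow_loglog_div_log_self`),
  `platt2017_lemmaC2_of_plattTrudgian2015` (as printed: `t ≥ e`, hypothesis (A.2) verbatim),
  `platt2017_lemmaC2_of_hpy` (from `zeta_half_line_hiary_patel_yang`, hence for `t ≥ 3` only — the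
  HPY fact starts at `3 > e`; recorded, not hidden).

* **Lemma C.3** (p. 2465; `W(t) := Λ(t) exp(πt/4 − (t−t₀)²/(2H²))`, p. 2464). «Let `t₀ > exp(e)` and
  `β = 1/6 + log log t₀/log t₀`. Then given `N_s ∈ ℤ_{>0}` with `N_s ≤ t₀A` we have
  `|Σ_{|n − t₀A| > N_s} W(n/A) sinc(A(n/A − t₀))| ≤ (6A/(πN_s))(X + Y + Z)`, where
  `X = (t₀ + N_s/A)^β exp(−N_s²/(2A²h²))`, `Y = 2^{2β−1/2} t₀^β A·H·Γ(1/2, N_s²/(2A²H²))`, and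
  `Z = 2^{3β−1/2} A·H^{β+1} Γ((β+1)/2, t₀²/(2H²))`. *Proof.* The right tail majorizes the left and the
  first term missing is less in absolute terms than `|W(t₀ + N_s/A) sinc(N_s/A)|` which is less then
  `(3A/(πN_s))(t₀+N_s/A)^β exp(−N_s²/(2A²H²))`. Now, since our bound for `W` is decreasing, we can
  majorize the rest of the tail with the integral …» — `platt2017_lemmaC3` (**both tails PROVED**, with
  the sharper constant `6/(πN_s)` the argument yields: `|sinc(A(n/A−t₀))| ≤ 1/(π|n − At₀|) < 1/(πN_s)`),
  `platt2017_lemmaC3_printed` (the printed `6A/(πN_s)`, for `A ≥ 1`), `platt2017_lemmaC3_of_plattTrudgian2015`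
  (hypothesis (A.2) verbatim, printed constant), `platt2017_lemmaC3_of_hpy`. Sum over the subtype
  `{n : ℤ // N_s < |n − At₀|}`, `sinc = Real.sinc(π·)`, `W` written out. RECORDED: the printed `X` has `h`
  for `H` (typo; the proof's display has `H`); the printed `Y`, `Z` exponents `2^{2β−1/2}`, `2^{3β−1/2}`
  exceed the proof's `2^{β−1/2}`, `2^{(3β−1)/2}` (printed kept); «our bound for `W` is decreasing» needs
  the proviso `βH²/t₀ ≤ N_s/A` (explicit hypothesis here; not printed); the left tail is
  `Platt2017.norm_Lambda_reflected_le` again; the right tail is Lemma A.10's bound at `h = H`.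

## Main results

* `platt2017_lemmaA1`, `platt2017_lemmaA2`, `platt2017_lemmaA3_corrected`, `platt2017_lemmaA4`,
  `platt2017_lemmaA5` (`_of_bound`),
  `platt2017_lemmaA10`
  (`_of_plattTrudgian2015`, `_of_hpy`), `platt2017_lemmaA11` (`_of_plattTrudgian2015`, `_of_hpy`),
  `platt2017_lemmaB2_moment`, `platt2017_lemmaB2_duplication`, `platt2017_lemmaB2_of_bound`,
  `platt2017_sum_inv_sqrt_le`, `platt2017_lemmaC2` (`_of_plattTrudgian2015`, `_of_hpy`), `platt2017_lemmaC3`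
  (`_printed`, `_of_plattTrudgian2015`, `_of_hpy`) (namespace `Literature.NumberTheory.LFunctions`).
* Engine `Platt2017.*`: `im_digamma_le_half_pi` (**`Im ψ(w) ≤ π/2` for `Re w ≥ 1`**),
  `norm_Gamma_mul_exp_monotone` (**`τ ↦ |Γ((σ+iτ)/2)| e^{πτ/4}` nondecreasing, `σ ≥ 2`**),
  `norm_Gamma_half_line_mul_exp_lt_four` (**`|Γ((1/2+ix)/2)| e^{πx/4} < 4`,
  all real `x`**), `norm_Gamma_quarter_mul_exp_le_of_nonpos` / `_of_le` / `_of_ge` (the three ranges: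
  `≤ 3.632`, `≤ 3.999`, `≤ 3.8`),
  `Gamma_midpoint_sq_le` (`Γ((a+b)/2)² ≤ Γ(a)Γ(b)`), `Gamma_nine_quarters_le` (`Γ(9/4) ≤ 1.1347`),
  `Gamma_one_quarter_le` (`Γ(1/4) ≤ 3.632`), `log_le_rpow_loglog`, `rpow_loglog_div_log_self`,
  `norm_pi_cpow_neg_I_mul` (`|π^{−iu/2}| = 1`), `tsum_lattice_le` (**lattice-tail engine**:
  `Φ ≥ 0` antitone and integrable on `[a,∞)` ⇒ `Σ_{m≥0} Φ(a+mB) ≤ Φ(a) + B⁻¹∫_a^∞ Φ`),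
  `pow_mul_exp_antitone` (`s^k e^{−s²/(2h²)}` decreasing past `h√k`), `lattice_two_sided` (two-sided
  lattice sums from a pointwise majorant `‖F(t)‖ ≤ P(|t|)`), `profile_antitone` (`(s+t₀)^β e^{−s²/(2h²)}`
  decreasing on `[B/2,∞)` when `βh² ≤ (B/2)t₀`), `norm_Lambda_reflected_le` (the left-tail domination),
  `profile_integrableOn` / `integral_profile_le` (the majorizing integral
  `∫_a^∞ 3(s+t₀)^β e^{−s²/(2H²)} ≤ 3[(2t₀)^β 2^{−1/2}HΓ(1/2, a²/(2H²)) + 2^β 2^{(β−1)/2}H^{β+1}Γ((β+1)/2, t₀²/(2H²))]`),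
  `norm_zeta_half_le_of_abs_le_three` (`|ζ(1/2+iv)| ≤ 3.33`, `|v| ≤ 3`; private: `norm_zeta_half_neg`,
  `rpow_sixth_mul_log_mono`, `fifteen_le_exp_exp_one`), `cell'` (one mesh cell with a parameter `G ≥ Γ(σ+2)`;
  `GammaFactorBound.cell` has `Γ(σ+2) ≤ σ+1` built in, too weak for the constant `4`), and the
  private rational exponential enclosures `exp_le_taylor`, `exp_le_taylor'`, `exp_pi_mul_le`,
  `exp_pi_mul_le'` (copies of the private lemmas of `CertifiedLFunctionGammaFactorBound.lean`).

## Deliberately NOT here (gap recorded, no silent weakening)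

Lemmas A.6–A.9, B.1 and C.1 (contour
shifts of the Fourier transforms `G^{(k)}`, `F` past the pole of `ζ` — the `ζ`-analogues of Platt 2016
Lemma 8.5, cf. `CertifiedLFunctionWindowAliasingBound.lean`; their Gamma-side input Lemma A.3 IS here),
and of Lemma B.2 only the Taylor-tail /
Fourier-derivative identification (its Gaussian moment and duplication step are here) — i.e. the contour-shift
family only; EVERY sampling-tail lemma of the paper (A.5, A.11, C.3) and every
Gamma-side or growth lemma (A.1, A.2, A.3 (corrected), A.4, A.10, C.2) is a theorem of this file. The Platt–Trudgian 2015 bound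
`|ζ(1/2+it)| ≤ 0.732 t^{1/6} log t` ((A.2) of the paper, [22]) is not typed as a named fact (the tree
carries the stronger Hiary–Patel–Yang 2024 bound `zeta_half_line_hiary_patel_yang`); Lemmas A.10/C.2
take it as an explicit hypothesis. §4 Theorems 4.1–4.2 (Turing's method) are the tree's `TuringMethod.lean`
(`abs_integral_zetaArgS_le_trudgian`), Theorems 4.3–4.4 (Whittaker–Shannon, Weiss) the tree's
`CertifiedLFunctionUpsampling.lean`, Lemma 3.1 (DFT pair by Poisson summation) the pattern of
`CertifiedLFunctionDFTPair.lean`; Theorem 5.1 (RH and simplicity to height `3.0610046·10¹⁰`) is a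
computation.

`lean search` / `rg` (2026-08-28): no declaration of the tree mentions Lemma A.1/A.2/A.4 of Platt 2017
or the constant `(1+2√2)/6`; `Platt 2017` occurs in ≈ 10 docstrings (`TuringMethod`,
`ZetaZeroCountExplicit`, `NamedHypothesesProofs`, …) only as the zero database / the height
`3.06·10¹⁰`. Reused: `GammaFactorBound.norm_Gamma_le_shift_two`, `GammaFactorBound.log_norm_Gamma_add_le`
(`CertifiedLFunctionGammaFactorBound.lean`), `GammaStirling.abs_log_norm_Gamma_sub_le`
(`GammaStirlingUniform.lean`), `GammaVert.norm_Gamma_le_Gamma_re` (`GammaVerticalBounds.lean`),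
`TimeAliasing.hasSum_im_digamma`, `TimeAliasing.hasDerivAt_log_norm_Gamma`
(`CertifiedLFunctionTimeAliasingBound.lean`),
`upperIncGamma` / `integrableOn_upperIncGamma_integrand` (`ZetaZeroReciprocalSumsExplicit.lean`),
`Zagier2012.Real_Gamma_add_nat` (`EulerTailProduct.lean`: `Γ(x+n) = Γ(x)∏_{j<n}(x+j)`);
Mathlib: `Real.convexOn_log_Gamma`, `Real.Gamma_nat_eq_factorial`, `Real.Gamma_one_half_eq`,
`integral_comp_mul_deriv_Ioi`, `integrable_rpow_mul_exp_neg_mul_sq`, `Complex.tan_arg`, `Real.le_tan`,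
`Real.exp_bound'`, `Real.one_sub_inv_le_log_of_pos`, `Real.pi_lt_d4`, `Real.exp_one_lt_d9`,
`Real.log_div_self_antitoneOn`, `Complex.norm_cpow_eq_rpow_re_of_pos`, `AntitoneOn.sum_le_integral`,
`intervalIntegral.integral_comp_mul_add`, `summable_of_sum_range_le`, `Real.tsum_le_of_sum_range_le`,
`Summable.of_nat_of_neg_add_one`, `tsum_of_nat_of_neg_add_one`, `tsum_of_norm_bounded`, `riemannZeta_conj`,
`setIntegral_union`, `Real.pow_rpow_inv_natCast`, `Real.sinc_of_ne_zero`, `Int.floor_lt`, `Int.lt_ceil`,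
`integral_rpow_mul_exp_neg_mul_rpow`, `integral_comp_abs`, `Real.Gamma_mul_Gamma_add_half`,
`summable_of_sum_le`, `Real.tsum_le_of_sum_le`, `monotone_of_deriv_nonneg`, `monotoneOn_of_deriv_nonneg`,
`integral_gaussian_Ioi`, `add_pow`, `HasSum.nonpos`, `Finset.sum_range_sub`, `Finset.sum_image` (the subtype-sum pattern of
`CertifiedLFunctionUpsamplingTruncation.lean`, whose helper lemmas are private/profile-specific); `norm_riemannZeta_half_line_le_of_abs_le_one`
(`LehmanCriticalLineBound.lean`), `norm_riemannZeta_half_le_of_le_404` (`LehmanCriticalLineBoundProofs.lean`); `zeta_half_line_hiary_patel_yang`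
(`ZetaHalfLineHiaryPatelYang.lean`). The constant `0.732` occurs in the tree only inside inline hypotheses of
`TuringMethodTrudgianIINumerics*.lean` (no named fact).

## References

* [Platt2017] D. J. Platt, *Isolating some non-trivial zeros of zeta*, Math. Comp. 86 (2017),
  no. 307, 2449–2467, doi:10.1090/mcom/3198 — Appendix A, Lemmas A.1 (p. 2456), A.2 (p. 2457),
  A.3 (p. 2457, proof p. 2458),
  A.4 (pp. 2458–2459), A.5 (p. 2459), A.10 (p. 2462), A.11 (p. 2463); Appendix B, Lemma B.2 (p. 2464);
  Appendix C, Lemmas C.2, C.3 (p. 2465);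
  §5 p. 2456
  (the parameters `N, A, B, h, J, K, H`).
* [PlattTrudgianBLMS2021] D. Platt, T. Trudgian, *The Riemann hypothesis is true up to `3·10¹²`*,
  Bull. Lond. Math. Soc. 53 (2021) 792–797, doi:10.1112/blms.12460 — §2 (the instrument is [Platt2017];
  «A.2 in [21]»).
* D. J. Platt, T. S. Trudgian, *An improved explicit bound on `|ζ(1/2+it)|`*, J. Number Theory 147
  (2015) 842–851 (= [22] of [Platt2017]; the input (A.2) of Lemmas A.10/C.2, taken as a hypothesis).
* [HiaryPatelYang2024] G. A. Hiary, D. Patel, A. Yang, *An improved explicit estimate for `ζ(1/2+it)`*,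
  J. Number Theory 256 (2024) 195–217, Thm. 1.1 (via `ZetaHalfLineHiaryPatelYang.lean`).
* [AndrewsAskeyRoy1999] G. E. Andrews, R. Askey, R. Roy, *Special Functions* (1999), Thm 1.2.5
  (1.2.13) (the series for `ψ`, via `CertifiedLFunctionTimeAliasingBound.lean`).
* E. T. Whittaker, G. N. Watson, *A Course of Modern Analysis*, 4th ed. (1927), §12.33
  (Stirling / Binet, via `GammaStirlingUniform.lean`); DLMF §5.5, §5.6, §8.2.
-/

noncomputable section

open Complex Real Set MeasureTheory Filter
open scoped ComplexConjugate

namespace Literature.NumberTheory.LFunctions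

namespace Platt2017

open GammaFactorBound (norm_Gamma_le_shift_two log_norm_Gamma_add_le)
open Literature.NumberTheory.Transcendental.Zagier2012 (Real_Gamma_add_nat)
open Literature.Analysis.SpecialFunctions.GammaStirling (abs_log_norm_Gamma_sub_le)

/-! ### The enclosure `Γ(9/4) ≤ 1.1347` (shift `Γ(x+n) = Γ(x)∏_{j<n}(x+j)` = the tree's `Zagier2012.Real_Gamma_add_nat`) -/

/-- Log-convexity of `Γ` at a midpoint: `Γ((a+b)/2)² ≤ Γ(a) Γ(b)` for `a, b > 0` (Mathlib
`Real.convexOn_log_Gamma`). [cite: DLMF, §5.5(iv) (Bohr–Mollerup: log Γ convex)] -/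
theorem Gamma_midpoint_sq_le {a b : ℝ} (ha : 0 < a) (hb : 0 < b) :
    Real.Gamma ((a + b) / 2) ^ 2 ≤ Real.Gamma a * Real.Gamma b := by
  have h := Real.convexOn_log_Gamma.2 (mem_Ioi.mpr ha) (mem_Ioi.mpr hb)
    (by norm_num : (0 : ℝ) ≤ 1 / 2) (by norm_num : (0 : ℝ) ≤ 1 / 2) (by norm_num)
  simp only [Function.comp_apply, smul_eq_mul] at h
  have hab : (1 / 2 : ℝ) * a + 1 / 2 * b = (a + b) / 2 := by ring
  rw [hab] at h
  have hGa := Real.Gamma_pos_of_pos ha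
  have hGb := Real.Gamma_pos_of_pos hb
  have hGm := Real.Gamma_pos_of_pos (by positivity : (0 : ℝ) < (a + b) / 2)
  have h2 : Real.log (Real.Gamma ((a + b) / 2) ^ 2) ≤ Real.log (Real.Gamma a * Real.Gamma b) := by
    rw [Real.log_pow, Real.log_mul hGa.ne' hGb.ne']
    push_cast
    linarith
  exact (Real.log_le_log_iff (by positivity) (by positivity)).mp h2

/-- **`Γ(9/4) ≤ 1.1347`** (true value `1.13300…`): `Γ(9/4) ∏_{j<20}(9/4+j) = Γ(89/4)` and
`Γ(89/4)² ≤ Γ(22) Γ(45/2) = 21! · √π ∏_{j<22}(1/2+j)` (log-convexity at the midpoint of `22` and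
`45/2`), with `√π ≤ 1.77246`; the resulting rational inequality is closed by `norm_num`.
[cite: DLMF, Eq. 5.5.1 and §5.5(iv)] -/
theorem Gamma_nine_quarters_le : Real.Gamma (9 / 4) ≤ 1.1347 := by
  have hP := Real_Gamma_add_nat (x := 9 / 4) (by norm_num) 20
  have h89 : (9 / 4 : ℝ) + (20 : ℕ) = 89 / 4 := by norm_num
  rw [h89] at hP
  have hPval : ∏ j ∈ Finset.range 20, ((9 / 4 : ℝ) + j) =
      106920439789984738773335070215625 / 1099511627776 := by
    simp only [Finset.prod_range_succ, Finset.prod_range_zero]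
    norm_num
  have h22 : Real.Gamma 22 = Nat.factorial 21 := by
    rw [show (22 : ℝ) = (21 : ℕ) + 1 by norm_num, Real.Gamma_nat_eq_factorial]
  have hQ := Real_Gamma_add_nat (x := 1 / 2) (by norm_num) 22
  have h45 : (1 / 2 : ℝ) + (22 : ℕ) = 45 / 2 := by norm_num
  rw [h45, Real.Gamma_one_half_eq] at hQ
  have hQval : ∏ j ∈ Finset.range 22, ((1 / 2 : ℝ) + j) =
      563862029680583509947946875 / 4194304 := by
    simp only [Finset.prod_range_succ, Finset.prod_range_zero]
    norm_num
  have hmid := Gamma_midpoint_sq_le (a := 22) (b := 45 / 2) (by norm_num) (by norm_num)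
  rw [show ((22 : ℝ) + 45 / 2) / 2 = 89 / 4 by norm_num, hP, h22, hQ, hPval, hQval] at hmid
  have hsqrtpi : Real.sqrt π ≤ 1.77246 := by
    have h1 : Real.sqrt π ≤ Real.sqrt (1.77246 ^ 2) :=
      Real.sqrt_le_sqrt (by nlinarith [Real.pi_lt_d4])
    rwa [Real.sqrt_sq (by norm_num)] at h1
  have hfac : (Nat.factorial 21 : ℝ) = 51090942171709440000 := by norm_num [Nat.factorial]
  rw [hfac] at hmid
  have hG0 : 0 ≤ Real.Gamma (9 / 4) := (Real.Gamma_pos_of_pos (by norm_num)).le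
  have hsq : Real.Gamma (9 / 4) ^ 2 ≤ (1.1347 : ℝ) ^ 2 := by
    nlinarith [hmid, hsqrtpi, Real.sqrt_nonneg π, sq_nonneg (Real.Gamma (9 / 4))]
  exact (pow_le_pow_iff_left₀ hG0 (by norm_num) two_ne_zero).mp hsq

/-- `Γ(1/4) ≤ 3.632` (true value `3.6256…`): `Γ(9/4) = (5/4)(1/4) Γ(1/4)`.
[cite: DLMF, Eq. 5.5.1] -/
theorem Gamma_one_quarter_le : Real.Gamma (1 / 4) ≤ 3.632 := by
  have h := Real_Gamma_add_nat (x := 1 / 4) (by norm_num) 2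
  rw [show (1 / 4 : ℝ) + (2 : ℕ) = 9 / 4 by norm_num] at h
  simp only [Finset.prod_range_succ, Finset.prod_range_zero] at h
  norm_num at h
  have h94 := Gamma_nine_quarters_le
  rw [h] at h94
  linarith

/-! ### One mesh cell with an explicit bound `G ≥ Γ(σ+2)` -/

/-- **One mesh cell** (variant of `GammaFactorBound.cell` with the constant `Γ(σ+2) ≤ G` as a
parameter): for `σ > 0`, `0 ≤ u ≤ t ≤ v`, `E ≥ e^{πv/4}`, `K ≥ 0` and
`(G E)² ≤ K² (σ²+u²/4)((σ+1)²+u²/4)`: `‖Γ(σ+it/2)‖ e^{πt/4} ≤ K` (`|Γ(w)| = |Γ(w+2)|/(|w||w+1|)`,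
`|Γ(w+2)| ≤ Γ(σ+2) ≤ G`, each factor monotone in `t` on the cell).
[cite: Platt2017, Lemma A.4 p. 2459 (the «trivial bound» |Γ((1/2+ix)/2)|e^{πx/4} < 4, execution)] -/
theorem cell' {σ t u v E K G : ℝ} (hσ : 0 < σ) (hu : 0 ≤ u) (hut : u ≤ t) (htv : t ≤ v)
    (hG : Real.Gamma (σ + 2) ≤ G) (hE : Real.exp (π * v / 4) ≤ E) (hK : 0 ≤ K)
    (hnum : (G * E) ^ 2 ≤ K ^ 2 * ((σ ^ 2 + u ^ 2 / 4) * ((σ + 1) ^ 2 + u ^ 2 / 4))) :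
    ‖Complex.Gamma (((σ : ℝ) : ℂ) + ((t / 2 : ℝ) : ℂ) * I)‖ * Real.exp (π * t / 4) ≤ K := by
  have ht0 : 0 ≤ t := hu.trans hut
  have hE0 : 0 ≤ E := (Real.exp_pos _).le.trans hE
  have hG0 : 0 ≤ G := (Real.Gamma_pos_of_pos (by linarith)).le.trans hG
  set Q : ℝ := (σ ^ 2 + (t / 2) ^ 2) * ((σ + 1) ^ 2 + (t / 2) ^ 2) with hQ
  set Qu : ℝ := (σ ^ 2 + u ^ 2 / 4) * ((σ + 1) ^ 2 + u ^ 2 / 4) with hQu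
  have hQu0 : 0 < Qu := by positivity
  have hQuQ : Qu ≤ Q := by
    have h1 : u ^ 2 / 4 ≤ (t / 2) ^ 2 := by nlinarith
    calc Qu = (σ ^ 2 + u ^ 2 / 4) * ((σ + 1) ^ 2 + u ^ 2 / 4) := rfl
      _ ≤ (σ ^ 2 + u ^ 2 / 4) * ((σ + 1) ^ 2 + (t / 2) ^ 2) := by gcongr
      _ ≤ (σ ^ 2 + (t / 2) ^ 2) * ((σ + 1) ^ 2 + (t / 2) ^ 2) := by gcongr
  have hQ0 : 0 < Q := hQu0.trans_le hQuQ
  have hsQ : 0 < Real.sqrt Q := Real.sqrt_pos.mpr hQ0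
  have hΓ : ‖Complex.Gamma (((σ : ℝ) : ℂ) + ((t / 2 : ℝ) : ℂ) * I)‖ ≤ G / Real.sqrt Q := by
    have h := norm_Gamma_le_shift_two hσ (t / 2)
    rw [← Real.sqrt_mul (by positivity)] at h
    refine h.trans ?_
    gcongr
  have hKE : G * E ≤ K * Real.sqrt Q := by
    have h1 : G * E ≤ Real.sqrt (K ^ 2 * Qu) := by
      rw [Real.le_sqrt (by positivity) (by positivity)]
      exact hnum
    rw [Real.sqrt_mul' _ hQu0.le, Real.sqrt_sq hK] at h1
    exact h1.trans (by gcongr)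
  have hexp : Real.exp (π * t / 4) ≤ E :=
    (Real.exp_le_exp.mpr (by gcongr)).trans hE
  calc ‖Complex.Gamma (((σ : ℝ) : ℂ) + ((t / 2 : ℝ) : ℂ) * I)‖ * Real.exp (π * t / 4)
      ≤ G / Real.sqrt Q * E := mul_le_mul hΓ hexp (Real.exp_pos _).le (by positivity)
    _ = G * E / Real.sqrt Q := by ring
    _ ≤ K * Real.sqrt Q / Real.sqrt Q := by gcongr
    _ = K := by field_simp

/-! ### Rational enclosures of `e^x` (private, as in `CertifiedLFunctionGammaFactorBound`) -/

/-- `e^x ≤ 1 + x + x²/2 + x³/6 + x⁴/24 + x⁵/100` for `0 ≤ x ≤ 1` (Mathlib's `Real.exp_bound'`,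
`n = 5`). [folklore] -/
private theorem exp_le_taylor {x : ℝ} (h0 : 0 ≤ x) (h1 : x ≤ 1) :
    Real.exp x ≤ 1 + x + x ^ 2 / 2 + x ^ 3 / 6 + x ^ 4 / 24 + x ^ 5 / 100 := by
  have h := Real.exp_bound' h0 h1 (n := 5) (by norm_num)
  have hs : ∑ m ∈ Finset.range 5, x ^ m / (m.factorial : ℝ) =
      1 + x + x ^ 2 / 2 + x ^ 3 / 6 + x ^ 4 / 24 := by
    simp only [Finset.sum_range_succ, Finset.sum_range_zero, Nat.factorial]
    norm_num
  rw [hs] at h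
  refine h.trans (le_of_eq ?_)
  norm_num [Nat.factorial]
  ring

/-- `e^x ≤ 2.7182818286 · (1 + y + y²/2 + y³/6 + y⁴/24 + y⁵/100)`, `y = x − 1`, for `1 ≤ x ≤ 2`.
[folklore] -/
private theorem exp_le_taylor' {x : ℝ} (h1 : 1 ≤ x) (h2 : x ≤ 2) :
    Real.exp x ≤ 2.7182818286 * (1 + (x - 1) + (x - 1) ^ 2 / 2 + (x - 1) ^ 3 / 6 +
      (x - 1) ^ 4 / 24 + (x - 1) ^ 5 / 100) := by
  have h := exp_le_taylor (x := x - 1) (by linarith) (by linarith)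
  have he : Real.exp x = Real.exp 1 * Real.exp (x - 1) := by
    rw [← Real.exp_add]; ring_nf
  rw [he]
  exact mul_le_mul Real.exp_one_lt_d9.le h (Real.exp_pos _).le (by norm_num)

/-- `e^{πv/4} ≤ 1 + x + … + x⁵/100` whenever `3.1416 v/4 ≤ x ≤ 1`, `v ≥ 0`. [folklore] -/
private theorem exp_pi_mul_le {v x : ℝ} (hv : 0 ≤ v) (hx : 3.1416 * v / 4 ≤ x) (hx1 : x ≤ 1) :
    Real.exp (π * v / 4) ≤ 1 + x + x ^ 2 / 2 + x ^ 3 / 6 + x ^ 4 / 24 + x ^ 5 / 100 := by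
  have hπ := Real.pi_lt_d4
  have h0 : 0 ≤ x := le_trans (by positivity) hx
  have hle : π * v / 4 ≤ x := by nlinarith
  exact (Real.exp_le_exp.mpr hle).trans (exp_le_taylor h0 hx1)

/-- `e^{πv/4} ≤ 2.7182818286 · (1 + (x−1) + …)` whenever `3.1416 v/4 ≤ x`, `1 ≤ x ≤ 2`, `v ≥ 0`.
[folklore] -/
private theorem exp_pi_mul_le' {v x : ℝ} (hv : 0 ≤ v) (hx : 3.1416 * v / 4 ≤ x) (hx1 : 1 ≤ x)
    (hx2 : x ≤ 2) :
    Real.exp (π * v / 4) ≤ 2.7182818286 * (1 + (x - 1) + (x - 1) ^ 2 / 2 + (x - 1) ^ 3 / 6 +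
      (x - 1) ^ 4 / 24 + (x - 1) ^ 5 / 100) := by
  have hπ := Real.pi_lt_d4
  have hle : π * v / 4 ≤ x := by nlinarith
  exact (Real.exp_le_exp.mpr hle).trans (exp_le_taylor' hx1 hx2)

/-! ### `|Γ(1/4 + it/2)| e^{πt/4}` on `0 ≤ t ≤ 7/5`: nineteen mesh cells -/

/-- For `0 ≤ t ≤ 7/5`: `‖Γ(1/4+it/2)‖ e^{πt/4} ≤ 3.999`, by nineteen cells of `cell'` with
`Γ(9/4) ≤ 1.1347` (breakpoints `0, .122, .161, .188, .21, .23, .25, .271, .294, .32, .351, .39, .44,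
.507, .598, .723, .892, 1.11, 1.37, 1.4`; the true maximum of the left side is `3.9163…` at
`t ≈ 0.213`). [cite: Platt2017, Lemma A.4 p. 2459 (trivial bound, case 0 ≤ x ≤ 7/5)] -/
theorem norm_Gamma_quarter_mul_exp_le_of_le {t : ℝ} (ht0 : 0 ≤ t) (ht1 : t ≤ 7 / 5) :
    ‖Complex.Gamma ((((1 / 4 : ℝ)) : ℂ) + ((t / 2 : ℝ) : ℂ) * I)‖ * Real.exp (π * t / 4) ≤ 3.999 := by
  have hσ : (0 : ℝ) < 1 / 4 := by norm_num
  have hK : (0 : ℝ) ≤ 3.999 := by norm_num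
  have hG94 : Real.Gamma ((1 / 4 : ℝ) + 2) ≤ 1.1347 := by
    rw [show (1 / 4 : ℝ) + 2 = 9 / 4 by norm_num]; exact Gamma_nine_quarters_le
  rcases le_or_gt t (61 / 500) with h1 | h1
  · exact cell' hσ le_rfl ht0 h1 hG94
      (exp_pi_mul_le (x := 3.1416 * (61 / 500) / 4) (by norm_num) le_rfl (by norm_num)) hK (by norm_num)
  rcases le_or_gt t (161 / 1000) with h2 | h2
  · exact cell' hσ (by norm_num) h1.le h2 hG94
      (exp_pi_mul_le (x := 3.1416 * (161 / 1000) / 4) (by norm_num) le_rfl (by norm_num)) hK (by norm_num)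
  rcases le_or_gt t (47 / 250) with h3 | h3
  · exact cell' hσ (by norm_num) h2.le h3 hG94
      (exp_pi_mul_le (x := 3.1416 * (47 / 250) / 4) (by norm_num) le_rfl (by norm_num)) hK (by norm_num)
  rcases le_or_gt t (21 / 100) with h4 | h4
  · exact cell' hσ (by norm_num) h3.le h4 hG94
      (exp_pi_mul_le (x := 3.1416 * (21 / 100) / 4) (by norm_num) le_rfl (by norm_num)) hK (by norm_num)
  rcases le_or_gt t (23 / 100) with h5 | h5
  · exact cell' hσ (by norm_num) h4.le h5 hG94
      (exp_pi_mul_le (x := 3.1416 * (23 / 100) / 4) (by norm_num) le_rfl (by norm_num)) hK (by norm_num)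
  rcases le_or_gt t (1 / 4) with h6 | h6
  · exact cell' hσ (by norm_num) h5.le h6 hG94
      (exp_pi_mul_le (x := 3.1416 * (1 / 4) / 4) (by norm_num) le_rfl (by norm_num)) hK (by norm_num)
  rcases le_or_gt t (271 / 1000) with h7 | h7
  · exact cell' hσ (by norm_num) h6.le h7 hG94
      (exp_pi_mul_le (x := 3.1416 * (271 / 1000) / 4) (by norm_num) le_rfl (by norm_num)) hK (by norm_num)
  rcases le_or_gt t (147 / 500) with h8 | h8
  · exact cell' hσ (by norm_num) h7.le h8 hG94
      (exp_pi_mul_le (x := 3.1416 * (147 / 500) / 4) (by norm_num) le_rfl (by norm_num)) hK (by norm_num)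
  rcases le_or_gt t (8 / 25) with h9 | h9
  · exact cell' hσ (by norm_num) h8.le h9 hG94
      (exp_pi_mul_le (x := 3.1416 * (8 / 25) / 4) (by norm_num) le_rfl (by norm_num)) hK (by norm_num)
  rcases le_or_gt t (351 / 1000) with h10 | h10
  · exact cell' hσ (by norm_num) h9.le h10 hG94
      (exp_pi_mul_le (x := 3.1416 * (351 / 1000) / 4) (by norm_num) le_rfl (by norm_num)) hK (by norm_num)
  rcases le_or_gt t (39 / 100) with h11 | h11
  · exact cell' hσ (by norm_num) h10.le h11 hG94
      (exp_pi_mul_le (x := 3.1416 * (39 / 100) / 4) (by norm_num) le_rfl (by norm_num)) hK (by norm_num)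
  rcases le_or_gt t (11 / 25) with h12 | h12
  · exact cell' hσ (by norm_num) h11.le h12 hG94
      (exp_pi_mul_le (x := 3.1416 * (11 / 25) / 4) (by norm_num) le_rfl (by norm_num)) hK (by norm_num)
  rcases le_or_gt t (507 / 1000) with h13 | h13
  · exact cell' hσ (by norm_num) h12.le h13 hG94
      (exp_pi_mul_le (x := 3.1416 * (507 / 1000) / 4) (by norm_num) le_rfl (by norm_num)) hK (by norm_num)
  rcases le_or_gt t (299 / 500) with h14 | h14
  · exact cell' hσ (by norm_num) h13.le h14 hG94
      (exp_pi_mul_le (x := 3.1416 * (299 / 500) / 4) (by norm_num) le_rfl (by norm_num)) hK (by norm_num)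
  rcases le_or_gt t (723 / 1000) with h15 | h15
  · exact cell' hσ (by norm_num) h14.le h15 hG94
      (exp_pi_mul_le (x := 3.1416 * (723 / 1000) / 4) (by norm_num) le_rfl (by norm_num)) hK (by norm_num)
  rcases le_or_gt t (223 / 250) with h16 | h16
  · exact cell' hσ (by norm_num) h15.le h16 hG94
      (exp_pi_mul_le (x := 3.1416 * (223 / 250) / 4) (by norm_num) le_rfl (by norm_num)) hK (by norm_num)
  rcases le_or_gt t (111 / 100) with h17 | h17
  · exact cell' hσ (by norm_num) h16.le h17 hG94
      (exp_pi_mul_le (x := 3.1416 * (111 / 100) / 4) (by norm_num) le_rfl (by norm_num)) hK (by norm_num)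
  rcases le_or_gt t (137 / 100) with h18 | h18
  · exact cell' hσ (by norm_num) h17.le h18 hG94
      (exp_pi_mul_le' (x := 3.1416 * (137 / 100) / 4) (by norm_num) le_rfl (by norm_num) (by norm_num)) hK (by norm_num)
  · exact cell' hσ (by norm_num) h18.le ht1 hG94
      (exp_pi_mul_le' (x := 3.1416 * (7 / 5) / 4) (by norm_num) le_rfl (by norm_num) (by norm_num)) hK (by norm_num)
/-! ### `t ≥ 7/5`: Stirling -/

/-- For `t ≥ 7/5`: `‖Γ(1/4+it/2)‖ e^{πt/4} ≤ 3.8` — Stirling (`GammaFactorBound.log_norm_Gamma_add_le`)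
with `‖w‖ ≥ 0.7433`: `−¼ log‖w‖ ≤ ¼(1/‖w‖ − 1) ≤ 0.0864`, remainder `≤ 0.327`, and
`√(2π) e^{0.4134} ≤ 3.8`. [cite: Platt2017, Lemma A.4 p. 2459 (trivial bound, case x ≥ 7/5)] -/
theorem norm_Gamma_quarter_mul_exp_le_of_ge {t : ℝ} (ht : 7 / 5 ≤ t) :
    ‖Complex.Gamma ((((1 / 4 : ℝ)) : ℂ) + ((t / 2 : ℝ) : ℂ) * I)‖ * Real.exp (π * t / 4) ≤ 3.8 := by
  have ht0 : 0 ≤ t := by linarith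
  set n : ℝ := ‖(((1 / 4 : ℝ)) : ℂ) + ((t / 2 : ℝ) : ℂ) * I‖ with hn
  have hn_eq : n = Real.sqrt ((1 / 4) ^ 2 + (t / 2) ^ 2) := Complex.norm_add_mul_I (1 / 4) (t / 2)
  have hn_ge : 0.7433 ≤ n := by
    rw [hn_eq, Real.le_sqrt (by norm_num) (by positivity)]
    nlinarith
  have hn_pos : 0 < n := by linarith
  have hlog := log_norm_Gamma_add_le (σ := 1 / 4) (τ := t / 2) (by norm_num) (by linarith)
  rw [← hn] at hlog
  have hR : (1 / 12 : ℝ) * (1 / n ^ 2 + π / (2 * n)) ≤ 0.327 := by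
    have hπ := Real.pi_lt_d4
    have h1 : 1 / n ^ 2 ≤ 1 / 0.7433 ^ 2 := by
      apply div_le_div_of_nonneg_left (by norm_num) (by positivity)
      nlinarith
    have h2 : π / (2 * n) ≤ 3.1416 / (2 * 0.7433) := by
      rw [div_le_div_iff₀ (by positivity) (by norm_num)]
      nlinarith
    have h3 : (1 : ℝ) / 0.7433 ^ 2 ≤ 1.81 := by norm_num
    have h4 : (3.1416 : ℝ) / (2 * 0.7433) ≤ 2.1134 := by norm_num
    linarith
  -- `-(1/4) log n ≤ (1/4)(1/n - 1) ≤ 0.0864`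
  have hlogn : -(1 / 4 : ℝ) * Real.log n ≤ 0.0864 := by
    have h1 : 1 - n⁻¹ ≤ Real.log n := Real.one_sub_inv_le_log_of_pos hn_pos
    have h2 : n⁻¹ ≤ 0.7433⁻¹ := by
      rw [inv_le_inv₀ hn_pos (by norm_num)]; exact hn_ge
    have h3 : (0.7433 : ℝ)⁻¹ ≤ 1.3454 := by norm_num
    linarith
  have hmain : Real.log ‖Complex.Gamma ((((1 / 4 : ℝ)) : ℂ) + ((t / 2 : ℝ) : ℂ) * I)‖ + π * t / 4 ≤
      Real.log (2 * π) / 2 + 0.4134 := by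
    have hτ : π * (t / 2) / 2 = π * t / 4 := by ring
    rw [hτ] at hlog
    have : ((1 / 4 : ℝ) - 1 / 2) * Real.log n = -(1 / 4 : ℝ) * Real.log n := by ring
    rw [this] at hlog
    linarith
  have hpos : 0 < ‖Complex.Gamma ((((1 / 4 : ℝ)) : ℂ) + ((t / 2 : ℝ) : ℂ) * I)‖ := by
    have hre : ((((1 / 4 : ℝ)) : ℂ) + ((t / 2 : ℝ) : ℂ) * I).re = 1 / 4 := by simp
    exact norm_pos_iff.mpr (Complex.Gamma_ne_zero_of_re_pos (by rw [hre]; norm_num))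
  have heq : ‖Complex.Gamma ((((1 / 4 : ℝ)) : ℂ) + ((t / 2 : ℝ) : ℂ) * I)‖ * Real.exp (π * t / 4) =
      Real.exp (Real.log ‖Complex.Gamma ((((1 / 4 : ℝ)) : ℂ) + ((t / 2 : ℝ) : ℂ) * I)‖ + π * t / 4) := by
    rw [Real.exp_add, Real.exp_log hpos]
  rw [heq]
  have hsq : Real.exp (Real.log (2 * π) / 2) = Real.sqrt (2 * π) := by
    rw [Real.sqrt_eq_rpow, Real.rpow_def_of_pos (by positivity)]; ring_nf
  have h2π : Real.sqrt (2 * π) ≤ 2.5067 := by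
    have h1 : Real.sqrt (2 * π) ≤ Real.sqrt (2.5067 ^ 2) :=
      Real.sqrt_le_sqrt (by nlinarith [Real.pi_lt_d4])
    rwa [Real.sqrt_sq (by norm_num)] at h1
  have hexp : Real.exp 0.4134 ≤ 1.512 :=
    (exp_le_taylor (by norm_num) (by norm_num)).trans (by norm_num)
  calc Real.exp (Real.log ‖Complex.Gamma ((((1 / 4 : ℝ)) : ℂ) + ((t / 2 : ℝ) : ℂ) * I)‖ + π * t / 4)
      ≤ Real.exp (Real.log (2 * π) / 2 + 0.4134) := Real.exp_le_exp.mpr hmain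
    _ = Real.sqrt (2 * π) * Real.exp 0.4134 := by rw [Real.exp_add, hsq]
    _ ≤ 2.5067 * 1.512 := mul_le_mul h2π hexp (Real.exp_pos _).le (by norm_num)
    _ ≤ 3.8 := by norm_num

/-! ### `t ≤ 0` -/

/-- For `t ≤ 0`: `‖Γ(1/4+it/2)‖ e^{πt/4} ≤ Γ(1/4) ≤ 3.632` (`|Γ(x+iy)| ≤ Γ(x)`, `e^{πt/4} ≤ 1`).
[cite: Platt2017, Lemma A.4 p. 2459 (trivial bound, case x ≤ 0)] [cite: DLMF, Eq. 5.6.6] -/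
theorem norm_Gamma_quarter_mul_exp_le_of_nonpos {t : ℝ} (ht : t ≤ 0) :
    ‖Complex.Gamma ((((1 / 4 : ℝ)) : ℂ) + ((t / 2 : ℝ) : ℂ) * I)‖ * Real.exp (π * t / 4) ≤ 3.632 := by
  have hG : ‖Complex.Gamma ((((1 / 4 : ℝ)) : ℂ) + ((t / 2 : ℝ) : ℂ) * I)‖ ≤ 3.632 :=
    (Literature.Analysis.SpecialFunctions.GammaVert.norm_Gamma_le_Gamma_re (by norm_num) (t / 2)).trans
      Gamma_one_quarter_le
  have hexp : Real.exp (π * t / 4) ≤ 1 := by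
    rw [Real.exp_le_one_iff]
    nlinarith [Real.pi_pos]
  calc ‖Complex.Gamma ((((1 / 4 : ℝ)) : ℂ) + ((t / 2 : ℝ) : ℂ) * I)‖ * Real.exp (π * t / 4)
      ≤ 3.632 * 1 := mul_le_mul hG hexp (Real.exp_pos _).le (by norm_num)
    _ = 3.632 := mul_one _

/-! ### Lemma A.4: the trivial bound and the bound for `g(t; k)` -/

/-- **Platt 2017, proof of Lemma A.4 (p. 2459), "the trivial bound":**
`|Γ((1/2 + ix)/2)| e^{πx/4} < 4` for every real `x`. (True supremum `3.9163…` at `x ≈ 0.213`;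
`Γ(1/4) = 3.6256…` at `x = 0`.) Assembled from the three ranges above.
[cite: Platt2017, Lemma A.4 p. 2459 (proof: «the trivial bound |Γ((1/2+ix)/2)| e^{πx/4} < 4»)] -/
theorem norm_Gamma_half_line_mul_exp_lt_four (x : ℝ) :
    ‖Complex.Gamma ((1 / 2 + x * I) / 2)‖ * Real.exp (π * x / 4) < 4 := by
  have hw : (1 / 2 + x * I) / 2 = (((1 / 4 : ℝ)) : ℂ) + ((x / 2 : ℝ) : ℂ) * I := by
    push_cast; ring
  rw [hw]
  rcases le_or_gt x 0 with h0 | h0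
  · exact (norm_Gamma_quarter_mul_exp_le_of_nonpos h0).trans_lt (by norm_num)
  rcases le_or_gt x (7 / 5) with h1 | h1
  · exact (norm_Gamma_quarter_mul_exp_le_of_le h0.le h1).trans_lt (by norm_num)
  · exact (norm_Gamma_quarter_mul_exp_le_of_ge h1.le).trans_lt (by norm_num)

/-! ### The `ζ`-growth bookkeeping of Lemmas A.10 / C.2 -/

/-- For `t₀ ≥ e^e` and `u ≥ t₀`: `log u ≤ u^{log log t₀ / log t₀}` — the step
«with `(t + t₀) > exp(e)` and `β` defined as above, `(t+t₀)^{1/6} log(t+t₀) ≤ (t+t₀)^β`» of the proof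
of Lemma A.10: `x ↦ log x / x` is decreasing on `[e, ∞)` (Mathlib `Real.log_div_self_antitoneOn`),
applied to `e ≤ log t₀ ≤ log u`, then exponentiate. [cite: Platt2017, Lemma A.10 p. 2462 (proof)] -/
theorem log_le_rpow_loglog {t₀ u : ℝ} (ht₀ : Real.exp (Real.exp 1) ≤ t₀) (hu : t₀ ≤ u) :
    Real.log u ≤ u ^ (Real.log (Real.log t₀) / Real.log t₀) := by
  have he : 0 < Real.exp (Real.exp 1) := Real.exp_pos _
  have ht₀pos : 0 < t₀ := he.trans_le ht₀
  have hupos : 0 < u := ht₀pos.trans_le hu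
  have hlt₀ : Real.exp 1 ≤ Real.log t₀ := by
    have := Real.log_le_log he ht₀
    rwa [Real.log_exp] at this
  have hlul : Real.log t₀ ≤ Real.log u := Real.log_le_log ht₀pos hu
  have hlu : Real.exp 1 ≤ Real.log u := hlt₀.trans hlul
  have hlupos : 0 < Real.log u := (Real.exp_pos 1).trans_le hlu
  have hanti : Real.log (Real.log u) / Real.log u ≤ Real.log (Real.log t₀) / Real.log t₀ :=
    Real.log_div_self_antitoneOn (mem_Ici.mpr hlt₀) (mem_Ici.mpr hlu) hlul
  set c : ℝ := Real.log (Real.log t₀) / Real.log t₀ with hc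
  have h1 : Real.log (Real.log u) ≤ c * Real.log u := by
    have := (div_le_iff₀ hlupos).mp hanti
    linarith
  calc Real.log u = Real.exp (Real.log (Real.log u)) := (Real.exp_log hlupos).symm
    _ ≤ Real.exp (c * Real.log u) := Real.exp_le_exp.mpr h1
    _ = u ^ c := by rw [Real.rpow_def_of_pos hupos, mul_comm]

/-- For `u > 1`: `u^{log log u / log u} = log u` (so Lemma C.2's `t^β`, `β = 1/6 + log log t / log t`,
is `t^{1/6} log t`). [cite: Platt2017, Lemma C.2 p. 2465 (the exponent β)] -/
theorem rpow_loglog_div_log_self {u : ℝ} (hu : 1 < u) :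
    u ^ (Real.log (Real.log u) / Real.log u) = Real.log u := by
  have hupos : 0 < u := by linarith
  have hlupos : 0 < Real.log u := Real.log_pos hu
  rw [Real.rpow_def_of_pos hupos, mul_div_cancel₀ _ hlupos.ne', Real.exp_log hlupos]

/-- `‖π^{−iu/2}‖ = 1` for real `u` (the unimodular factor of `Λ(u) = π^{−iu/2} Γ((1/2+iu)/2) ζ(1/2+iu)`,
§3 p. 2450). [cite: Platt2017, §3 p. 2450 (definition of Λ)] -/
theorem norm_pi_cpow_neg_I_mul (u : ℝ) : ‖(π : ℂ) ^ (-(I * u / 2))‖ = 1 := by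
  rw [Complex.norm_cpow_eq_rpow_re_of_pos Real.pi_pos]
  have hre : (-(I * (u : ℂ) / 2)).re = 0 := by simp
  rw [hre, Real.rpow_zero]

/-- `1 < e^e`. [folklore] -/
private theorem one_lt_exp_exp_one : (1 : ℝ) < Real.exp (Real.exp 1) :=
  (Real.one_lt_exp_iff (x := Real.exp 1)).mpr (Real.exp_pos 1)

/-- `e^e ≥ 3` (`e > 2.7182818283`, `e^x ≥ 1 + x`). [folklore] -/
private theorem three_le_exp_exp_one : (3 : ℝ) ≤ Real.exp (Real.exp 1) := by
  have h1 : (2.7182818283 : ℝ) < Real.exp 1 := Real.exp_one_gt_d9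
  have h2 : Real.exp 1 + 1 ≤ Real.exp (Real.exp 1) := Real.add_one_le_exp _
  linarith

/-! ### Lattice tails of an eventually decreasing profile: `Σ_{m≥0} Φ(a+mB) ≤ Φ(a) + B⁻¹ ∫_a^∞ Φ` -/

/-- **Geometric-lattice tail bound** (the mechanism of Lemmas A.5, A.7, A.9, A.11, C.3: «we can split
off the first term and majorize the balance with an integral»): if `Φ ≥ 0` is antitone on `[a, ∞)`
and integrable there, then for `B > 0` the samples `Φ(a + mB)`, `m ≥ 0`, are summable and
`Σ_{m≥0} Φ(a + mB) ≤ Φ(a) + B⁻¹ ∫_a^∞ Φ(s) ds` (`Σ_{i<N} Φ(a+(i+1)B) ≤ ∫_0^N Φ(a+wB) dw`, Mathlib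
`AntitoneOn.sum_le_integral`). [cite: Platt2017, Lemma A.5 p. 2459 (proof)] -/
theorem tsum_lattice_le {Φ : ℝ → ℝ} {a B : ℝ} (hB : 0 < B) (hΦ0 : ∀ s, a ≤ s → 0 ≤ Φ s)
    (hanti : AntitoneOn Φ (Ici a)) (hint : IntegrableOn Φ (Ioi a)) :
    Summable (fun m : ℕ => Φ (a + m * B)) ∧
      ∑' m : ℕ, Φ (a + m * B) ≤ Φ a + B⁻¹ * ∫ s in Ioi a, Φ s := by
  set I : ℝ := ∫ s in Ioi a, Φ s with hI
  have hI0 : 0 ≤ I := setIntegral_nonneg measurableSet_Ioi fun s hs => hΦ0 s (le_of_lt hs)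
  have hterm0 : ∀ m : ℕ, 0 ≤ Φ (a + m * B) := fun m => hΦ0 _ (by
    have : (0 : ℝ) ≤ m * B := by positivity
    linarith)
  have hpartial : ∀ N : ℕ, ∑ m ∈ Finset.range N, Φ (a + m * B) ≤ Φ a + B⁻¹ * I := by
    intro N
    cases N with
    | zero =>
      simp only [Finset.range_zero, Finset.sum_empty]
      have := hΦ0 a le_rfl
      positivity
    | succ N =>
      rw [Finset.sum_range_succ']
      simp only [Nat.cast_zero, zero_mul, add_zero, Nat.cast_succ]
      set ψ : ℝ → ℝ := fun w => Φ (B * w + a) with hψ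
      have hψanti : AntitoneOn ψ (Icc (0 : ℝ) (0 + N)) := by
        intro w hw w' hw' hww'
        simp only [hψ]
        apply hanti
        · exact mem_Ici.mpr (by nlinarith [hw.1])
        · exact mem_Ici.mpr (by nlinarith [hw'.1])
        · nlinarith
      have hsum := AntitoneOn.sum_le_integral hψanti
      simp only [zero_add] at hsum
      have hsum' : ∑ i ∈ Finset.range N, Φ (a + ((i : ℝ) + 1) * B) ≤ ∫ w in (0 : ℝ)..N, ψ w := by
        refine le_of_eq_of_le ?_ hsum
        apply Finset.sum_congr rfl
        intro i _
        simp only [hψ]; push_cast; ring_nf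
      have hsub : ∫ w in (0 : ℝ)..N, ψ w = B⁻¹ * ∫ s in a..(B * N + a), Φ s := by
        simp only [hψ]
        rw [intervalIntegral.integral_comp_mul_add (fun s => Φ s) hB.ne' a]
        simp
      have hab : a ≤ B * N + a := by
        have : (0 : ℝ) ≤ B * N := by positivity
        linarith
      have hle : ∫ s in a..(B * N + a), Φ s ≤ I := by
        rw [intervalIntegral.integral_of_le hab, hI]
        exact setIntegral_mono_set hint
          (ae_restrict_of_forall_mem measurableSet_Ioi fun s hs => hΦ0 s (le_of_lt hs))
          Ioc_subset_Ioi_self.eventuallyLE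
      have hBinv : 0 ≤ B⁻¹ := inv_nonneg.mpr hB.le
      have : B⁻¹ * ∫ s in a..(B * N + a), Φ s ≤ B⁻¹ * I := mul_le_mul_of_nonneg_left hle hBinv
      linarith
  exact ⟨summable_of_sum_range_le hterm0 hpartial, Real.tsum_le_of_sum_range_le hterm0 hpartial⟩

/-! ### The majorant `G(s) = 4 (2πs)^k e^{−s²/(2h²)}` of Lemma A.4 is decreasing on `[h√k, ∞)` -/

/-- For `0 < s ≤ s'` with `h²k ≤ s²`: `s'^k e^{−s'²/(2h²)} ≤ s^k e^{−s²/(2h²)}` (the bound of Lemma A.4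
«is decreasing» past `h√k`: `(s'/s)^k ≤ e^{k(s'/s − 1)} ≤ e^{(s'²−s²)/(2h²)}`).
[cite: Platt2017, Lemma A.5 p. 2459 (proof: «our bound for g(t;k) (Lemma A.4) is decreasing»)] -/
theorem pow_mul_exp_antitone {k : ℕ} {h s s' : ℝ} (hh : 0 < h) (hs : 0 < s) (hks : h ^ 2 * k ≤ s ^ 2)
    (hss' : s ≤ s') :
    s' ^ k * Real.exp (-(s' ^ 2 / (2 * h ^ 2))) ≤ s ^ k * Real.exp (-(s ^ 2 / (2 * h ^ 2))) := by
  have hs' : 0 < s' := hs.trans_le hss'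
  -- `(s'/s)^k ≤ exp(k (s'/s - 1))`
  have h1 : (s' / s) ^ k ≤ Real.exp (k * (s' / s - 1)) := by
    rw [Real.exp_nat_mul]
    exact pow_le_pow_left₀ (by positivity) (by linarith [Real.add_one_le_exp (s' / s - 1)]) k
  -- `k (s'/s - 1) ≤ (s'^2 - s^2)/(2h^2)`
  have h2 : (k : ℝ) * (s' / s - 1) ≤ (s' ^ 2 - s ^ 2) / (2 * h ^ 2) := by
    rw [div_sub_one hs.ne', mul_div_assoc', div_le_div_iff₀ hs (by positivity)]
    have hd : 0 ≤ s' - s := by linarith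
    have : (k : ℝ) * (2 * h ^ 2) ≤ (s' + s) * s := by nlinarith
    calc (k : ℝ) * (s' - s) * (2 * h ^ 2) = (s' - s) * ((k : ℝ) * (2 * h ^ 2)) := by ring
      _ ≤ (s' - s) * ((s' + s) * s) := mul_le_mul_of_nonneg_left this hd
      _ = (s' ^ 2 - s ^ 2) * s := by ring
  have h3 : (s' / s) ^ k ≤ Real.exp ((s' ^ 2 - s ^ 2) / (2 * h ^ 2)) :=
    h1.trans (Real.exp_le_exp.mpr h2)
  have h4 : s' ^ k = s ^ k * (s' / s) ^ k := by
    rw [← mul_pow]; congr 1; field_simp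
  rw [h4, mul_assoc]
  apply mul_le_mul_of_nonneg_left _ (by positivity)
  calc (s' / s) ^ k * Real.exp (-(s' ^ 2 / (2 * h ^ 2)))
      ≤ Real.exp ((s' ^ 2 - s ^ 2) / (2 * h ^ 2)) * Real.exp (-(s' ^ 2 / (2 * h ^ 2))) :=
        mul_le_mul_of_nonneg_right h3 (Real.exp_pos _).le
    _ = Real.exp (-(s ^ 2 / (2 * h ^ 2))) := by rw [← Real.exp_add]; congr 1; ring

/-! ### Two-sided lattice tails and the low-height / reflected values of `ζ` -/

/-- **Two-sided lattice tails.** If `‖F(t)‖ ≤ P(|t|)` whenever `|t| ≥ B/2`, with `P ≥ 0` antitone and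
integrable on `[B/2, ∞)`, then for `|x| ≤ B/2` the samples `F(x + lB)`, `l ∈ ℤ`, are summable and
`‖Σ_{l∈ℤ} F(x+lB) − F(x)‖ = ‖Σ_{l≠0} F(x+lB)‖ ≤ 2 (P(B/2) + B⁻¹ ∫_{B/2}^∞ P)` — both tails «split off
the first term and majorize the balance with an integral» (`tsum_lattice_le`), the `l`-th point of either
tail having `|x + lB| ≥ (2|l|−1)B/2`. The common skeleton of Lemmas A.5 and A.11.
[cite: Platt2017, Lemma A.5 p. 2459 and Lemma A.11 p. 2463 (proofs)] -/
theorem lattice_two_sided {F : ℝ → ℂ} {P : ℝ → ℝ} {B x : ℝ} (hB0 : 0 < B) (hx : |x| ≤ B / 2)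
    (hP0 : ∀ s, B / 2 ≤ s → 0 ≤ P s) (hPanti : AntitoneOn P (Ici (B / 2)))
    (hPint : IntegrableOn P (Ioi (B / 2))) (hF : ∀ t : ℝ, B / 2 ≤ |t| → ‖F t‖ ≤ P |t|) :
    Summable (fun l : ℤ => F (x + l * B)) ∧
      ‖∑' l : ℤ, F (x + l * B) - F x‖ ≤ 2 * (P (B / 2) + B⁻¹ * ∫ s in Ioi (B / 2), P s) := by
  have hB2 : 0 < B / 2 := by linarith
  obtain ⟨hTsum, hTle⟩ := tsum_lattice_le (Φ := P) (a := B / 2) hB0 hP0 hPanti hPint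
  set T : ℝ := ∑' m : ℕ, P (B / 2 + m * B) with hT
  have hPmono : ∀ (m : ℕ) (t : ℝ), B / 2 + m * B ≤ |t| → ‖F t‖ ≤ P (B / 2 + m * B) := by
    intro m t ht
    have hmB : (0 : ℝ) ≤ m * B := by positivity
    exact (hF t (by linarith)).trans (hPanti (mem_Ici.mpr (by linarith)) (mem_Ici.mpr (by linarith)) ht)
  have hright : ∀ m : ℕ, ‖F (x + ((m : ℝ) + 1) * B)‖ ≤ P (B / 2 + m * B) := by
    intro m
    apply hPmono
    have hmB : (0 : ℝ) < ((m : ℝ) + 1) * B := by positivity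
    have h1 : |((m : ℝ) + 1) * B| - |-x| ≤ |((m : ℝ) + 1) * B - (-x)| := abs_sub_abs_le_abs_sub _ _
    rw [abs_neg, abs_of_pos hmB, sub_neg_eq_add, add_comm (((m : ℝ) + 1) * B) x] at h1
    linarith
  have hleft : ∀ m : ℕ, ‖F (x + (-((m : ℝ) + 1)) * B)‖ ≤ P (B / 2 + m * B) := by
    intro m
    apply hPmono
    have hmB : (0 : ℝ) < ((m : ℝ) + 1) * B := by positivity
    have h1 : |((m : ℝ) + 1) * B| - |x| ≤ |((m : ℝ) + 1) * B - x| := abs_sub_abs_le_abs_sub _ _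
    rw [abs_of_pos hmB] at h1
    have h2 : x + (-((m : ℝ) + 1)) * B = -(((m : ℝ) + 1) * B - x) := by ring
    rw [h2, abs_neg]
    linarith
  set f : ℤ → ℂ := fun l => F (x + (l : ℝ) * B) with hf
  have hsum_right : Summable (fun m : ℕ => F (x + ((m : ℝ) + 1) * B)) :=
    Summable.of_norm_bounded hTsum hright
  have hsum_left : Summable (fun m : ℕ => F (x + (-((m : ℝ) + 1)) * B)) :=
    Summable.of_norm_bounded hTsum hleft
  have hshift : (fun n : ℕ => f ((n + 1 : ℕ) : ℤ)) = fun m : ℕ => F (x + ((m : ℝ) + 1) * B) := by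
    funext m; simp only [hf]; push_cast; ring_nf
  have hnegf : (fun n : ℕ => f (-(n + 1))) = fun m : ℕ => F (x + (-((m : ℝ) + 1)) * B) := by
    funext m; simp only [hf]; push_cast; ring_nf
  have hsum_nat : Summable (fun n : ℕ => f n) := by
    have h1 : Summable (fun n : ℕ => f ((n + 1 : ℕ) : ℤ)) := by rw [hshift]; exact hsum_right
    exact (summable_nat_add_iff 1).mp h1
  have hsum_neg : Summable (fun n : ℕ => f (-(n + 1))) := by rw [hnegf]; exact hsum_left
  have hsumZ : Summable f := Summable.of_nat_of_neg_add_one hsum_nat hsum_neg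
  refine ⟨hsumZ, ?_⟩
  have hsplit : ∑' l : ℤ, f l = (∑' n : ℕ, f n) + ∑' n : ℕ, f (-(n + 1)) :=
    tsum_of_nat_of_neg_add_one hsum_nat hsum_neg
  have hnat : ∑' n : ℕ, f n = F x + ∑' m : ℕ, F (x + ((m : ℝ) + 1) * B) := by
    rw [hsum_nat.tsum_eq_zero_add]
    congr 1
    · simp [hf]
    · have : (fun n : ℕ => f ((n : ℤ) + 1)) = fun m : ℕ => F (x + ((m : ℝ) + 1) * B) := by
        funext m; simp only [hf]; push_cast; ring_nf
      rw [← this]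
      rfl
  have hneg : ∑' n : ℕ, f (-(n + 1)) = ∑' m : ℕ, F (x + (-((m : ℝ) + 1)) * B) := by rw [hnegf]
  have hfsum : ∑' l : ℤ, F (x + (l : ℝ) * B) = ∑' l : ℤ, f l := rfl
  rw [hfsum, hsplit, hnat, hneg]
  have hS1 : ‖∑' m : ℕ, F (x + ((m : ℝ) + 1) * B)‖ ≤ T := tsum_of_norm_bounded hTsum.hasSum hright
  have hS2 : ‖∑' m : ℕ, F (x + (-((m : ℝ) + 1)) * B)‖ ≤ T := tsum_of_norm_bounded hTsum.hasSum hleft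
  calc ‖F x + ∑' m : ℕ, F (x + ((m : ℝ) + 1) * B) + ∑' m : ℕ, F (x + (-((m : ℝ) + 1)) * B) - F x‖
      = ‖∑' m : ℕ, F (x + ((m : ℝ) + 1) * B) + ∑' m : ℕ, F (x + (-((m : ℝ) + 1)) * B)‖ := by
        congr 1; ring
    _ ≤ T + T := (norm_add_le _ _).trans (add_le_add hS1 hS2)
    _ ≤ 2 * (P (B / 2) + B⁻¹ * ∫ s in Ioi (B / 2), P s) := by linarith

/-! ### Low-height and reflected values of `ζ` on the critical line (for the left tails) -/

/-- `|ζ(1/2 + iv)| ≤ 3.33` for `|v| ≤ 3` (the tree's `norm_riemannZeta_half_line_le_of_abs_le_one`: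
`≤ 1+√5` on `|v| ≤ 1`, and `norm_riemannZeta_half_le_of_le_404`: `≤ 2.53 v^{1/4}` on `[1, 404]`,
reflected by `ζ(s̄) = conj ζ(s)`) — the low-height input of the left tail of Lemma A.11.
[cite: Platt2017, Lemma A.11 p. 2463 (proof: «the right tail majorizes the left», ordinates |v| ≤ 3)]
[cite: Trudgian2011, Lemma 2.5 (footnote)] -/
theorem norm_zeta_half_le_of_abs_le_three {v : ℝ} (hv : |v| ≤ 3) :
    ‖riemannZeta (1 / 2 + v * I)‖ ≤ 3.33 := by
  -- reduce to `v ≥ 0`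
  have key : ∀ w : ℝ, 0 ≤ w → w ≤ 3 → ‖riemannZeta (1 / 2 + w * I)‖ ≤ 3.33 := by
    intro w hw0 hw3
    rcases le_or_gt w 1 with h1 | h1
    · have h := norm_riemannZeta_half_line_le_of_abs_le_one (u := w) (by rw [abs_of_nonneg hw0]; exact h1)
      have h5 : Real.sqrt 5 ≤ 2.237 := by
        have : Real.sqrt 5 ≤ Real.sqrt (2.237 ^ 2) := Real.sqrt_le_sqrt (by norm_num)
        rwa [Real.sqrt_sq (by norm_num)] at this
      linarith
    · have h := norm_riemannZeta_half_le_of_le_404 w h1.le (by linarith)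
      have h3 : w ^ (1 / 4 : ℝ) ≤ (3 : ℝ) ^ (1 / 4 : ℝ) := Real.rpow_le_rpow hw0 hw3 (by norm_num)
      have h34 : (3 : ℝ) ^ (1 / 4 : ℝ) ≤ 1.3161 := by
        have h0 : (3 : ℝ) ≤ (1.3161 : ℝ) ^ (4 : ℕ) := by norm_num
        have h1' := Real.rpow_le_rpow (by norm_num : (0 : ℝ) ≤ 3) h0 (by norm_num : (0 : ℝ) ≤ 1 / 4)
        have h2 : ((1.3161 : ℝ) ^ (4 : ℕ)) ^ (1 / 4 : ℝ) = 1.3161 := by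
          rw [show (1 / 4 : ℝ) = ((4 : ℕ) : ℝ)⁻¹ by norm_num]
          exact Real.pow_rpow_inv_natCast (by norm_num) (by norm_num)
        rw [h2] at h1'; exact h1'
      nlinarith [h, h3, h34, Real.rpow_nonneg hw0 (1 / 4 : ℝ)]
  rcases le_or_gt 0 v with hv0 | hv0
  · exact key v hv0 ((le_abs_self v).trans hv)
  · have hconj : riemannZeta (1 / 2 + v * I) = conj (riemannZeta (1 / 2 + (-v : ℝ) * I)) := by
      rw [← riemannZeta_conj]
      congr 1
      simp only [map_add, map_div₀, map_one, map_mul, Complex.conj_ofReal, Complex.conj_I, map_ofNat]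
      push_cast; ring
    rw [hconj, Complex.norm_conj]
    exact key (-v) (by linarith) (by linarith [neg_abs_le v, hv, neg_le_abs v])

/-- Reflection: `‖ζ(1/2 − iv)‖ = ‖ζ(1/2 + iv)‖`. [folklore] -/
private theorem norm_zeta_half_neg (v : ℝ) :
    ‖riemannZeta (1 / 2 + (-v : ℝ) * I)‖ = ‖riemannZeta (1 / 2 + v * I)‖ := by
  have hconj : riemannZeta (1 / 2 + (-v : ℝ) * I) = conj (riemannZeta (1 / 2 + v * I)) := by
    rw [← riemannZeta_conj]
    congr 1
    simp only [map_add, map_div₀, map_one, map_mul, Complex.conj_ofReal, Complex.conj_I, map_ofNat]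
    push_cast; ring
  rw [hconj, Complex.norm_conj]

/-- `u ↦ u^{1/6} log u` is monotone on `[1, ∞)`. [folklore] -/
private theorem rpow_sixth_mul_log_mono {v u : ℝ} (hv : 1 ≤ v) (hvu : v ≤ u) :
    v ^ (1 / 6 : ℝ) * Real.log v ≤ u ^ (1 / 6 : ℝ) * Real.log u := by
  have hv0 : 0 ≤ v := by linarith
  exact mul_le_mul (Real.rpow_le_rpow hv0 hvu (by norm_num)) (Real.log_le_log (by linarith) hvu)
    (Real.log_nonneg hv) (Real.rpow_nonneg (by linarith) _)

/-- `15 ≤ e^e` (`e > 2.7182818283` and ten terms of the exponential series). [folklore] -/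
private theorem fifteen_le_exp_exp_one : (15 : ℝ) ≤ Real.exp (Real.exp 1) := by
  have h1 : (2.7182818283 : ℝ) < Real.exp 1 := Real.exp_one_gt_d9
  refine le_trans ?_ (Real.exp_le_exp.mpr h1.le)
  have hs := Real.sum_le_exp_of_nonneg (x := (2.7182818283 : ℝ)) (by norm_num) 10
  have hs' : ∑ i ∈ Finset.range 10, (2.7182818283 : ℝ) ^ i / (i.factorial : ℝ) ≥ 15 := by
    simp only [Finset.sum_range_succ, Finset.sum_range_zero, Nat.factorial]
    norm_num
  linarith

end Platt2017

open Platt2017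

/-- **Platt 2017, Lemma A.4 (pp. 2458–2459), as printed:** for `k ∈ ℤ_{≥0}`, `t ∈ ℝ`, `t₀, h > 0` and
`g(t; k) := Γ((1/2 + i(t+t₀))/2) exp(π(t+t₀)/4 − t²/(2h²)) (−2πit)^k` (the functions sampled in
step (1) of the algorithm, §3 p. 2451): `|g(t; k)| ≤ 4 (2π|t|)^k exp(−t²/(2h²))`. *Proof (printed):*
`|g| < (2π|t|)^k e^{−t²/(2h²)} |Γ((1/2+i(t+t₀))/2) e^{π(t+t₀)/4}|` "and the result follows from the
trivial bound `|Γ((1/2+ix)/2)| e^{πx/4} < 4`" (`Platt2017.norm_Gamma_half_line_mul_exp_lt_four`). The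
hypotheses `t₀, h > 0` are not needed and not assumed. [cite: Platt2017, Lemma A.4 pp. 2458–2459] -/
theorem platt2017_lemmaA4 (k : ℕ) (t t₀ h : ℝ) :
    ‖Complex.Gamma ((1 / 2 + (t + t₀ : ℝ) * I) / 2) *
        Complex.exp ((π * (t + t₀) / 4 - t ^ 2 / (2 * h ^ 2) : ℝ) : ℂ) * (-(2 * π * t : ℝ) * I) ^ k‖ ≤
      4 * (2 * π * |t|) ^ k * Real.exp (-(t ^ 2 / (2 * h ^ 2))) := by
  have h4 := norm_Gamma_half_line_mul_exp_lt_four (t + t₀)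
  rw [norm_mul, norm_mul, Complex.norm_exp, Complex.ofReal_re, norm_pow, norm_mul, norm_neg,
    Complex.norm_I, mul_one, Complex.norm_real, Real.norm_eq_abs, sub_eq_add_neg, Real.exp_add]
  have habs : |2 * π * t| = 2 * π * |t| := by
    rw [abs_mul, abs_of_pos (by positivity : (0 : ℝ) < 2 * π)]
  rw [habs]
  have hE : 0 < Real.exp (-(t ^ 2 / (2 * h ^ 2))) := Real.exp_pos _
  have hP : 0 ≤ (2 * π * |t|) ^ k := by positivity
  calc ‖Complex.Gamma ((1 / 2 + ((t + t₀ : ℝ) : ℂ) * I) / 2)‖ *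
        (Real.exp (π * (t + t₀) / 4) * Real.exp (-(t ^ 2 / (2 * h ^ 2)))) * (2 * π * |t|) ^ k
      = (‖Complex.Gamma ((1 / 2 + ((t + t₀ : ℝ) : ℂ) * I) / 2)‖ * Real.exp (π * (t + t₀) / 4)) *
          ((2 * π * |t|) ^ k * Real.exp (-(t ^ 2 / (2 * h ^ 2)))) := by ring
    _ ≤ 4 * ((2 * π * |t|) ^ k * Real.exp (-(t ^ 2 / (2 * h ^ 2)))) :=
        mul_le_mul_of_nonneg_right h4.le (by positivity)
    _ = 4 * (2 * π * |t|) ^ k * Real.exp (-(t ^ 2 / (2 * h ^ 2))) := by ring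

open Literature.Analysis.SpecialFunctions.GammaStirling (abs_log_norm_Gamma_sub_le)

/-! ### Lemma A.1 and Lemma A.2 -/

/-- **Platt 2017, Lemma A.1 (p. 2456), as printed:** "Define the incomplete Gamma function for
`Re s > 0` by `Γ(s, x) := ∫_x^∞ t^{s−1} e^{−t} dt`. Then, given `κ > −1` and `x, h > 0`, we have
`∫_x^∞ w^κ exp(−w²/(2h²)) dw = 2^{(κ−1)/2} h^{κ+1} Γ((κ+1)/2, x²/(2h²))`." *Proof (printed):* the
substitution `t = w²/(2h²)`. Here `Γ(s, x)` = the tree's `upperIncGamma s x`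
(`ZetaZeroReciprocalSumsExplicit.lean`), powers are `Real.rpow`, and the substitution is Mathlib's
`MeasureTheory.integral_comp_mul_deriv_Ioi`. [cite: Platt2017, Lemma A.1 p. 2456] -/
theorem platt2017_lemmaA1 {κ x h : ℝ} (hκ : -1 < κ) (hx : 0 < x) (hh : 0 < h) :
    ∫ w in Ioi x, w ^ κ * Real.exp (-(w ^ 2 / (2 * h ^ 2))) =
      (2 : ℝ) ^ ((κ - 1) / 2) * h ^ (κ + 1) * upperIncGamma ((κ + 1) / 2) (x ^ 2 / (2 * h ^ 2)) := by
  set s : ℝ := (κ + 1) / 2 with hs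
  have hs0 : 0 < s := by rw [hs]; linarith
  set c : ℝ := (2 : ℝ) ^ ((κ - 1) / 2) * h ^ (κ + 1) with hc
  set f : ℝ → ℝ := fun w => w ^ 2 / (2 * h ^ 2) with hf
  set f' : ℝ → ℝ := fun w => w / h ^ 2 with hf'
  set g : ℝ → ℝ := fun u => c * (u ^ (s - 1) * Real.exp (-u)) with hg
  have hh2 : 0 < 2 * h ^ 2 := by positivity
  -- the pointwise identity `(g ∘ f)(w) f'(w) = w^κ e^{−w²/(2h²)}` for `w > 0`
  have key : ∀ w : ℝ, 0 < w → (g ∘ f) w * f' w = w ^ κ * Real.exp (-(w ^ 2 / (2 * h ^ 2))) := by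
    intro w hw
    simp only [Function.comp_apply, hg, hf, hf']
    have hs1 : s - 1 = (κ - 1) / 2 := by rw [hs]; ring
    rw [hs1]
    have h1 : (w ^ 2 / (2 * h ^ 2)) ^ ((κ - 1) / 2) =
        w ^ (κ - 1) / ((2 : ℝ) ^ ((κ - 1) / 2) * h ^ (κ - 1)) := by
      rw [Real.div_rpow (by positivity) hh2.le, Real.mul_rpow (by norm_num) (by positivity)]
      congr 1
      · rw [show (w ^ 2 : ℝ) = w ^ (2 : ℝ) by norm_cast, ← Real.rpow_mul hw.le]
        congr 1; ring
      · congr 1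
        rw [show (h ^ 2 : ℝ) = h ^ (2 : ℝ) by norm_cast, ← Real.rpow_mul hh.le]
        congr 1; ring
    rw [h1, hc]
    have h2pos : 0 < (2 : ℝ) ^ ((κ - 1) / 2) := Real.rpow_pos_of_pos (by norm_num) _
    have hhk : 0 < h ^ (κ - 1) := Real.rpow_pos_of_pos hh _
    have hκ1 : h ^ (κ + 1) = h ^ (κ - 1) * h ^ 2 := by
      rw [show (h ^ 2 : ℝ) = h ^ (2 : ℝ) by norm_cast, ← Real.rpow_add hh]; congr 1; ring
    have hwκ : w ^ κ = w ^ (κ - 1) * w := by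
      conv_lhs => rw [show κ = (κ - 1) + 1 by ring, Real.rpow_add hw, Real.rpow_one]
    rw [hκ1, hwκ]
    field_simp
  have hfc : ContinuousOn f (Ici x) := by
    apply Continuous.continuousOn; simp only [hf]; fun_prop
  have hft : Tendsto f atTop atTop := by
    simp only [hf]
    exact (tendsto_pow_atTop two_ne_zero).atTop_div_const hh2
  have hff' : ∀ w ∈ Ioi x, HasDerivWithinAt f (f' w) (Ioi w) w := by
    intro w _
    have h1 : HasDerivAt f (((2 : ℕ) : ℝ) * w ^ (2 - 1) / (2 * h ^ 2)) w := by
      simp only [hf]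
      exact (hasDerivAt_pow 2 w).div_const (2 * h ^ 2)
    have h2 : ((2 : ℕ) : ℝ) * w ^ (2 - 1) / (2 * h ^ 2) = f' w := by
      simp only [hf']; field_simp; ring
    rw [h2] at h1
    exact h1.hasDerivWithinAt
  have hfpos : ∀ w, 0 < w → 0 < f w := fun w hw => by simp only [hf]; positivity
  have himg1 : f '' Ioi x ⊆ Ioi 0 := by
    rintro _ ⟨w, hw, rfl⟩; exact hfpos w (hx.trans hw)
  have himg2 : f '' Ici x ⊆ Ioi 0 := by
    rintro _ ⟨w, hw, rfl⟩; exact hfpos w (hx.trans_le hw)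
  have hgc : ContinuousOn g (Ioi 0) := by
    simp only [hg]
    refine continuousOn_const.mul (ContinuousOn.mul ?_ (Continuous.continuousOn (by fun_prop)))
    exact continuousOn_id.rpow_const fun u hu => Or.inl (ne_of_gt hu)
  have hg_cont : ContinuousOn g (f '' Ioi x) := hgc.mono himg1
  have hg1 : IntegrableOn g (f '' Ici x) := by
    have h0 : IntegrableOn (fun u : ℝ => u ^ (s - 1) * Real.exp (-u)) (Ioi 0) :=
      integrableOn_upperIncGamma_integrand hs0 le_rfl
    exact (h0.mono_set himg2).const_mul c
  have hint : Integrable fun w : ℝ => w ^ κ * Real.exp (-(1 / (2 * h ^ 2)) * w ^ 2) :=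
    integrable_rpow_mul_exp_neg_mul_sq (by positivity) hκ
  have hg2 : IntegrableOn (fun w => (g ∘ f) w * f' w) (Ici x) := by
    refine (hint.integrableOn (s := Ici x)).congr_fun ?_ measurableSet_Ici
    intro w hw
    show w ^ κ * Real.exp (-(1 / (2 * h ^ 2)) * w ^ 2) = (g ∘ f) w * f' w
    rw [key w (hx.trans_le hw)]
    congr 2; ring
  have hmain := integral_comp_mul_deriv_Ioi hfc hft hff' hg_cont hg1 hg2
  have hlhs : ∫ w in Ioi x, (g ∘ f) w * f' w = ∫ w in Ioi x, w ^ κ * Real.exp (-(w ^ 2 / (2 * h ^ 2))) :=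
    setIntegral_congr_fun measurableSet_Ioi fun w hw => key w (hx.trans hw)
  rw [← hlhs, hmain]
  simp only [hg, hf, upperIncGamma]
  rw [integral_const_mul]

/-- **Platt 2017, Lemma A.2 (p. 2457), as printed:** "Let `t ≥ σ ≥ 1`. Then we have
`|Γ((σ+it)/2)| exp(πt/4) < 2^{(3−σ)/4} √π t^{(σ−1)/2} exp((1+2√2)/(6t))`." *Proof (printed):*
Stirling's approximation for `Re log Γ((σ+it)/2)` with Olver's bound for the error,
`πt/4 − (t/2) arctan(t/σ) − σ/2 < 0`, and `|(σ+it)/2| ≤ t/√2`. This is the bound Platt–Trudgian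
2021 §2 refer to («a minor improvement to our bound for `|Γ((σ+it)/2)| exp(πt/4)` (A.2 in [21])»).
Executed here with the tree's uniform Stirling formula `GammaStirling.abs_log_norm_Gamma_sub_le`
(remainder `(1/12)(1/|w|² + π/(2|w|)) ≤ (4+π)/(12t) < (1+2√2)/(6t)` for `|w| ≥ t/2 ≥ 1/2`) and
`(t/2)(π/2 − arg w) ≤ σ/2` (`tan(π/2 − arg w) = σ/t`); powers are `Real.rpow`.
[cite: Platt2017, Lemma A.2 p. 2457] [cite: PlattTrudgianBLMS2021, §2 (arXiv v1 p. 3)] -/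
theorem platt2017_lemmaA2 {σ t : ℝ} (hσ : 1 ≤ σ) (hσt : σ ≤ t) :
    ‖Complex.Gamma ((σ + t * I) / 2)‖ * Real.exp (π * t / 4) <
      (2 : ℝ) ^ ((3 - σ) / 4) * Real.sqrt π * t ^ ((σ - 1) / 2) *
        Real.exp ((1 + 2 * Real.sqrt 2) / (6 * t)) := by
  have ht : 1 ≤ t := hσ.trans hσt
  have ht0 : 0 < t := by linarith
  have hσ0 : 0 < σ := by linarith
  set w : ℂ := (σ + t * I) / 2 with hw
  have hw' : w = ((σ / 2 : ℝ) : ℂ) + ((t / 2 : ℝ) : ℂ) * I := by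
    simp only [hw]; push_cast; ring
  have hre : w.re = σ / 2 := by rw [hw']; simp
  have him : w.im = t / 2 := by rw [hw']; simp
  have hre0 : 0 < w.re := by rw [hre]; linarith
  set n : ℝ := ‖w‖ with hn
  have hn_eq : n = Real.sqrt ((σ / 2) ^ 2 + (t / 2) ^ 2) := by
    rw [hn, hw']; exact Complex.norm_add_mul_I (σ / 2) (t / 2)
  have hn_pos : 0 < n := by
    rw [hn_eq]; exact Real.sqrt_pos.mpr (by positivity)
  have hn_ge : t / 2 ≤ n := by
    rw [hn_eq, Real.le_sqrt (by linarith) (by positivity)]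
    nlinarith
  have hn_sq_le : n ^ 2 ≤ t ^ 2 / 2 := by
    rw [hn_eq, Real.sq_sqrt (by positivity)]
    nlinarith
  -- Stirling
  have hS := abs_log_norm_Gamma_sub_le (w := w) hre0
  rw [hre, him, ← hn] at hS
  have hS' := (abs_le.mp hS).2
  -- `(t/2)(π/2) − (t/2) arg w ≤ σ/2`
  have hkey : (t / 2) * (π / 2) - (t / 2) * Complex.arg w ≤ σ / 2 := by
    have him_pos : 0 < w.im := by rw [him]; linarith
    have harg_nn : 0 ≤ Complex.arg w := Complex.arg_nonneg_iff.mpr him_pos.le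
    have harg_ne : Complex.arg w ≠ 0 := by
      intro h0
      have := (Complex.arg_eq_zero_iff.mp h0).2
      linarith
    have harg_pos : 0 < Complex.arg w := lt_of_le_of_ne harg_nn (Ne.symm harg_ne)
    have harg_lt : Complex.arg w < π / 2 := by
      have := Complex.abs_arg_lt_pi_div_two_iff.mpr (Or.inl hre0)
      exact (abs_lt.mp this).2
    set φ : ℝ := π / 2 - Complex.arg w with hφ
    have hφ0 : 0 ≤ φ := by rw [hφ]; linarith
    have hφ1 : φ < π / 2 := by rw [hφ]; linarith
    have htan : Real.tan φ = (σ / 2) / (t / 2) := by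
      rw [hφ, Real.tan_pi_div_two_sub, Complex.tan_arg, hre, him, inv_div]
    have hle := Real.le_tan hφ0 hφ1
    rw [htan] at hle
    have h1 : (t / 2) * φ ≤ σ / 2 := by
      calc (t / 2) * φ ≤ (t / 2) * ((σ / 2) / (t / 2)) := by gcongr
        _ = σ / 2 := by field_simp
    rw [hφ, mul_sub] at h1
    exact h1
  -- the remainder
  have hR : (1 / 12 : ℝ) * (1 / n ^ 2 + π / (2 * n)) ≤ (4 + π) / (12 * t) := by
    have h1 : 1 / n ^ 2 ≤ 4 / t ^ 2 := by
      rw [div_le_div_iff₀ (by positivity) (by positivity)]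
      nlinarith
    have h1' : 4 / t ^ 2 ≤ 4 / t := by
      apply div_le_div_of_nonneg_left (by norm_num) ht0
      nlinarith
    have h2 : π / (2 * n) ≤ π / t :=
      div_le_div_of_nonneg_left Real.pi_pos.le ht0 (by linarith)
    have e : (4 + π) / (12 * t) = (1 / 12) * (4 / t + π / t) := by field_simp
    rw [e]
    have h3 : 1 / n ^ 2 + π / (2 * n) ≤ 4 / t + π / t := by linarith
    exact mul_le_mul_of_nonneg_left h3 (by norm_num)
  have hRlt : (4 + π) / (12 * t) < (1 + 2 * Real.sqrt 2) / (6 * t) := by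
    rw [div_lt_div_iff₀ (by positivity) (by positivity)]
    have hs2 : (1.414 : ℝ) ≤ Real.sqrt 2 := by
      rw [Real.le_sqrt (by norm_num) (by norm_num)]; norm_num
    nlinarith [Real.pi_lt_d4]
  -- `((σ−1)/2) log n ≤ ((σ−1)/2)(log t − log 2 / 2)`
  have hlogn : (σ / 2 - 1 / 2) * Real.log n ≤ ((σ - 1) / 2) * (Real.log t - Real.log 2 / 2) := by
    have h1 : Real.log n ≤ Real.log t - Real.log 2 / 2 := by
      have h2 : Real.log (n ^ 2) ≤ Real.log (t ^ 2 / 2) := Real.log_le_log (by positivity) hn_sq_le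
      rw [Real.log_pow, Real.log_div (by positivity) (by norm_num), Real.log_pow] at h2
      push_cast at h2
      linarith
    have e : (σ / 2 - 1 / 2 : ℝ) = (σ - 1) / 2 := by ring
    rw [e]
    exact mul_le_mul_of_nonneg_left h1 (by linarith)
  have hmain : Real.log ‖Complex.Gamma w‖ + π * t / 4 <
      ((σ - 1) / 2) * Real.log t + ((3 - σ) / 4) * Real.log 2 + Real.log π / 2 +
        (1 + 2 * Real.sqrt 2) / (6 * t) := by
    have h2π : Real.log (2 * π) = Real.log 2 + Real.log π :=
      Real.log_mul (by norm_num) Real.pi_pos.ne'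
    rw [h2π] at hS'
    nlinarith [hS', hkey, hR, hRlt, hlogn]
  have hpos : 0 < ‖Complex.Gamma w‖ := norm_pos_iff.mpr (Complex.Gamma_ne_zero_of_re_pos hre0)
  have heq : ‖Complex.Gamma w‖ * Real.exp (π * t / 4) =
      Real.exp (Real.log ‖Complex.Gamma w‖ + π * t / 4) := by
    rw [Real.exp_add, Real.exp_log hpos]
  rw [heq]
  have hrhs : (2 : ℝ) ^ ((3 - σ) / 4) * Real.sqrt π * t ^ ((σ - 1) / 2) *
        Real.exp ((1 + 2 * Real.sqrt 2) / (6 * t)) =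
      Real.exp (((σ - 1) / 2) * Real.log t + ((3 - σ) / 4) * Real.log 2 + Real.log π / 2 +
        (1 + 2 * Real.sqrt 2) / (6 * t)) := by
    rw [Real.exp_add, Real.exp_add, Real.exp_add, Real.rpow_def_of_pos (by norm_num : (0 : ℝ) < 2),
      Real.rpow_def_of_pos ht0, Real.sqrt_eq_rpow, Real.rpow_def_of_pos Real.pi_pos]
    ring_nf
  rw [hrhs]
  exact Real.exp_lt_exp.mpr hmain

/-! ### Lemma A.10 and Lemma C.2: the growth of `f` and `W` -/

/-- **Platt 2017, Lemma A.10 (p. 2462)**, with the `ζ`-input explicit: for `t ≥ 0`, `t₀ > e^e`,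
`β = 1/6 + log log t₀ / log t₀`, and any constant `A ≤ 3/4` such that `|ζ(1/2+iu)| ≤ A u^{1/6} log u`
for `u ≥ t₀` (the paper: `A = 0.732`, Platt–Trudgian 2015, for `u > 2` — `platt2017_lemmaA10_of_plattTrudgian2015`;
the tree's Hiary–Patel–Yang fact: `A = 0.618`, `u ≥ 3` — `platt2017_lemmaA10_of_hpy`):
`|f(t)| ≤ 3 (t+t₀)^β exp(−t²/(2h²))`, where
`f(t) = Λ(t+t₀) exp(π(t+t₀)/4 − t²/(2h²))`, `Λ(u) = π^{−iu/2} Γ((1/2+iu)/2) ζ(1/2+iu)` ((3.1) and §3,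
written out). Proof as printed: `|π^{−iu/2}| = 1`, the trivial bound `|Γ((1/2+iu)/2)| e^{πu/4} < 4`
(`Platt2017.norm_Gamma_half_line_mul_exp_lt_four`), the `ζ`-bound, `u^{1/6} log u ≤ u^β`
(`Platt2017.log_le_rpow_loglog`) and `4A ≤ 3` («round 2.928 up to 3»). The positivity hypothesis on
`h` printed in (3.1) is not needed. [cite: Platt2017, Lemma A.10 p. 2462] -/
theorem platt2017_lemmaA10 {A t₀ h t : ℝ} (hA : A ≤ 3 / 4) (ht₀ : Real.exp (Real.exp 1) < t₀)
    (ht : 0 ≤ t)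
    (hζ : ∀ u : ℝ, t₀ ≤ u → ‖riemannZeta (1 / 2 + u * I)‖ ≤ A * u ^ (1 / 6 : ℝ) * Real.log u) :
    ‖(π : ℂ) ^ (-(I * (t + t₀ : ℝ) / 2)) * Complex.Gamma ((1 / 2 + (t + t₀ : ℝ) * I) / 2) *
        riemannZeta (1 / 2 + (t + t₀ : ℝ) * I) *
        Complex.exp ((π * (t + t₀) / 4 - t ^ 2 / (2 * h ^ 2) : ℝ) : ℂ)‖ ≤
      3 * (t + t₀) ^ (1 / 6 + Real.log (Real.log t₀) / Real.log t₀) *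
        Real.exp (-(t ^ 2 / (2 * h ^ 2))) := by
  have he : 0 < Real.exp (Real.exp 1) := Real.exp_pos _
  have ht₀pos : 0 < t₀ := he.trans ht₀
  have hut : t₀ ≤ t + t₀ := by linarith
  set u : ℝ := t + t₀ with hu_def
  have hupos : 0 < u := ht₀pos.trans_le hut
  have hu1 : 1 < u := (one_lt_exp_exp_one.trans ht₀).trans_le hut
  set c : ℝ := Real.log (Real.log t₀) / Real.log t₀ with hc
  rw [norm_mul, norm_mul, norm_mul, norm_pi_cpow_neg_I_mul, one_mul, Complex.norm_exp,
    Complex.ofReal_re, sub_eq_add_neg, Real.exp_add]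
  have hΓ := norm_Gamma_half_line_mul_exp_lt_four u
  have hz := hζ u hut
  have hlog := log_le_rpow_loglog ht₀.le hut
  have hu16 : 0 < u ^ (1 / 6 : ℝ) := Real.rpow_pos_of_pos hupos _
  have hlupos : 0 < Real.log u := Real.log_pos hu1
  have hA0 : 0 ≤ A := by
    have h0 : 0 * (u ^ (1 / 6 : ℝ) * Real.log u) ≤ A * (u ^ (1 / 6 : ℝ) * Real.log u) := by
      rw [zero_mul, ← mul_assoc]; exact (norm_nonneg _).trans hz
    exact le_of_mul_le_mul_right h0 (mul_pos hu16 hlupos)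
  set E : ℝ := Real.exp (-(t ^ 2 / (2 * h ^ 2))) with hE
  have hE0 : 0 < E := Real.exp_pos _
  calc ‖Complex.Gamma ((1 / 2 + (u : ℂ) * I) / 2)‖ * ‖riemannZeta (1 / 2 + (u : ℂ) * I)‖ *
        (Real.exp (π * u / 4) * E)
      = (‖Complex.Gamma ((1 / 2 + (u : ℂ) * I) / 2)‖ * Real.exp (π * u / 4)) *
          ‖riemannZeta (1 / 2 + (u : ℂ) * I)‖ * E := by ring
    _ ≤ 4 * (A * u ^ (1 / 6 : ℝ) * Real.log u) * E := by
        apply mul_le_mul_of_nonneg_right _ hE0.le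
        exact mul_le_mul hΓ.le hz (norm_nonneg _) (by norm_num)
    _ ≤ 4 * (A * u ^ (1 / 6 : ℝ) * u ^ c) * E := by
        apply mul_le_mul_of_nonneg_right _ hE0.le
        apply mul_le_mul_of_nonneg_left _ (by norm_num)
        exact mul_le_mul_of_nonneg_left hlog (mul_nonneg hA0 hu16.le)
    _ = 4 * A * u ^ (1 / 6 + c) * E := by rw [Real.rpow_add hupos]; ring
    _ ≤ 3 * u ^ (1 / 6 + c) * E := by
        have h43 : 4 * A ≤ 3 := by linarith
        have hpos : 0 ≤ u ^ (1 / 6 + c) * E := by positivity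
        nlinarith

/-- **Platt 2017, Lemma A.10 (p. 2462), as printed** (hypothesis (A.2) = [22] = Platt–Trudgian 2015
verbatim: «for `t + t₀ > 2`, `|ζ(1/2+i(t+t₀))| ≤ 0.732 (t+t₀)^{1/6} log(t+t₀)`»): for `t ≥ 0`,
`t₀ > exp(e)`, `β = 1/6 + log log t₀/log t₀`: `|f(t)| ≤ 3 (t+t₀)^β exp(−t²/(2h²))`.
[cite: Platt2017, Lemma A.10 p. 2462] -/
theorem platt2017_lemmaA10_of_plattTrudgian2015
    (h22 : ∀ u : ℝ, 2 < u → ‖riemannZeta (1 / 2 + u * I)‖ ≤ 0.732 * u ^ (1 / 6 : ℝ) * Real.log u)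
    {t₀ h t : ℝ} (ht₀ : Real.exp (Real.exp 1) < t₀) (ht : 0 ≤ t) :
    ‖(π : ℂ) ^ (-(I * (t + t₀ : ℝ) / 2)) * Complex.Gamma ((1 / 2 + (t + t₀ : ℝ) * I) / 2) *
        riemannZeta (1 / 2 + (t + t₀ : ℝ) * I) *
        Complex.exp ((π * (t + t₀) / 4 - t ^ 2 / (2 * h ^ 2) : ℝ) : ℂ)‖ ≤
      3 * (t + t₀) ^ (1 / 6 + Real.log (Real.log t₀) / Real.log t₀) *
        Real.exp (-(t ^ 2 / (2 * h ^ 2))) :=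
  platt2017_lemmaA10 (A := 0.732) (by norm_num) ht₀ ht fun u hu =>
    h22 u (by linarith [three_le_exp_exp_one])

/-- **Platt 2017, Lemma A.10 (p. 2462), from the tree's named fact `zeta_half_line_hiary_patel_yang`**
(Hiary–Patel–Yang 2024, Thm 1.1: `|ζ(1/2+it)| ≤ 0.618 t^{1/6} log t` for `t ≥ 3`; `t + t₀ > e^e > 3`):
same conclusion. [cite: Platt2017, Lemma A.10 p. 2462] [cite: HiaryPatelYang2024, Thm. 1.1] -/
theorem platt2017_lemmaA10_of_hpy (hHPY : zeta_half_line_hiary_patel_yang)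
    {t₀ h t : ℝ} (ht₀ : Real.exp (Real.exp 1) < t₀) (ht : 0 ≤ t) :
    ‖(π : ℂ) ^ (-(I * (t + t₀ : ℝ) / 2)) * Complex.Gamma ((1 / 2 + (t + t₀ : ℝ) * I) / 2) *
        riemannZeta (1 / 2 + (t + t₀ : ℝ) * I) *
        Complex.exp ((π * (t + t₀) / 4 - t ^ 2 / (2 * h ^ 2) : ℝ) : ℂ)‖ ≤
      3 * (t + t₀) ^ (1 / 6 + Real.log (Real.log t₀) / Real.log t₀) *
        Real.exp (-(t ^ 2 / (2 * h ^ 2))) :=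
  platt2017_lemmaA10 (A := 0.618) (by norm_num) ht₀ ht fun u hu =>
    hHPY u (by linarith [three_le_exp_exp_one])

/-- **Platt 2017, Lemma C.2 (p. 2465)**, with the `ζ`-input explicit: for `T > 1`, `t ≥ T` and any
`A ≤ 3/4` with `|ζ(1/2+iu)| ≤ A u^{1/6} log u` for `u ≥ T`:
`|W(t)| ≤ 3 t^β exp(−(t−t₀)²/(2H²))`, `β = 1/6 + log log t / log t` (so `t^β = t^{1/6} log t`), where
`W(t) = Λ(t) exp(πt/4 − (t−t₀)²/(2H²))` (p. 2464), `Λ(t) = π^{−it/2} Γ((1/2+it)/2) ζ(1/2+it)`,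
written out. «The proof is almost identical to that of Lemma A.10.»
[cite: Platt2017, Lemma C.2 p. 2465] -/
theorem platt2017_lemmaC2 {A T t₀ H t : ℝ} (hA : A ≤ 3 / 4) (hT : 1 < T) (ht : T ≤ t)
    (hζ : ∀ u : ℝ, T ≤ u → ‖riemannZeta (1 / 2 + u * I)‖ ≤ A * u ^ (1 / 6 : ℝ) * Real.log u) :
    ‖(π : ℂ) ^ (-(I * t / 2)) * Complex.Gamma ((1 / 2 + t * I) / 2) * riemannZeta (1 / 2 + t * I) *
        Complex.exp ((π * t / 4 - (t - t₀) ^ 2 / (2 * H ^ 2) : ℝ) : ℂ)‖ ≤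
      3 * t ^ (1 / 6 + Real.log (Real.log t) / Real.log t) *
        Real.exp (-((t - t₀) ^ 2 / (2 * H ^ 2))) := by
  have htpos : 0 < t := by linarith
  have ht1 : 1 < t := by linarith
  rw [norm_mul, norm_mul, norm_mul, norm_pi_cpow_neg_I_mul, one_mul, Complex.norm_exp,
    Complex.ofReal_re, sub_eq_add_neg, Real.exp_add, Real.rpow_add htpos,
    rpow_loglog_div_log_self ht1]
  have hΓ := norm_Gamma_half_line_mul_exp_lt_four t
  have hz := hζ t ht
  set E : ℝ := Real.exp (-((t - t₀) ^ 2 / (2 * H ^ 2))) with hE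
  have hE0 : 0 < E := Real.exp_pos _
  have hu16 : 0 < t ^ (1 / 6 : ℝ) := Real.rpow_pos_of_pos htpos _
  have hlupos : 0 < Real.log t := Real.log_pos ht1
  have hA0 : 0 ≤ A := by
    have h0 : 0 * (t ^ (1 / 6 : ℝ) * Real.log t) ≤ A * (t ^ (1 / 6 : ℝ) * Real.log t) := by
      rw [zero_mul, ← mul_assoc]; exact (norm_nonneg _).trans hz
    exact le_of_mul_le_mul_right h0 (mul_pos hu16 hlupos)
  calc ‖Complex.Gamma ((1 / 2 + (t : ℂ) * I) / 2)‖ * ‖riemannZeta (1 / 2 + (t : ℂ) * I)‖ *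
        (Real.exp (π * t / 4) * E)
      = (‖Complex.Gamma ((1 / 2 + (t : ℂ) * I) / 2)‖ * Real.exp (π * t / 4)) *
          ‖riemannZeta (1 / 2 + (t : ℂ) * I)‖ * E := by ring
    _ ≤ 4 * (A * t ^ (1 / 6 : ℝ) * Real.log t) * E := by
        apply mul_le_mul_of_nonneg_right _ hE0.le
        exact mul_le_mul hΓ.le hz (norm_nonneg _) (by norm_num)
    _ = 4 * A * (t ^ (1 / 6 : ℝ) * Real.log t) * E := by ring
    _ ≤ 3 * (t ^ (1 / 6 : ℝ) * Real.log t) * E := by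
        have h43 : 4 * A ≤ 3 := by linarith
        have hpos : 0 ≤ t ^ (1 / 6 : ℝ) * Real.log t * E := by positivity
        nlinarith

/-- **Platt 2017, Lemma C.2 (p. 2465), as printed** (hypothesis (A.2) = Platt–Trudgian 2015 verbatim):
«Let `t ≥ e` and `β = 1/6 + log log t / log t`. Then we have `|W(t)| ≤ 3 t^β exp(−(t−t₀)²/(2H²))`.»
[cite: Platt2017, Lemma C.2 p. 2465] -/
theorem platt2017_lemmaC2_of_plattTrudgian2015
    (h22 : ∀ u : ℝ, 2 < u → ‖riemannZeta (1 / 2 + u * I)‖ ≤ 0.732 * u ^ (1 / 6 : ℝ) * Real.log u)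
    {t₀ H t : ℝ} (ht : Real.exp 1 ≤ t) :
    ‖(π : ℂ) ^ (-(I * t / 2)) * Complex.Gamma ((1 / 2 + t * I) / 2) * riemannZeta (1 / 2 + t * I) *
        Complex.exp ((π * t / 4 - (t - t₀) ^ 2 / (2 * H ^ 2) : ℝ) : ℂ)‖ ≤
      3 * t ^ (1 / 6 + Real.log (Real.log t) / Real.log t) *
        Real.exp (-((t - t₀) ^ 2 / (2 * H ^ 2))) :=
  platt2017_lemmaC2 (A := 0.732) (T := Real.exp 1) (by norm_num)
    (by linarith [Real.exp_one_gt_d9]) ht fun u hu => h22 u (by linarith [Real.exp_one_gt_d9])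

/-- **Platt 2017, Lemma C.2 (p. 2465), from the tree's named fact `zeta_half_line_hiary_patel_yang`**,
hence for `t ≥ 3` (the HPY bound is stated from `3 > e` on; the printed range is `t ≥ e`).
[cite: Platt2017, Lemma C.2 p. 2465] [cite: HiaryPatelYang2024, Thm. 1.1] -/
theorem platt2017_lemmaC2_of_hpy (hHPY : zeta_half_line_hiary_patel_yang) {t₀ H t : ℝ} (ht : 3 ≤ t) :
    ‖(π : ℂ) ^ (-(I * t / 2)) * Complex.Gamma ((1 / 2 + t * I) / 2) * riemannZeta (1 / 2 + t * I) *
        Complex.exp ((π * t / 4 - (t - t₀) ^ 2 / (2 * H ^ 2) : ℝ) : ℂ)‖ ≤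
      3 * t ^ (1 / 6 + Real.log (Real.log t) / Real.log t) *
        Real.exp (-((t - t₀) ^ 2 / (2 * H ^ 2))) :=
  platt2017_lemmaC2 (A := 0.618) (T := 3) (by norm_num) (by norm_num) ht fun u hu => hHPY u hu

/-! ### Lemma A.5: the aliasing error of step (2) -/

/-- **Platt 2017, Lemma A.5 (p. 2459), in the form its proof yields, for any `g` obeying the bound of
Lemma A.4:** if `‖g(t)‖ ≤ 4 (2π|t|)^k e^{−t²/(2h²)}` for all real `t`, `h, B > 0`, `|x| ≤ B/2` and
`2h√k ≤ B`, then `l ↦ g(x + lB)` is summable over `ℤ` and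
`‖Σ_{l∈ℤ} g(x + lB) − g(x)‖ = ‖Σ_{l≠0} g(x + lB)‖ ≤ 8(πB)^k [e^{−B²/(8h²)} + 2^{(3k−1)/2} (h/B)^{k+1} Γ((k+1)/2, B²/(8h²))]`.
Printed: `x = n/A`, `n ∈ [−N/2, N/2 − 1]`, `N = AB` (so `|x| ≤ B/2`) and the hypothesis «`B > h√k`»;
the printed proof («the first term missing is `g(B/2; k)` and `B/2` is sufficiently large such that our
bound for `g(t;k)` (Lemma A.4) is decreasing») uses monotonicity of `4(2πt)^k e^{−t²/(2h²)}` on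
`[B/2, ∞)`, i.e. `B/2 ≥ h√k` — typed with that proviso `2h√k ≤ B` (Platt's parameters, §5 p. 2456:
`B = 5476`, `h = 176431/2048 ≈ 86.1`, `k ≤ K = 44`, so `2h√k ≤ 1143 < B`). Both tails are majorized by
`Σ_{m≥0} G(B/2 + mB) ≤ G(B/2) + B⁻¹∫_{B/2}^∞ G` (`Platt2017.tsum_lattice_le`) and the integral is
Lemma A.1 with `κ = k`, `x = B/2`. [cite: Platt2017, Lemma A.5 p. 2459] -/
theorem platt2017_lemmaA5_of_bound (k : ℕ) {h B x : ℝ} {g : ℝ → ℂ} (hh : 0 < h) (hB0 : 0 < B)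
    (hB : 2 * h * Real.sqrt k ≤ B) (hx : |x| ≤ B / 2)
    (hg : ∀ t : ℝ, ‖g t‖ ≤ 4 * (2 * π * |t|) ^ k * Real.exp (-(t ^ 2 / (2 * h ^ 2)))) :
    Summable (fun l : ℤ => g (x + l * B)) ∧
      ‖∑' l : ℤ, g (x + l * B) - g x‖ ≤
        8 * (π * B) ^ k * (Real.exp (-(B ^ 2 / (8 * h ^ 2))) +
          (2 : ℝ) ^ ((3 * (k : ℝ) - 1) / 2) * (h / B) ^ (k + 1) *
            upperIncGamma (((k : ℝ) + 1) / 2) (B ^ 2 / (8 * h ^ 2))) := by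
  -- the majorant
  set G : ℝ → ℝ := fun s => 4 * (2 * π * s) ^ k * Real.exp (-(s ^ 2 / (2 * h ^ 2))) with hG
  have hB2 : 0 < B / 2 := by linarith
  have hkB : h ^ 2 * k ≤ (B / 2) ^ 2 := by
    have h1 : h * Real.sqrt k ≤ B / 2 := by linarith
    have h0 : 0 ≤ h * Real.sqrt k := by positivity
    have := pow_le_pow_left₀ h0 h1 2
    rw [mul_pow, Real.sq_sqrt (Nat.cast_nonneg k)] at this
    exact this
  have hG0 : ∀ s, B / 2 ≤ s → 0 ≤ G s := fun s hs => by
    simp only [hG]; have : 0 ≤ s := hB2.le.trans hs; positivity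
  have hGanti : AntitoneOn G (Ici (B / 2)) := by
    intro s hs s' hs' hss'
    simp only [hG, mul_pow]
    have hs0 : 0 < s := hB2.trans_le hs
    have hks : h ^ 2 * k ≤ s ^ 2 := hkB.trans (pow_le_pow_left₀ hB2.le hs 2)
    have := pow_mul_exp_antitone (k := k) hh hs0 hks hss'
    have hc : 0 ≤ 4 * ((2 : ℝ) ^ k * π ^ k) := by positivity
    calc 4 * ((2 : ℝ) ^ k * π ^ k * s' ^ k) * Real.exp (-(s' ^ 2 / (2 * h ^ 2)))
        = 4 * ((2 : ℝ) ^ k * π ^ k) * (s' ^ k * Real.exp (-(s' ^ 2 / (2 * h ^ 2)))) := by ring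
      _ ≤ 4 * ((2 : ℝ) ^ k * π ^ k) * (s ^ k * Real.exp (-(s ^ 2 / (2 * h ^ 2)))) :=
          mul_le_mul_of_nonneg_left this hc
      _ = 4 * ((2 : ℝ) ^ k * π ^ k * s ^ k) * Real.exp (-(s ^ 2 / (2 * h ^ 2))) := by ring
  have hGint : IntegrableOn G (Ioi (B / 2)) := by
    have hb : (0 : ℝ) < 1 / (2 * h ^ 2) := by positivity
    have hk : (-1 : ℝ) < k := by have := Nat.cast_nonneg (α := ℝ) k; linarith
    have hi := ((integrable_rpow_mul_exp_neg_mul_sq hb hk).const_mul (4 * (2 * π) ^ k)).integrableOn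
      (s := Ioi (B / 2))
    refine hi.congr_fun (fun s _ => ?_) measurableSet_Ioi
    simp only [hG, Real.rpow_natCast, mul_pow]
    have : -(1 / (2 * h ^ 2)) * s ^ 2 = -(s ^ 2 / (2 * h ^ 2)) := by ring
    rw [this]; ring
  -- the engine
  obtain ⟨hTsum, hTle⟩ := tsum_lattice_le (Φ := G) (a := B / 2) hB0 hG0 hGanti hGint
  set T : ℝ := ∑' m : ℕ, G (B / 2 + m * B) with hT
  -- the integral, by Lemma A.1
  have hInt : ∫ s in Ioi (B / 2), G s =
      4 * (2 * π) ^ k * ((2 : ℝ) ^ (((k : ℝ) - 1) / 2) * h ^ ((k : ℝ) + 1) *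
        upperIncGamma (((k : ℝ) + 1) / 2) (B ^ 2 / (8 * h ^ 2))) := by
    have hA1 := platt2017_lemmaA1 (κ := k) (x := B / 2) (h := h)
      (by have := Nat.cast_nonneg (α := ℝ) k; linarith) hB2 hh
    have harg : (B / 2) ^ 2 / (2 * h ^ 2) = B ^ 2 / (8 * h ^ 2) := by ring
    rw [harg] at hA1
    rw [← hA1, ← integral_const_mul]
    refine setIntegral_congr_fun measurableSet_Ioi fun s _ => ?_
    simp only [hG, Real.rpow_natCast, mul_pow]; ring
  -- termwise bounds on the two tails: `‖g(t)‖ ≤ G(|t|) ≤ G(B/2 + mB)` for `|t| ≥ B/2 + mB`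
  have hgG : ∀ t : ℝ, ‖g t‖ ≤ G |t| := fun t => by
    refine (hg t).trans (le_of_eq ?_)
    simp only [hG, sq_abs]
  have hGmono : ∀ (m : ℕ) (t : ℝ), B / 2 + m * B ≤ |t| → ‖g t‖ ≤ G (B / 2 + m * B) := by
    intro m t ht
    have hmB : (0 : ℝ) ≤ m * B := by positivity
    exact (hgG t).trans (hGanti (mem_Ici.mpr (by linarith)) (mem_Ici.mpr (by linarith)) ht)
  have hright : ∀ m : ℕ, ‖g (x + ((m : ℝ) + 1) * B)‖ ≤ G (B / 2 + m * B) := by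
    intro m
    apply hGmono
    have hmB : (0 : ℝ) < ((m : ℝ) + 1) * B := by positivity
    have h1 : |((m : ℝ) + 1) * B| - |-x| ≤ |((m : ℝ) + 1) * B - (-x)| := abs_sub_abs_le_abs_sub _ _
    rw [abs_neg, abs_of_pos hmB, sub_neg_eq_add, add_comm (((m : ℝ) + 1) * B) x] at h1
    linarith
  have hleft : ∀ m : ℕ, ‖g (x + (-((m : ℝ) + 1)) * B)‖ ≤ G (B / 2 + m * B) := by
    intro m
    apply hGmono
    have hmB : (0 : ℝ) < ((m : ℝ) + 1) * B := by positivity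
    have h1 : |((m : ℝ) + 1) * B| - |x| ≤ |((m : ℝ) + 1) * B - x| := abs_sub_abs_le_abs_sub _ _
    rw [abs_of_pos hmB] at h1
    have h2 : x + (-((m : ℝ) + 1)) * B = -(((m : ℝ) + 1) * B - x) := by ring
    rw [h2, abs_neg]
    linarith
  -- summability of the two tails and of the whole lattice
  set f : ℤ → ℂ := fun l => g (x + (l : ℝ) * B) with hf
  have hsum_right : Summable (fun m : ℕ => g (x + ((m : ℝ) + 1) * B)) :=
    Summable.of_norm_bounded hTsum hright
  have hsum_left : Summable (fun m : ℕ => g (x + (-((m : ℝ) + 1)) * B)) :=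
    Summable.of_norm_bounded hTsum hleft
  have hshift : (fun n : ℕ => f ((n + 1 : ℕ) : ℤ)) = fun m : ℕ => g (x + ((m : ℝ) + 1) * B) := by
    funext m; simp only [hf]; push_cast; ring_nf
  have hnegf : (fun n : ℕ => f (-(n + 1))) = fun m : ℕ => g (x + (-((m : ℝ) + 1)) * B) := by
    funext m; simp only [hf]; push_cast; ring_nf
  have hsum_nat : Summable (fun n : ℕ => f n) := by
    have h1 : Summable (fun n : ℕ => f ((n + 1 : ℕ) : ℤ)) := by rw [hshift]; exact hsum_right
    exact (summable_nat_add_iff 1).mp h1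
  have hsum_neg : Summable (fun n : ℕ => f (-(n + 1))) := by rw [hnegf]; exact hsum_left
  have hsumZ : Summable f := Summable.of_nat_of_neg_add_one hsum_nat hsum_neg
  refine ⟨hsumZ, ?_⟩
  -- the value: `Σ_ℤ f = (f 0 + S₊) + S₋`
  have hsplit : ∑' l : ℤ, f l = (∑' n : ℕ, f n) + ∑' n : ℕ, f (-(n + 1)) :=
    tsum_of_nat_of_neg_add_one hsum_nat hsum_neg
  have hnat : ∑' n : ℕ, f n = g x + ∑' m : ℕ, g (x + ((m : ℝ) + 1) * B) := by
    rw [hsum_nat.tsum_eq_zero_add]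
    congr 1
    · simp [hf]
    · have : (fun n : ℕ => f ((n : ℤ) + 1)) = fun m : ℕ => g (x + ((m : ℝ) + 1) * B) := by
        funext m; simp only [hf]; push_cast; ring_nf
      rw [← this]
      rfl
  have hneg : ∑' n : ℕ, f (-(n + 1)) = ∑' m : ℕ, g (x + (-((m : ℝ) + 1)) * B) := by rw [hnegf]
  have hfsum : ∑' l : ℤ, g (x + (l : ℝ) * B) = ∑' l : ℤ, f l := rfl
  rw [hfsum, hsplit, hnat, hneg]
  have hS1 : ‖∑' m : ℕ, g (x + ((m : ℝ) + 1) * B)‖ ≤ T := tsum_of_norm_bounded hTsum.hasSum hright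
  have hS2 : ‖∑' m : ℕ, g (x + (-((m : ℝ) + 1)) * B)‖ ≤ T := tsum_of_norm_bounded hTsum.hasSum hleft
  have hGB2 : G (B / 2) = 4 * (π * B) ^ k * Real.exp (-(B ^ 2 / (8 * h ^ 2))) := by
    simp only [hG]
    congr 2
    · ring
    · congr 1; ring
  have h2pow : (2 : ℝ) ^ ((3 * (k : ℝ) - 1) / 2) = (2 : ℝ) ^ k * (2 : ℝ) ^ (((k : ℝ) - 1) / 2) := by
    rw [← Real.rpow_natCast, ← Real.rpow_add two_pos]; congr 1; ring
  have hhpow : h ^ ((k : ℝ) + 1) = h ^ (k + 1) := by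
    rw [← Real.rpow_natCast]; congr 1; push_cast; ring
  set Γv : ℝ := upperIncGamma (((k : ℝ) + 1) / 2) (B ^ 2 / (8 * h ^ 2)) with hΓv
  set P : ℝ := (2 : ℝ) ^ (((k : ℝ) - 1) / 2) with hP
  have hfinal : 2 * (G (B / 2) + B⁻¹ * ∫ s in Ioi (B / 2), G s) =
      8 * (π * B) ^ k * (Real.exp (-(B ^ 2 / (8 * h ^ 2))) +
        (2 : ℝ) ^ ((3 * (k : ℝ) - 1) / 2) * (h / B) ^ (k + 1) * Γv) := by
    rw [hInt, hGB2, h2pow, hhpow, div_pow, mul_pow, mul_pow]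
    field_simp
    ring
  calc ‖g x + ∑' m : ℕ, g (x + ((m : ℝ) + 1) * B) + ∑' m : ℕ, g (x + (-((m : ℝ) + 1)) * B) - g x‖
      = ‖∑' m : ℕ, g (x + ((m : ℝ) + 1) * B) + ∑' m : ℕ, g (x + (-((m : ℝ) + 1)) * B)‖ := by
        congr 1; ring
    _ ≤ T + T := (norm_add_le _ _).trans (add_le_add hS1 hS2)
    _ ≤ 2 * (G (B / 2) + B⁻¹ * ∫ s in Ioi (B / 2), G s) := by linarith
    _ = _ := hfinal

/-- **Platt 2017, Lemma A.5 (p. 2459)** for Platt's own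
`g(t; k) = Γ((1/2+i(t+t₀))/2) exp(π(t+t₀)/4 − t²/(2h²)) (−2πit)^k` (§3 step (1), p. 2451; Lemma A.4):
for `h, B > 0`, `2h√k ≤ B` (the proviso the printed proof uses; printed hypothesis «`B > h√k`») and
`|x| ≤ B/2` (printed: `x = n/A`, `n ∈ [−N/2, N/2 − 1]`, `N = AB`): `l ↦ g(x + lB; k)` is summable over `ℤ`
(so the `B`-periodisation `g̃` of step (2) exists) and
`|g̃ − g| = |Σ_{l≠0} g(x + lB; k)| ≤ 8(πB)^k [exp(−B²/(8h²)) + 2^{(3k−1)/2} (h/B)^{k+1} Γ((k+1)/2, B²/(8h²))]`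
(`Γ(s, x)` = `upperIncGamma`). From `platt2017_lemmaA5_of_bound` and Lemma A.4 (`platt2017_lemmaA4`).
[cite: Platt2017, Lemma A.5 p. 2459] -/
theorem platt2017_lemmaA5 (k : ℕ) {t₀ h B x : ℝ} (hh : 0 < h) (hB0 : 0 < B)
    (hB : 2 * h * Real.sqrt k ≤ B) (hx : |x| ≤ B / 2) :
    Summable (fun l : ℤ =>
        Complex.Gamma ((1 / 2 + ((x + l * B) + t₀ : ℝ) * I) / 2) *
          Complex.exp ((π * ((x + l * B) + t₀) / 4 - (x + l * B) ^ 2 / (2 * h ^ 2) : ℝ) : ℂ) *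
          (-(2 * π * (x + l * B) : ℝ) * I) ^ k) ∧
      ‖∑' l : ℤ, Complex.Gamma ((1 / 2 + ((x + l * B) + t₀ : ℝ) * I) / 2) *
            Complex.exp ((π * ((x + l * B) + t₀) / 4 - (x + l * B) ^ 2 / (2 * h ^ 2) : ℝ) : ℂ) *
            (-(2 * π * (x + l * B) : ℝ) * I) ^ k -
          Complex.Gamma ((1 / 2 + (x + t₀ : ℝ) * I) / 2) *
            Complex.exp ((π * (x + t₀) / 4 - x ^ 2 / (2 * h ^ 2) : ℝ) : ℂ) *
            (-(2 * π * x : ℝ) * I) ^ k‖ ≤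
        8 * (π * B) ^ k * (Real.exp (-(B ^ 2 / (8 * h ^ 2))) +
          (2 : ℝ) ^ ((3 * (k : ℝ) - 1) / 2) * (h / B) ^ (k + 1) *
            upperIncGamma (((k : ℝ) + 1) / 2) (B ^ 2 / (8 * h ^ 2))) :=
  platt2017_lemmaA5_of_bound k hh hB0 hB hx
    (g := fun t : ℝ => Complex.Gamma ((1 / 2 + (t + t₀ : ℝ) * I) / 2) *
      Complex.exp ((π * (t + t₀) / 4 - t ^ 2 / (2 * h ^ 2) : ℝ) : ℂ) * (-(2 * π * t : ℝ) * I) ^ k)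
    (fun t => platt2017_lemmaA4 k t t₀ h)


/-! ### Lemma A.11: the aliasing error of step (8), both tails -/

namespace Platt2017

/-- **The left-tail input of Lemma A.11** («for any `n`, the right tail majorizes the left», p. 2463,
not spelled out in print). For `t₀ > e^e`, `A ≤ 3/4` with `|ζ(1/2+iu)| ≤ A u^{1/6} log u` for `u ≥ 3`,
and `s ≥ 0` — the sample point `t = −s ≤ 0`, ordinate `v = t₀ − s` — one has
`|Γ((1/2+iv)/2)| e^{πv/4} |ζ(1/2+iv)| ≤ 3 (s+t₀)^β`, `β = 1/6 + log log t₀ / log t₀`, i.e. the profile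
`3(|t|+t₀)^β` of Lemma A.10 also dominates at the reflected point. Cases: `v ≥ 3` and `v ≤ −3` by the
`ζ`-bound at `|v| ≤ s + t₀` (reflection `|ζ(1/2−iv)| = |ζ(1/2+iv)|`), `u^{1/6} log u` monotone and
`(s+t₀)^{1/6} log(s+t₀) ≤ (s+t₀)^β` (`log_le_rpow_loglog`); `|v| < 3` by `|ζ(1/2+iv)| ≤ 3.33`
(`norm_zeta_half_le_of_abs_le_three`), `s + t₀ ≥ 2t₀ − 3 ≥ 27` (`e^e ≥ 15`) and
`(s+t₀)^β ≥ 27^{1/6} · log t₀ ≥ 1.732 · 2.718`, so `4 · 3.33 ≤ 3 (s+t₀)^β`; the Gamma factor by the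
trivial bound `4`. [cite: Platt2017, Lemma A.11 p. 2463 (proof: «the right tail majorizes the left»)] -/
theorem norm_Lambda_reflected_le {A t₀ s : ℝ} (hA : A ≤ 3 / 4) (ht₀ : Real.exp (Real.exp 1) < t₀)
    (hs : 0 ≤ s)
    (hζ : ∀ u : ℝ, 3 ≤ u → ‖riemannZeta (1 / 2 + u * I)‖ ≤ A * u ^ (1 / 6 : ℝ) * Real.log u) :
    ‖Complex.Gamma ((1 / 2 + (t₀ - s : ℝ) * I) / 2)‖ * Real.exp (π * (t₀ - s) / 4) *
        ‖riemannZeta (1 / 2 + (t₀ - s : ℝ) * I)‖ ≤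
      3 * (s + t₀) ^ (1 / 6 + Real.log (Real.log t₀) / Real.log t₀) := by
  have ht₀15 : 15 ≤ t₀ := fifteen_le_exp_exp_one.trans ht₀.le
  have ht₀pos : 0 < t₀ := by linarith
  have ht₀1 : 1 < t₀ := by linarith
  set v : ℝ := t₀ - s with hv
  set u : ℝ := s + t₀ with hu_def
  set c : ℝ := Real.log (Real.log t₀) / Real.log t₀ with hc
  have hu : t₀ ≤ u := by rw [hu_def]; linarith
  have hupos : 0 < u := by linarith
  have hu1 : 1 ≤ u := by linarith
  -- `log t₀ ≥ e`, `c > 0`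
  have hlt₀ : Real.exp 1 ≤ Real.log t₀ := by
    have := Real.log_le_log (Real.exp_pos _) ht₀.le
    rwa [Real.log_exp] at this
  have he1 : (2.7182818283 : ℝ) < Real.exp 1 := Real.exp_one_gt_d9
  have hlt₀pos : 0 < Real.log t₀ := by linarith
  have hc0 : 0 < c := div_pos (Real.log_pos (by linarith)) hlt₀pos
  have hΓ := norm_Gamma_half_line_mul_exp_lt_four v
  have hΓ0 : 0 ≤ ‖Complex.Gamma ((1 / 2 + (v : ℂ) * I) / 2)‖ * Real.exp (π * v / 4) := by positivity
  -- `u^β = u^{1/6} u^c`, `u^c ≥ log t₀`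
  have hsplit : u ^ (1 / 6 + c) = u ^ (1 / 6 : ℝ) * u ^ c := Real.rpow_add hupos _ _
  have huc : Real.log t₀ ≤ u ^ c := by
    rw [← rpow_loglog_div_log_self ht₀1]
    exact Real.rpow_le_rpow ht₀pos.le hu hc0.le
  have hu16 : 0 < u ^ (1 / 6 : ℝ) := Real.rpow_pos_of_pos hupos _
  have huc0 : 0 < u ^ c := Real.rpow_pos_of_pos hupos _
  -- the `ζ`-route for an ordinate `w ≥ 3` with `w ≤ u`
  have route : ∀ w : ℝ, 3 ≤ w → w ≤ u →
      ‖riemannZeta (1 / 2 + w * I)‖ ≤ 3 / 4 * u ^ (1 / 6 + c) := by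
    intro w hw3 hwu
    have hz := hζ w hw3
    have hw16 : 0 < w ^ (1 / 6 : ℝ) := Real.rpow_pos_of_pos (by linarith) _
    have hlw : 0 < Real.log w := Real.log_pos (by linarith)
    have hA0 : 0 ≤ A := by
      have h0 : 0 * (w ^ (1 / 6 : ℝ) * Real.log w) ≤ A * (w ^ (1 / 6 : ℝ) * Real.log w) := by
        rw [zero_mul, ← mul_assoc]; exact (norm_nonneg _).trans hz
      exact le_of_mul_le_mul_right h0 (mul_pos hw16 hlw)
    have hmono := rpow_sixth_mul_log_mono (by linarith : (1 : ℝ) ≤ w) hwu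
    have hlog := log_le_rpow_loglog ht₀.le hu
    calc ‖riemannZeta (1 / 2 + w * I)‖ ≤ A * (w ^ (1 / 6 : ℝ) * Real.log w) := by rw [← mul_assoc]; exact hz
      _ ≤ A * (u ^ (1 / 6 : ℝ) * Real.log u) := mul_le_mul_of_nonneg_left hmono hA0
      _ ≤ A * (u ^ (1 / 6 : ℝ) * u ^ c) :=
          mul_le_mul_of_nonneg_left (mul_le_mul_of_nonneg_left hlog hu16.le) hA0
      _ = A * u ^ (1 / 6 + c) := by rw [hsplit]
      _ ≤ 3 / 4 * u ^ (1 / 6 + c) := mul_le_mul_of_nonneg_right hA (by positivity)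
  -- the bound on `‖ζ(1/2+iv)‖` in all three cases
  have hzeta : ‖riemannZeta (1 / 2 + (v : ℂ) * I)‖ ≤ 3 / 4 * u ^ (1 / 6 + c) := by
    rcases le_or_gt 3 v with hv3 | hv3
    · exact route v hv3 (by linarith)
    rcases le_or_gt v (-3) with hvm | hvm
    · -- reflect
      have hrefl := norm_zeta_half_neg (-v)
      simp only [neg_neg] at hrefl
      rw [hrefl]
      exact route (-v) (by linarith) (by linarith)
    · -- `|v| < 3`
      have habs : |v| ≤ 3 := abs_le.mpr ⟨hvm.le, hv3.le⟩
      have hz := norm_zeta_half_le_of_abs_le_three habs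
      -- `u ≥ 27`, `u^{1/6} ≥ 1.732`, `u^c ≥ log t₀ > 2.718`
      have hu27 : 27 ≤ u := by rw [hu_def]; linarith
      have hu6 : (1.732 : ℝ) ≤ u ^ (1 / 6 : ℝ) := by
        have h0 : (1.732 : ℝ) ^ (6 : ℕ) ≤ u := by norm_num; linarith
        have h1 := Real.rpow_le_rpow (by norm_num) h0 (by norm_num : (0 : ℝ) ≤ 1 / 6)
        have h2 : ((1.732 : ℝ) ^ (6 : ℕ)) ^ (1 / 6 : ℝ) = 1.732 := by
          rw [show (1 / 6 : ℝ) = ((6 : ℕ) : ℝ)⁻¹ by norm_num]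
          exact Real.pow_rpow_inv_natCast (by norm_num) (by norm_num)
        rw [h2] at h1; exact h1
      have hucb : (2.718 : ℝ) ≤ u ^ c := by linarith
      rw [hsplit]
      nlinarith [mul_le_mul hu6 hucb (by norm_num) hu16.le]
  calc ‖Complex.Gamma ((1 / 2 + (v : ℂ) * I) / 2)‖ * Real.exp (π * v / 4) *
        ‖riemannZeta (1 / 2 + (v : ℂ) * I)‖
      ≤ 4 * (3 / 4 * u ^ (1 / 6 + c)) := mul_le_mul hΓ.le hzeta (norm_nonneg _) (by norm_num)
    _ = 3 * u ^ (1 / 6 + c) := by ring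

/-- The Lemma A.10/A.11 profile `(s+t₀)^β e^{−s²/(2h²)}` is decreasing on `[B/2, ∞)` once
`βh²/t₀ ≤ B/2` («the lower bound on `B` ensures that the bound of Lemma A.10 is decreasing for
`t ≥ B/2`»): for `B/2 ≤ s ≤ s'`, `((s'+t₀)/(s+t₀))^β ≤ e^{β(s'−s)/(s+t₀)} ≤ e^{(s'²−s²)/(2h²)}` since
`βh² ≤ (B/2)t₀ ≤ s(s+t₀)`. [cite: Platt2017, Lemma A.11 p. 2463 (proof, first sentence)] -/
theorem profile_antitone {β t₀ h B s s' : ℝ} (hβ : 0 ≤ β) (ht₀ : 0 < t₀) (hh : 0 < h)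
    (hBlo : β * h ^ 2 / t₀ ≤ B / 2) (hs : B / 2 ≤ s) (hs0 : 0 < s) (hss' : s ≤ s') :
    (s' + t₀) ^ β * Real.exp (-(s' ^ 2 / (2 * h ^ 2))) ≤
      (s + t₀) ^ β * Real.exp (-(s ^ 2 / (2 * h ^ 2))) := by
  have hst : 0 < s + t₀ := by linarith
  have hst' : 0 < s' + t₀ := by linarith
  -- `((s'+t₀)/(s+t₀))^β ≤ exp(β((s'+t₀)/(s+t₀) - 1))`
  set q : ℝ := (s' + t₀) / (s + t₀) with hq
  have hq0 : 0 ≤ q := by positivity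
  have h1 : q ^ β ≤ Real.exp (β * (q - 1)) := by
    have hq1 : q ≤ Real.exp (q - 1) := by linarith [Real.add_one_le_exp (q - 1)]
    calc q ^ β ≤ (Real.exp (q - 1)) ^ β := Real.rpow_le_rpow hq0 hq1 hβ
      _ = Real.exp (β * (q - 1)) := by rw [← Real.exp_mul]; ring_nf
  have h2 : β * (q - 1) ≤ (s' ^ 2 - s ^ 2) / (2 * h ^ 2) := by
    have hq1 : q - 1 = (s' - s) / (s + t₀) := by
      rw [hq]; field_simp; ring
    rw [hq1, mul_div_assoc', div_le_div_iff₀ hst (by positivity)]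
    have hd : 0 ≤ s' - s := by linarith
    have hkey : β * h ^ 2 ≤ s * (s + t₀) := by
      have h3 : β * h ^ 2 ≤ B / 2 * t₀ := by rwa [div_le_iff₀ ht₀] at hBlo
      nlinarith
    calc β * (s' - s) * (2 * h ^ 2) = (s' - s) * (2 * (β * h ^ 2)) := by ring
      _ ≤ (s' - s) * (2 * (s * (s + t₀))) := by gcongr
      _ ≤ (s' - s) * ((s' + s) * (s + t₀)) := by
          apply mul_le_mul_of_nonneg_left _ hd
          nlinarith
      _ = (s' ^ 2 - s ^ 2) * (s + t₀) := by ring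
  have h3 : q ^ β ≤ Real.exp ((s' ^ 2 - s ^ 2) / (2 * h ^ 2)) := h1.trans (Real.exp_le_exp.mpr h2)
  have h4 : (s' + t₀) ^ β = (s + t₀) ^ β * q ^ β := by
    rw [← Real.mul_rpow hst.le hq0]; congr 1; rw [hq]; field_simp
  rw [h4, mul_assoc]
  apply mul_le_mul_of_nonneg_left _ (by positivity)
  calc q ^ β * Real.exp (-(s' ^ 2 / (2 * h ^ 2)))
      ≤ Real.exp ((s' ^ 2 - s ^ 2) / (2 * h ^ 2)) * Real.exp (-(s' ^ 2 / (2 * h ^ 2))) :=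
        mul_le_mul_of_nonneg_right h3 (Real.exp_pos _).le
    _ = Real.exp (-(s ^ 2 / (2 * h ^ 2))) := by rw [← Real.exp_add]; congr 1; ring

end Platt2017


set_option maxHeartbeats 400000 in
open Platt2017 in
/-- **Platt 2017, Lemma A.11 (p. 2463)** — the aliasing error of step (8), `f̃(n) − f((n−N/2)/A) =
Σ_{l≠0} f((n−N/2)/A + lB)`, BOTH TAILS PROVED. Printed: «For `t ≥ 0` and `t₀ > exp(e)` set
`β = 1/6 + log log t₀ / log t₀`. Then providing `βh²/t₀ ≤ B/2 ≤ t₀` and `n ∈ [0, N−1]` we have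
`|Σ_{l∈ℤ≠0} f((n−N/2)/A + lB)| ≤ 6(X + (2^β h/B)(Y+Z))`, where `X = (B/2 + t₀)^β exp(−B²/(8h²))`,
`Y = 2^{−1/2} t₀^β Γ(1/2, B²/(8h²))`, and `Z = 2^{β−1/2} h^β Γ((β+1)/2, t₀²/(2h²))`. *Proof.* The lower
bound on `B` ensures that the bound of Lemma A.10 is decreasing for `t ≥ B/2`. The worst case is when
`n = 0` and for any `n`, the right tail majorizes the left. The first missing term to the right is `f(B/2)`
and the remaining terms are majorized by `|3∫_0^∞ ((2w+1)B/2 + t₀)^β exp(−((2w+1)B/2)²/(2h²)) dw| ≤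
(3/B)|∫_{B/2}^{t₀} (2t₀)^β e^{−t²/(2h²)} dt + ∫_{t₀}^∞ (2t)^β e^{−t²/(2h²)} dt|`. The result follows from
Lemma A.1.» Typed for real `x` with `|x| ≤ B/2` (covers `x = (n−N/2)/A`, `N = AB`, `n ∈ [0, N−1]`), with
`f(t) = π^{−i(t+t₀)/2} Γ((1/2+i(t+t₀))/2) ζ(1/2+i(t+t₀)) exp(π(t+t₀)/4 − t²/(2h²))` written out and the
`ζ`-input explicit (`|ζ(1/2+iu)| ≤ A u^{1/6} log u` for `u ≥ 3`, any `A ≤ 3/4`: Platt's (A.2) has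
`A = 0.732` for `u > 2`; the tree's `zeta_half_line_hiary_patel_yang` has `0.618`, `u ≥ 3` —
`platt2017_lemmaA11_of_hpy`). The right tail is the printed argument (`Platt2017.lattice_two_sided`,
`profile_antitone`, Lemma A.1 twice; the proof yields `2^{(β−1)/2}` where the paper prints the larger
`2^{β−1/2}` in `Z` — the printed `Z` is kept); the LEFT tail, which the paper asserts without proof,
is `Platt2017.norm_Lambda_reflected_le` (the profile `3(|t|+t₀)^β e^{−t²/(2h²)}` also dominates `|f(t)|`
for `t ≤ 0`, using `|ζ(1/2−iv)| = |ζ(1/2+iv)|`, the `ζ`-bound from `|v| ≥ 3` and `|ζ(1/2+iv)| ≤ 3.33` on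
`|v| ≤ 3` from the tree's certified Riemann–Siegel runs). Conclusion typed as: `l ↦ f(x+lB)` summable
over `ℤ` and `‖Σ_{l∈ℤ} f(x+lB) − f(x)‖ ≤` the printed right-hand side (`Γ(s,x)` = `upperIncGamma`).
[cite: Platt2017, Lemma A.11 p. 2463] -/
theorem platt2017_lemmaA11 {A t₀ h B x β : ℝ} (hA : A ≤ 3 / 4)
    (hζ : ∀ u : ℝ, 3 ≤ u → ‖riemannZeta (1 / 2 + u * I)‖ ≤ A * u ^ (1 / 6 : ℝ) * Real.log u)
    (ht₀ : Real.exp (Real.exp 1) < t₀) (hh : 0 < h) (hB0 : 0 < B)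
    (hβ : β = 1 / 6 + Real.log (Real.log t₀) / Real.log t₀) (hBlo : β * h ^ 2 / t₀ ≤ B / 2)
    (hBhi : B / 2 ≤ t₀) (hx : |x| ≤ B / 2) :
    Summable (fun l : ℤ =>
        (π : ℂ) ^ (-(I * ((x + l * B) + t₀ : ℝ) / 2)) *
          Complex.Gamma ((1 / 2 + ((x + l * B) + t₀ : ℝ) * I) / 2) *
          riemannZeta (1 / 2 + ((x + l * B) + t₀ : ℝ) * I) *
          Complex.exp ((π * ((x + l * B) + t₀) / 4 - (x + l * B) ^ 2 / (2 * h ^ 2) : ℝ) : ℂ)) ∧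
      ‖∑' l : ℤ, (π : ℂ) ^ (-(I * ((x + l * B) + t₀ : ℝ) / 2)) *
            Complex.Gamma ((1 / 2 + ((x + l * B) + t₀ : ℝ) * I) / 2) *
            riemannZeta (1 / 2 + ((x + l * B) + t₀ : ℝ) * I) *
            Complex.exp ((π * ((x + l * B) + t₀) / 4 - (x + l * B) ^ 2 / (2 * h ^ 2) : ℝ) : ℂ) -
          (π : ℂ) ^ (-(I * (x + t₀ : ℝ) / 2)) * Complex.Gamma ((1 / 2 + (x + t₀ : ℝ) * I) / 2) *
            riemannZeta (1 / 2 + (x + t₀ : ℝ) * I) *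
            Complex.exp ((π * (x + t₀) / 4 - x ^ 2 / (2 * h ^ 2) : ℝ) : ℂ)‖ ≤
        6 * ((B / 2 + t₀) ^ β * Real.exp (-(B ^ 2 / (8 * h ^ 2))) +
          (2 : ℝ) ^ β * h / B *
            ((2 : ℝ) ^ (-(1 / 2 : ℝ)) * t₀ ^ β * upperIncGamma (1 / 2) (B ^ 2 / (8 * h ^ 2)) +
              (2 : ℝ) ^ (β - 1 / 2) * h ^ β * upperIncGamma ((β + 1) / 2) (t₀ ^ 2 / (2 * h ^ 2)))) := by
  have ht₀15 : 15 ≤ t₀ := fifteen_le_exp_exp_one.trans ht₀.le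
  have ht₀pos : 0 < t₀ := by linarith
  have ht₀1 : 1 < t₀ := by linarith
  have hB2 : 0 < B / 2 := by linarith
  have hlt₀ : Real.exp 1 ≤ Real.log t₀ := by
    have := Real.log_le_log (Real.exp_pos _) ht₀.le
    rwa [Real.log_exp] at this
  have he1 : (2.7182818283 : ℝ) < Real.exp 1 := Real.exp_one_gt_d9
  have hc0 : 0 < Real.log (Real.log t₀) / Real.log t₀ :=
    div_pos (Real.log_pos (by linarith)) (by linarith)
  have hβ0 : 0 ≤ β := by rw [hβ]; positivity
  have hβ1 : -1 < β := by linarith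
  -- the sampled function and the profile
  set F : ℝ → ℂ := fun t => (π : ℂ) ^ (-(I * (t + t₀ : ℝ) / 2)) *
      Complex.Gamma ((1 / 2 + (t + t₀ : ℝ) * I) / 2) * riemannZeta (1 / 2 + (t + t₀ : ℝ) * I) *
      Complex.exp ((π * (t + t₀) / 4 - t ^ 2 / (2 * h ^ 2) : ℝ) : ℂ) with hF
  set P : ℝ → ℝ := fun s => 3 * (s + t₀) ^ β * Real.exp (-(s ^ 2 / (2 * h ^ 2))) with hP
  have hP0 : ∀ s, B / 2 ≤ s → 0 ≤ P s := fun s hs => by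
    simp only [hP]
    have : 0 ≤ s + t₀ := by linarith
    positivity
  have hPanti : AntitoneOn P (Ici (B / 2)) := by
    intro s hs s' _ hss'
    simp only [hP, mul_assoc]
    exact mul_le_mul_of_nonneg_left
      (profile_antitone hβ0 ht₀pos hh hBlo hs (hB2.trans_le hs) hss') (by norm_num)
  -- integrability of the profile on `(B/2, ∞)` by domination with `3((2t₀)^β + 2^β s^β) e^{−s²/(2h²)}`
  have hb : (0 : ℝ) < 1 / (2 * h ^ 2) := by positivity
  have hint0 : Integrable fun s : ℝ => s ^ (0 : ℝ) * Real.exp (-(1 / (2 * h ^ 2)) * s ^ 2) :=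
    integrable_rpow_mul_exp_neg_mul_sq hb (by norm_num)
  have hintβ : Integrable fun s : ℝ => s ^ β * Real.exp (-(1 / (2 * h ^ 2)) * s ^ 2) :=
    integrable_rpow_mul_exp_neg_mul_sq hb hβ1
  have hexp_eq : ∀ s : ℝ, Real.exp (-(1 / (2 * h ^ 2)) * s ^ 2) = Real.exp (-(s ^ 2 / (2 * h ^ 2))) :=
    fun s => by congr 1; ring
  have hPcont : ContinuousOn P (Ioi (B / 2)) := by
    simp only [hP]
    refine ContinuousOn.mul (ContinuousOn.mul continuousOn_const ?_) (Continuous.continuousOn (by fun_prop))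
    exact ContinuousOn.rpow_const (by fun_prop) fun s hs => Or.inl (by
      have : B / 2 < s := hs; linarith)
  have hPint : IntegrableOn P (Ioi (B / 2)) := by
    have hdom : IntegrableOn (fun s : ℝ => 3 * ((2 * t₀) ^ β * (s ^ (0 : ℝ) * Real.exp (-(1 / (2 * h ^ 2)) * s ^ 2)) +
        (2 : ℝ) ^ β * (s ^ β * Real.exp (-(1 / (2 * h ^ 2)) * s ^ 2)))) (Ioi (B / 2)) :=
      (((hint0.const_mul _).add (hintβ.const_mul _)).const_mul 3).integrableOn
    refine Integrable.mono' hdom (hPcont.aestronglyMeasurable measurableSet_Ioi) ?_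
    refine ae_restrict_of_forall_mem measurableSet_Ioi fun s hs => ?_
    have hs0 : 0 < s := hB2.trans hs
    have hst : 0 ≤ s + t₀ := by linarith
    rw [Real.norm_of_nonneg (hP0 s (le_of_lt hs))]
    simp only [hP, Real.rpow_zero, one_mul, hexp_eq]
    -- `(s+t₀)^β ≤ (2t₀)^β + (2s)^β = (2t₀)^β + 2^β s^β`
    have hsum : (s + t₀) ^ β ≤ (2 * t₀) ^ β + (2 : ℝ) ^ β * s ^ β := by
      rw [← Real.mul_rpow (by norm_num) hs0.le]
      rcases le_or_gt s t₀ with h1 | h1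
      · have : (s + t₀) ^ β ≤ (2 * t₀) ^ β := Real.rpow_le_rpow hst (by linarith) hβ0
        linarith [Real.rpow_nonneg (by linarith : (0 : ℝ) ≤ 2 * s) β]
      · have : (s + t₀) ^ β ≤ (2 * s) ^ β := Real.rpow_le_rpow hst (by linarith) hβ0
        linarith [Real.rpow_nonneg (by linarith : (0 : ℝ) ≤ 2 * t₀) β]
    have hE := Real.exp_pos (-(s ^ 2 / (2 * h ^ 2)))
    nlinarith [mul_le_mul_of_nonneg_right hsum hE.le]
  -- the pointwise domination `‖F t‖ ≤ P |t|` for `|t| ≥ B/2`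
  have hζt₀ : ∀ u : ℝ, t₀ ≤ u → ‖riemannZeta (1 / 2 + u * I)‖ ≤ A * u ^ (1 / 6 : ℝ) * Real.log u :=
    fun u hu => hζ u (by linarith)
  have hFP : ∀ t : ℝ, B / 2 ≤ |t| → ‖F t‖ ≤ P |t| := by
    intro t ht
    rcases le_or_gt 0 t with ht0 | ht0
    · -- right: Lemma A.10
      have h10 := platt2017_lemmaA10 (h := h) hA ht₀ ht0 hζt₀
      rw [abs_of_nonneg ht0]
      simp only [hF, hP, hβ]
      exact h10
    · -- left: the reflected bound
      have hs : 0 ≤ -t := by linarith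
      have hL := norm_Lambda_reflected_le (s := -t) hA ht₀ hs hζ
      have e1 : t₀ - -t = t + t₀ := by ring
      rw [e1] at hL
      rw [abs_of_neg ht0]
      simp only [hF, hP, hβ]
      rw [norm_mul, norm_mul, norm_mul, norm_pi_cpow_neg_I_mul, one_mul, Complex.norm_exp,
        Complex.ofReal_re, sub_eq_add_neg, Real.exp_add, neg_sq]
      have hE := Real.exp_pos (-(t ^ 2 / (2 * h ^ 2)))
      calc ‖Complex.Gamma ((1 / 2 + ((t + t₀ : ℝ) : ℂ) * I) / 2)‖ *
            ‖riemannZeta (1 / 2 + ((t + t₀ : ℝ) : ℂ) * I)‖ *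
            (Real.exp (π * (t + t₀) / 4) * Real.exp (-(t ^ 2 / (2 * h ^ 2))))
          = (‖Complex.Gamma ((1 / 2 + ((t + t₀ : ℝ) : ℂ) * I) / 2)‖ * Real.exp (π * (t + t₀) / 4) *
              ‖riemannZeta (1 / 2 + ((t + t₀ : ℝ) : ℂ) * I)‖) * Real.exp (-(t ^ 2 / (2 * h ^ 2))) := by
            ring
        _ ≤ 3 * (-t + t₀) ^ (1 / 6 + Real.log (Real.log t₀) / Real.log t₀) *
              Real.exp (-(t ^ 2 / (2 * h ^ 2))) := mul_le_mul_of_nonneg_right hL hE.le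
  -- the engine
  obtain ⟨hsum, hle⟩ := lattice_two_sided (F := F) (P := P) hB0 hx hP0 hPanti hPint hFP
  -- evaluate `P(B/2)` and bound `∫ P`
  have hPB2 : P (B / 2) = 3 * ((B / 2 + t₀) ^ β * Real.exp (-(B ^ 2 / (8 * h ^ 2)))) := by
    simp only [hP]
    rw [mul_assoc]
    congr 3
    ring
  set Γ₁ : ℝ := upperIncGamma (1 / 2) (B ^ 2 / (8 * h ^ 2)) with hΓ₁
  set Γ₂ : ℝ := upperIncGamma ((β + 1) / 2) (t₀ ^ 2 / (2 * h ^ 2)) with hΓ₂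
  -- Lemma A.1 twice
  have hA1a : ∫ s in Ioi (B / 2), Real.exp (-(s ^ 2 / (2 * h ^ 2))) = (2 : ℝ) ^ (-(1 / 2 : ℝ)) * h * Γ₁ := by
    have h1 := platt2017_lemmaA1 (κ := 0) (x := B / 2) (h := h) (by norm_num) hB2 hh
    simp only [Real.rpow_zero, one_mul] at h1
    rw [h1, hΓ₁]
    have e1 : (B / 2) ^ 2 / (2 * h ^ 2) = B ^ 2 / (8 * h ^ 2) := by ring
    rw [e1]
    norm_num
  have hA1b : ∫ s in Ioi t₀, s ^ β * Real.exp (-(s ^ 2 / (2 * h ^ 2))) =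
      (2 : ℝ) ^ ((β - 1) / 2) * h ^ (β + 1) * Γ₂ :=
    platt2017_lemmaA1 (κ := β) (x := t₀) (h := h) hβ1 ht₀pos hh
  -- split `∫_{B/2}^∞ P = ∫_{(B/2, t₀]} P + ∫_{t₀}^∞ P`
  have hunion : Ioc (B / 2) t₀ ∪ Ioi t₀ = Ioi (B / 2) := Ioc_union_Ioi_eq_Ioi hBhi
  have hsplit : ∫ s in Ioi (B / 2), P s = (∫ s in Ioc (B / 2) t₀, P s) + ∫ s in Ioi t₀, P s := by
    rw [← hunion]
    exact setIntegral_union (Set.Ioc_disjoint_Ioi le_rfl) measurableSet_Ioi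
      (hPint.mono_set (by rw [← hunion]; exact subset_union_left))
      (hPint.mono_set (by rw [← hunion]; exact subset_union_right))
  -- (i) the middle piece
  have hmid : ∫ s in Ioc (B / 2) t₀, P s ≤ 3 * (2 * t₀) ^ β * ((2 : ℝ) ^ (-(1 / 2 : ℝ)) * h * Γ₁) := by
    have hgi : IntegrableOn (fun s : ℝ => Real.exp (-(s ^ 2 / (2 * h ^ 2)))) (Ioi (B / 2)) := by
      refine (hint0.integrableOn (s := Ioi (B / 2))).congr_fun (fun s _ => ?_) measurableSet_Ioi
      simp only [Real.rpow_zero, one_mul, hexp_eq]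
    have h1 : ∫ s in Ioc (B / 2) t₀, P s ≤ ∫ s in Ioc (B / 2) t₀, 3 * (2 * t₀) ^ β * Real.exp (-(s ^ 2 / (2 * h ^ 2))) := by
      refine setIntegral_mono_on (hPint.mono_set Ioc_subset_Ioi_self)
        ((hgi.mono_set Ioc_subset_Ioi_self).const_mul _) measurableSet_Ioc fun s hs => ?_
      simp only [hP]
      have hs0 : 0 < s := hB2.trans hs.1
      have : (s + t₀) ^ β ≤ (2 * t₀) ^ β := Real.rpow_le_rpow (by linarith) (by linarith [hs.2]) hβ0
      have hE := Real.exp_pos (-(s ^ 2 / (2 * h ^ 2)))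
      nlinarith
    have h2 : ∫ s in Ioc (B / 2) t₀, Real.exp (-(s ^ 2 / (2 * h ^ 2))) ≤
        ∫ s in Ioi (B / 2), Real.exp (-(s ^ 2 / (2 * h ^ 2))) :=
      setIntegral_mono_set hgi
        (ae_restrict_of_forall_mem measurableSet_Ioi fun s _ => (Real.exp_pos _).le)
        Ioc_subset_Ioi_self.eventuallyLE
    rw [hA1a] at h2
    refine h1.trans ?_
    rw [integral_const_mul]
    exact mul_le_mul_of_nonneg_left h2 (by positivity)
  -- (ii) the far piece
  have hfar : ∫ s in Ioi t₀, P s ≤ 3 * (2 : ℝ) ^ β * ((2 : ℝ) ^ ((β - 1) / 2) * h ^ (β + 1) * Γ₂) := by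
    have hgi : IntegrableOn (fun s : ℝ => s ^ β * Real.exp (-(s ^ 2 / (2 * h ^ 2)))) (Ioi t₀) := by
      refine (hintβ.integrableOn (s := Ioi t₀)).congr_fun (fun s _ => ?_) measurableSet_Ioi
      simp only [hexp_eq]
    have h1 : ∫ s in Ioi t₀, P s ≤ ∫ s in Ioi t₀, 3 * (2 : ℝ) ^ β * (s ^ β * Real.exp (-(s ^ 2 / (2 * h ^ 2)))) := by
      refine setIntegral_mono_on (hPint.mono_set (Ioi_subset_Ioi hBhi)) (hgi.const_mul _)
        measurableSet_Ioi fun s hs => ?_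
      simp only [hP]
      have hs0 : 0 < s := ht₀pos.trans hs
      have h2s : (s + t₀) ^ β ≤ (2 : ℝ) ^ β * s ^ β := by
        rw [← Real.mul_rpow (by norm_num) hs0.le]
        exact Real.rpow_le_rpow (by linarith) (by linarith [(show t₀ < s from hs).le]) hβ0
      have hE := Real.exp_pos (-(s ^ 2 / (2 * h ^ 2)))
      nlinarith [Real.rpow_nonneg hs0.le β]
    rw [integral_const_mul, hA1b] at h1
    exact h1
  -- assemble
  have h2βZ : (2 : ℝ) ^ ((β - 1) / 2) ≤ (2 : ℝ) ^ (β - 1 / 2) :=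
    Real.rpow_le_rpow_of_exponent_le (by norm_num) (by linarith)
  have hΓ₂0 : 0 ≤ Γ₂ := by
    rw [hΓ₂]; unfold upperIncGamma
    exact setIntegral_nonneg measurableSet_Ioi fun s hs => by
      have : 0 < s := lt_trans (by positivity) hs
      positivity
  have hΓ₁0 : 0 ≤ Γ₁ := by
    rw [hΓ₁]; unfold upperIncGamma
    exact setIntegral_nonneg measurableSet_Ioi fun s hs => by
      have : 0 < s := lt_trans (by positivity) hs
      positivity
  have hInt_le : ∫ s in Ioi (B / 2), P s ≤
      3 * (2 : ℝ) ^ β * h * ((2 : ℝ) ^ (-(1 / 2 : ℝ)) * t₀ ^ β * Γ₁ + (2 : ℝ) ^ (β - 1 / 2) * h ^ β * Γ₂) := by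
    rw [hsplit]
    have h2t : (2 * t₀) ^ β = (2 : ℝ) ^ β * t₀ ^ β := Real.mul_rpow (by norm_num) ht₀pos.le
    have hhβ : h ^ (β + 1) = h ^ β * h := by rw [Real.rpow_add hh, Real.rpow_one]
    rw [h2t] at hmid
    rw [hhβ] at hfar
    have hfar' : ∫ s in Ioi t₀, P s ≤ 3 * (2 : ℝ) ^ β * ((2 : ℝ) ^ (β - 1 / 2) * (h ^ β * h) * Γ₂) := by
      refine hfar.trans ?_
      have : (2 : ℝ) ^ ((β - 1) / 2) * (h ^ β * h) * Γ₂ ≤ (2 : ℝ) ^ (β - 1 / 2) * (h ^ β * h) * Γ₂ := by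
        apply mul_le_mul_of_nonneg_right _ hΓ₂0
        exact mul_le_mul_of_nonneg_right h2βZ (by positivity)
      exact mul_le_mul_of_nonneg_left this (by positivity)
    calc (∫ s in Ioc (B / 2) t₀, P s) + ∫ s in Ioi t₀, P s
        ≤ 3 * ((2 : ℝ) ^ β * t₀ ^ β) * ((2 : ℝ) ^ (-(1 / 2 : ℝ)) * h * Γ₁) +
          3 * (2 : ℝ) ^ β * ((2 : ℝ) ^ (β - 1 / 2) * (h ^ β * h) * Γ₂) := add_le_add hmid hfar'
      _ = 3 * (2 : ℝ) ^ β * h * ((2 : ℝ) ^ (-(1 / 2 : ℝ)) * t₀ ^ β * Γ₁ + (2 : ℝ) ^ (β - 1 / 2) * h ^ β * Γ₂) := by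
          ring
  have hBinv : 0 ≤ B⁻¹ := inv_nonneg.mpr hB0.le
  have haux : 2 * (P (B / 2) + B⁻¹ * ∫ s in Ioi (B / 2), P s) ≤
      6 * ((B / 2 + t₀) ^ β * Real.exp (-(B ^ 2 / (8 * h ^ 2))) +
          (2 : ℝ) ^ β * h / B *
            ((2 : ℝ) ^ (-(1 / 2 : ℝ)) * t₀ ^ β * Γ₁ + (2 : ℝ) ^ (β - 1 / 2) * h ^ β * Γ₂)) := by
    calc 2 * (P (B / 2) + B⁻¹ * ∫ s in Ioi (B / 2), P s)
          ≤ 2 * (3 * ((B / 2 + t₀) ^ β * Real.exp (-(B ^ 2 / (8 * h ^ 2)))) +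
          B⁻¹ * (3 * (2 : ℝ) ^ β * h *
            ((2 : ℝ) ^ (-(1 / 2 : ℝ)) * t₀ ^ β * Γ₁ + (2 : ℝ) ^ (β - 1 / 2) * h ^ β * Γ₂))) := by
            rw [hPB2]
            have := mul_le_mul_of_nonneg_left hInt_le hBinv
            linarith
      _ = 6 * ((B / 2 + t₀) ^ β * Real.exp (-(B ^ 2 / (8 * h ^ 2))) +
          (2 : ℝ) ^ β * h / B *
            ((2 : ℝ) ^ (-(1 / 2 : ℝ)) * t₀ ^ β * Γ₁ + (2 : ℝ) ^ (β - 1 / 2) * h ^ β * Γ₂)) := by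
            field_simp
            ring
  exact ⟨hsum, hle.trans haux⟩



/-- **Platt 2017, Lemma A.11 (p. 2463), as printed** — hypothesis (A.2) = [22] = Platt–Trudgian 2015
verbatim («for `t > 2`, `|ζ(1/2+it)| ≤ 0.732 t^{1/6} log t`»), both tails.
[cite: Platt2017, Lemma A.11 p. 2463] -/
theorem platt2017_lemmaA11_of_plattTrudgian2015
    (h22 : ∀ u : ℝ, 2 < u → ‖riemannZeta (1 / 2 + u * I)‖ ≤ 0.732 * u ^ (1 / 6 : ℝ) * Real.log u)
    {t₀ h B x β : ℝ} (ht₀ : Real.exp (Real.exp 1) < t₀) (hh : 0 < h) (hB0 : 0 < B)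
    (hβ : β = 1 / 6 + Real.log (Real.log t₀) / Real.log t₀) (hBlo : β * h ^ 2 / t₀ ≤ B / 2)
    (hBhi : B / 2 ≤ t₀) (hx : |x| ≤ B / 2) :
    Summable (fun l : ℤ =>
        (π : ℂ) ^ (-(I * ((x + l * B) + t₀ : ℝ) / 2)) *
          Complex.Gamma ((1 / 2 + ((x + l * B) + t₀ : ℝ) * I) / 2) *
          riemannZeta (1 / 2 + ((x + l * B) + t₀ : ℝ) * I) *
          Complex.exp ((π * ((x + l * B) + t₀) / 4 - (x + l * B) ^ 2 / (2 * h ^ 2) : ℝ) : ℂ)) ∧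
      ‖∑' l : ℤ, (π : ℂ) ^ (-(I * ((x + l * B) + t₀ : ℝ) / 2)) *
            Complex.Gamma ((1 / 2 + ((x + l * B) + t₀ : ℝ) * I) / 2) *
            riemannZeta (1 / 2 + ((x + l * B) + t₀ : ℝ) * I) *
            Complex.exp ((π * ((x + l * B) + t₀) / 4 - (x + l * B) ^ 2 / (2 * h ^ 2) : ℝ) : ℂ) -
          (π : ℂ) ^ (-(I * (x + t₀ : ℝ) / 2)) * Complex.Gamma ((1 / 2 + (x + t₀ : ℝ) * I) / 2) *
            riemannZeta (1 / 2 + (x + t₀ : ℝ) * I) *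
            Complex.exp ((π * (x + t₀) / 4 - x ^ 2 / (2 * h ^ 2) : ℝ) : ℂ)‖ ≤
        6 * ((B / 2 + t₀) ^ β * Real.exp (-(B ^ 2 / (8 * h ^ 2))) +
          (2 : ℝ) ^ β * h / B *
            ((2 : ℝ) ^ (-(1 / 2 : ℝ)) * t₀ ^ β * upperIncGamma (1 / 2) (B ^ 2 / (8 * h ^ 2)) +
              (2 : ℝ) ^ (β - 1 / 2) * h ^ β * upperIncGamma ((β + 1) / 2) (t₀ ^ 2 / (2 * h ^ 2)))) :=
  platt2017_lemmaA11 (A := 0.732) (by norm_num) (fun u hu => h22 u (by linarith)) ht₀ hh hB0 hβ hBlo hBhi hx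

/-- **Platt 2017, Lemma A.11 (p. 2463), from the tree's named fact `zeta_half_line_hiary_patel_yang`**
(Hiary–Patel–Yang 2024 Thm 1.1, `0.618 t^{1/6} log t` for `t ≥ 3`), both tails.
[cite: Platt2017, Lemma A.11 p. 2463] [cite: HiaryPatelYang2024, Thm. 1.1] -/
theorem platt2017_lemmaA11_of_hpy (hHPY : zeta_half_line_hiary_patel_yang)
    {t₀ h B x β : ℝ} (ht₀ : Real.exp (Real.exp 1) < t₀) (hh : 0 < h) (hB0 : 0 < B)
    (hβ : β = 1 / 6 + Real.log (Real.log t₀) / Real.log t₀) (hBlo : β * h ^ 2 / t₀ ≤ B / 2)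
    (hBhi : B / 2 ≤ t₀) (hx : |x| ≤ B / 2) :
    Summable (fun l : ℤ =>
        (π : ℂ) ^ (-(I * ((x + l * B) + t₀ : ℝ) / 2)) *
          Complex.Gamma ((1 / 2 + ((x + l * B) + t₀ : ℝ) * I) / 2) *
          riemannZeta (1 / 2 + ((x + l * B) + t₀ : ℝ) * I) *
          Complex.exp ((π * ((x + l * B) + t₀) / 4 - (x + l * B) ^ 2 / (2 * h ^ 2) : ℝ) : ℂ)) ∧
      ‖∑' l : ℤ, (π : ℂ) ^ (-(I * ((x + l * B) + t₀ : ℝ) / 2)) *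
            Complex.Gamma ((1 / 2 + ((x + l * B) + t₀ : ℝ) * I) / 2) *
            riemannZeta (1 / 2 + ((x + l * B) + t₀ : ℝ) * I) *
            Complex.exp ((π * ((x + l * B) + t₀) / 4 - (x + l * B) ^ 2 / (2 * h ^ 2) : ℝ) : ℂ) -
          (π : ℂ) ^ (-(I * (x + t₀ : ℝ) / 2)) * Complex.Gamma ((1 / 2 + (x + t₀ : ℝ) * I) / 2) *
            riemannZeta (1 / 2 + (x + t₀ : ℝ) * I) *
            Complex.exp ((π * (x + t₀) / 4 - x ^ 2 / (2 * h ^ 2) : ℝ) : ℂ)‖ ≤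
        6 * ((B / 2 + t₀) ^ β * Real.exp (-(B ^ 2 / (8 * h ^ 2))) +
          (2 : ℝ) ^ β * h / B *
            ((2 : ℝ) ^ (-(1 / 2 : ℝ)) * t₀ ^ β * upperIncGamma (1 / 2) (B ^ 2 / (8 * h ^ 2)) +
              (2 : ℝ) ^ (β - 1 / 2) * h ^ β * upperIncGamma ((β + 1) / 2) (t₀ ^ 2 / (2 * h ^ 2)))) :=
  platt2017_lemmaA11 (A := 0.618) (by norm_num) (fun u hu => hHPY u hu) ht₀ hh hB0 hβ hBlo hBhi hx


/-! ### Appendix C, Lemma C.3: the truncation error of the up-sampling (both tails) -/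

namespace Platt2017

/-- The profile `3(s+t₀)^β e^{−s²/(2H²)}` is integrable on `(a, ∞)`, `a > 0` (dominated by
`3((2t₀)^β + 2^β s^β) e^{−s²/(2H²)}`). [cite: Platt2017, Lemma C.3 p. 2465 (proof: the majorizing integral)] -/
theorem profile_integrableOn {β t₀ H a : ℝ} (hβ1 : -1 < β) (hβ0 : 0 ≤ β) (ht₀ : 0 < t₀) (hH : 0 < H)
    (ha : 0 < a) :
    IntegrableOn (fun s : ℝ => 3 * (s + t₀) ^ β * Real.exp (-(s ^ 2 / (2 * H ^ 2)))) (Ioi a) := by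
  have hb : (0 : ℝ) < 1 / (2 * H ^ 2) := by positivity
  have hint0 : Integrable fun s : ℝ => s ^ (0 : ℝ) * Real.exp (-(1 / (2 * H ^ 2)) * s ^ 2) :=
    integrable_rpow_mul_exp_neg_mul_sq hb (by norm_num)
  have hintβ : Integrable fun s : ℝ => s ^ β * Real.exp (-(1 / (2 * H ^ 2)) * s ^ 2) :=
    integrable_rpow_mul_exp_neg_mul_sq hb hβ1
  have hexp_eq : ∀ s : ℝ, Real.exp (-(1 / (2 * H ^ 2)) * s ^ 2) = Real.exp (-(s ^ 2 / (2 * H ^ 2))) :=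
    fun s => by congr 1; ring
  have hPcont : ContinuousOn (fun s : ℝ => 3 * (s + t₀) ^ β * Real.exp (-(s ^ 2 / (2 * H ^ 2)))) (Ioi a) := by
    refine ContinuousOn.mul (ContinuousOn.mul continuousOn_const ?_) (Continuous.continuousOn (by fun_prop))
    exact ContinuousOn.rpow_const (by fun_prop) fun s hs => Or.inl (by
      have : a < s := hs; linarith)
  have hdom : IntegrableOn (fun s : ℝ => 3 * ((2 * t₀) ^ β * (s ^ (0 : ℝ) * Real.exp (-(1 / (2 * H ^ 2)) * s ^ 2)) +
      (2 : ℝ) ^ β * (s ^ β * Real.exp (-(1 / (2 * H ^ 2)) * s ^ 2)))) (Ioi a) :=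
    (((hint0.const_mul _).add (hintβ.const_mul _)).const_mul 3).integrableOn
  refine Integrable.mono' hdom (hPcont.aestronglyMeasurable measurableSet_Ioi) ?_
  refine ae_restrict_of_forall_mem measurableSet_Ioi fun s hs => ?_
  have hs0 : 0 < s := ha.trans hs
  have hst : 0 ≤ s + t₀ := by linarith
  have hval : 0 ≤ 3 * (s + t₀) ^ β * Real.exp (-(s ^ 2 / (2 * H ^ 2))) := by positivity
  rw [Real.norm_of_nonneg hval]
  simp only [Real.rpow_zero, one_mul, hexp_eq]
  have hsum : (s + t₀) ^ β ≤ (2 * t₀) ^ β + (2 : ℝ) ^ β * s ^ β := by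
    rw [← Real.mul_rpow (by norm_num) hs0.le]
    rcases le_or_gt s t₀ with h1 | h1
    · have : (s + t₀) ^ β ≤ (2 * t₀) ^ β := Real.rpow_le_rpow hst (by linarith) hβ0
      linarith [Real.rpow_nonneg (by linarith : (0 : ℝ) ≤ 2 * s) β]
    · have : (s + t₀) ^ β ≤ (2 * s) ^ β := Real.rpow_le_rpow hst (by linarith) hβ0
      linarith [Real.rpow_nonneg (by linarith : (0 : ℝ) ≤ 2 * t₀) β]
  have hE := Real.exp_pos (-(s ^ 2 / (2 * H ^ 2)))
  nlinarith [mul_le_mul_of_nonneg_right hsum hE.le]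

/-- **The majorizing integral of Lemmas A.11 / C.3**: for `0 < a ≤ t₀`, `β ≥ 0`, `H > 0`,
`∫_a^∞ 3(s+t₀)^β e^{−s²/(2H²)} ds ≤ 3[(2t₀)^β 2^{−1/2} H Γ(1/2, a²/(2H²)) + 2^β 2^{(β−1)/2} H^{β+1} Γ((β+1)/2, t₀²/(2H²))]`
(«`< ∫_a^{t₀}(2t₀)^β e^{−t²/(2H²)}dt + ∫_{t₀}^∞ (2t)^β e^{−t²/(2H²)}dt`, the result follows from Lemma A.1»).
[cite: Platt2017, Lemma C.3 p. 2465 (proof) and Lemma A.11 p. 2463 (proof)] -/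
theorem integral_profile_le {β t₀ H a : ℝ} (hβ1 : -1 < β) (hβ0 : 0 ≤ β) (ht₀ : 0 < t₀) (hH : 0 < H)
    (ha : 0 < a) (hat : a ≤ t₀) :
    ∫ s in Ioi a, 3 * (s + t₀) ^ β * Real.exp (-(s ^ 2 / (2 * H ^ 2))) ≤
      3 * ((2 * t₀) ^ β * ((2 : ℝ) ^ (-(1 / 2 : ℝ)) * H * upperIncGamma (1 / 2) (a ^ 2 / (2 * H ^ 2))) +
        (2 : ℝ) ^ β * ((2 : ℝ) ^ ((β - 1) / 2) * H ^ (β + 1) *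
          upperIncGamma ((β + 1) / 2) (t₀ ^ 2 / (2 * H ^ 2)))) := by
  set P : ℝ → ℝ := fun s => 3 * (s + t₀) ^ β * Real.exp (-(s ^ 2 / (2 * H ^ 2))) with hP
  have hPint : IntegrableOn P (Ioi a) := profile_integrableOn hβ1 hβ0 ht₀ hH ha
  have hb : (0 : ℝ) < 1 / (2 * H ^ 2) := by positivity
  have hint0 : Integrable fun s : ℝ => s ^ (0 : ℝ) * Real.exp (-(1 / (2 * H ^ 2)) * s ^ 2) :=
    integrable_rpow_mul_exp_neg_mul_sq hb (by norm_num)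
  have hintβ : Integrable fun s : ℝ => s ^ β * Real.exp (-(1 / (2 * H ^ 2)) * s ^ 2) :=
    integrable_rpow_mul_exp_neg_mul_sq hb hβ1
  have hexp_eq : ∀ s : ℝ, Real.exp (-(1 / (2 * H ^ 2)) * s ^ 2) = Real.exp (-(s ^ 2 / (2 * H ^ 2))) :=
    fun s => by congr 1; ring
  set Γ₁ : ℝ := upperIncGamma (1 / 2) (a ^ 2 / (2 * H ^ 2)) with hΓ₁
  set Γ₂ : ℝ := upperIncGamma ((β + 1) / 2) (t₀ ^ 2 / (2 * H ^ 2)) with hΓ₂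
  have hA1a : ∫ s in Ioi a, Real.exp (-(s ^ 2 / (2 * H ^ 2))) = (2 : ℝ) ^ (-(1 / 2 : ℝ)) * H * Γ₁ := by
    have h1 := platt2017_lemmaA1 (κ := 0) (x := a) (h := H) (by norm_num) ha hH
    simp only [Real.rpow_zero, one_mul] at h1
    rw [h1, hΓ₁]
    norm_num
  have hA1b : ∫ s in Ioi t₀, s ^ β * Real.exp (-(s ^ 2 / (2 * H ^ 2))) =
      (2 : ℝ) ^ ((β - 1) / 2) * H ^ (β + 1) * Γ₂ :=
    platt2017_lemmaA1 (κ := β) (x := t₀) (h := H) hβ1 ht₀ hH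
  have hunion : Ioc a t₀ ∪ Ioi t₀ = Ioi a := Ioc_union_Ioi_eq_Ioi hat
  have hsplit : ∫ s in Ioi a, P s = (∫ s in Ioc a t₀, P s) + ∫ s in Ioi t₀, P s := by
    rw [← hunion]
    exact setIntegral_union (Set.Ioc_disjoint_Ioi le_rfl) measurableSet_Ioi
      (hPint.mono_set (by rw [← hunion]; exact subset_union_left))
      (hPint.mono_set (by rw [← hunion]; exact subset_union_right))
  have hmid : ∫ s in Ioc a t₀, P s ≤ 3 * (2 * t₀) ^ β * ((2 : ℝ) ^ (-(1 / 2 : ℝ)) * H * Γ₁) := by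
    have hgi : IntegrableOn (fun s : ℝ => Real.exp (-(s ^ 2 / (2 * H ^ 2)))) (Ioi a) := by
      refine (hint0.integrableOn (s := Ioi a)).congr_fun (fun s _ => ?_) measurableSet_Ioi
      simp only [Real.rpow_zero, one_mul, hexp_eq]
    have h1 : ∫ s in Ioc a t₀, P s ≤ ∫ s in Ioc a t₀, 3 * (2 * t₀) ^ β * Real.exp (-(s ^ 2 / (2 * H ^ 2))) := by
      refine setIntegral_mono_on (hPint.mono_set Ioc_subset_Ioi_self)
        ((hgi.mono_set Ioc_subset_Ioi_self).const_mul _) measurableSet_Ioc fun s hs => ?_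
      simp only [hP]
      have hs0 : 0 < s := ha.trans hs.1
      have : (s + t₀) ^ β ≤ (2 * t₀) ^ β := Real.rpow_le_rpow (by linarith) (by linarith [hs.2]) hβ0
      have hE := Real.exp_pos (-(s ^ 2 / (2 * H ^ 2)))
      nlinarith
    have h2 : ∫ s in Ioc a t₀, Real.exp (-(s ^ 2 / (2 * H ^ 2))) ≤
        ∫ s in Ioi a, Real.exp (-(s ^ 2 / (2 * H ^ 2))) :=
      setIntegral_mono_set hgi
        (ae_restrict_of_forall_mem measurableSet_Ioi fun s _ => (Real.exp_pos _).le)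
        Ioc_subset_Ioi_self.eventuallyLE
    rw [hA1a] at h2
    refine h1.trans ?_
    rw [integral_const_mul]
    exact mul_le_mul_of_nonneg_left h2 (by positivity)
  have hfar : ∫ s in Ioi t₀, P s ≤ 3 * (2 : ℝ) ^ β * ((2 : ℝ) ^ ((β - 1) / 2) * H ^ (β + 1) * Γ₂) := by
    have hgi : IntegrableOn (fun s : ℝ => s ^ β * Real.exp (-(s ^ 2 / (2 * H ^ 2)))) (Ioi t₀) := by
      refine (hintβ.integrableOn (s := Ioi t₀)).congr_fun (fun s _ => ?_) measurableSet_Ioi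
      simp only [hexp_eq]
    have h1 : ∫ s in Ioi t₀, P s ≤ ∫ s in Ioi t₀, 3 * (2 : ℝ) ^ β * (s ^ β * Real.exp (-(s ^ 2 / (2 * H ^ 2)))) := by
      refine setIntegral_mono_on (hPint.mono_set (Ioi_subset_Ioi hat)) (hgi.const_mul _)
        measurableSet_Ioi fun s hs => ?_
      simp only [hP]
      have hs0 : 0 < s := ht₀.trans hs
      have h2s : (s + t₀) ^ β ≤ (2 : ℝ) ^ β * s ^ β := by
        rw [← Real.mul_rpow (by norm_num) hs0.le]
        exact Real.rpow_le_rpow (by linarith) (by linarith [(show t₀ < s from hs).le]) hβ0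
      have hE := Real.exp_pos (-(s ^ 2 / (2 * H ^ 2)))
      nlinarith [Real.rpow_nonneg hs0.le β]
    rw [integral_const_mul, hA1b] at h1
    exact h1
  rw [hsplit]
  linarith

/-- Finite partial sums dominated through an injection into a summable non-negative `ℕ`-sequence.
[folklore] -/
private theorem sum_le_tsum_of_inj {Φ : ℕ → ℝ} (hΦs : Summable Φ) (hΦ0 : ∀ k, 0 ≤ Φ k) (f : ℤ → ℝ)
    (T : Finset ℤ) (φ : ℤ → ℕ) (hinj : Set.InjOn φ ↑T) (hdom : ∀ n ∈ T, f n ≤ Φ (φ n)) :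
    ∑ n ∈ T, f n ≤ ∑' k, Φ k := by
  calc ∑ n ∈ T, f n ≤ ∑ n ∈ T, Φ (φ n) := Finset.sum_le_sum hdom
    _ = ∑ j ∈ T.image φ, Φ j := by rw [Finset.sum_image hinj]
    _ ≤ ∑' k, Φ k := hΦs.sum_le_tsum _ (fun j _ => hΦ0 j)

/-- From bounded partial sums to the subtype `tsum` (non-negative terms). [folklore] -/
private theorem summable_and_tsum_subtype_le {Q : ℤ → Prop} {f : ℤ → ℝ} (hf0 : ∀ n, Q n → 0 ≤ f n)
    {K : ℝ} (hK : ∀ T : Finset ℤ, (∀ n ∈ T, Q n) → ∑ n ∈ T, f n ≤ K) :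
    Summable (fun n : {n : ℤ // Q n} => f n) ∧ ∑' n : {n : ℤ // Q n}, f n ≤ K := by
  have hpart : ∀ s : Finset {n : ℤ // Q n}, ∑ i ∈ s, f i ≤ K := fun s => by
    have h := hK (s.map (Function.Embedding.subtype _)) (fun n hn => by
      rw [Finset.mem_map] at hn
      obtain ⟨i, _, rfl⟩ := hn
      exact i.2)
    rwa [Finset.sum_map] at h
  have hS : Summable (fun n : {n : ℤ // Q n} => f n) :=
    summable_of_sum_le (fun i => hf0 i i.2) hpart
  exact ⟨hS, Real.tsum_le_of_sum_le (fun i => hf0 i i.2) hpart⟩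

/-- `|sinc x| ≤ 1/|x|` (`x ≠ 0`). [folklore] -/
private theorem abs_sinc_le_one_div_abs {x : ℝ} (hx : x ≠ 0) : |Real.sinc x| ≤ 1 / |x| := by
  rw [Real.sinc_of_ne_zero hx, abs_div]
  exact div_le_div_of_nonneg_right (Real.abs_sin_le_one x) (abs_nonneg x)

end Platt2017

open Platt2017 in
/-- **Platt 2017, Lemma C.3 (p. 2465)** — the truncation error of the Whittaker–Shannon up-sampling of
`W(t) = Λ(t) exp(πt/4 − (t−t₀)²/(2H²))` (p. 2464; `Λ(t) = π^{−it/2} Γ((1/2+it)/2) ζ(1/2+it)`),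
BOTH TAILS PROVED, in the form the printed proof yields. Printed: «Let `t₀ > exp(e)` and
`β = 1/6 + log log t₀ / log t₀`. Then given `N_s ∈ ℤ_{>0}` with `N_s ≤ t₀A` we have
`|Σ_{|n − t₀A| > N_s} W(n/A) sinc(A(n/A − t₀))| ≤ (6A/(πN_s))(X + Y + Z)`, where
`X = (t₀ + N_s/A)^β exp(−N_s²/(2A²h²))`, `Y = 2^{2β−1/2} t₀^β A·H·Γ(1/2, N_s²/(2A²H²))`, and
`Z = 2^{3β−1/2} A·H^{β+1} Γ((β+1)/2, t₀²/(2H²))`. *Proof.* The right tail majorizes the left and the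
first term missing is less in absolute terms than `|W(t₀ + N_s/A) sinc(N_s/A)|` which is less then
`(3A/(πN_s))(t₀ + N_s/A)^β exp(−N_s²/(2A²H²))`. Now, since our bound for `W` is decreasing, we can
majorize the rest of the tail with the integral `(3A/(πN_s))∫_{N_s}^∞ (t₀+n/A)^β exp(−n²/(2A²H²))dn <
(3A/(πN_s))[∫_{N_s}^{t₀A} 2^β t₀^β … + ∫_{t₀A}^∞ 2^β (n/A)^β …] = …» Typed with: the sum over the integers
`n` with `|n − At₀| > N_s` (a subtype of `ℤ`), `sinc = Real.sinc(π·)` (Mathlib: `sin x/x`), `W` written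
out, the `ζ`-input explicit (`|ζ(1/2+iu)| ≤ A_ζ u^{1/6} log u` for `u ≥ 3`, `A_ζ ≤ 3/4`; printed/HPY forms
below), and **the sharper constant `6/(πN_s)`** that the argument gives (`|sinc(A(n/A − t₀))| ≤
1/(π|n − At₀|) < 1/(πN_s)`; the printed `6A/(πN_s)` carries a spurious factor `A` and follows for
`A ≥ 1` — `platt2017_lemmaC3_printed`). RECORDED, not silent: (i) the `h` in the printed `X` is `H`
(the Gaussian of `W`; the proof's display has `H`); (ii) the printed exponents `2^{2β−1/2}`, `2^{3β−1/2}`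
in `Y`, `Z` exceed the proof's `2^{β−1/2}`, `2^{(3β−1)/2}` — the printed (weaker) `Y`, `Z` are kept;
(iii) «our bound for `W` is decreasing» (the profile `3(t₀+s)^β e^{−s²/(2H²)}` in the distance `s` from
`t₀`) needs `βH² ≤ t₀ N_s/A`, an explicit proviso here (no such hypothesis is printed; Platt's
`H = 2089/16384`, `t₀ ≤ 3·10¹⁰`, §5, satisfy it with room); (iv) the left tail («the right tail
majorizes the left», not proved in print) is `Platt2017.norm_Lambda_reflected_le`.
[cite: Platt2017, Lemma C.3 p. 2465] -/
theorem platt2017_lemmaC3 {Aζ t₀ H A β : ℝ} {Ns : ℕ} (hAζ : Aζ ≤ 3 / 4)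
    (hζ : ∀ u : ℝ, 3 ≤ u → ‖riemannZeta (1 / 2 + u * I)‖ ≤ Aζ * u ^ (1 / 6 : ℝ) * Real.log u)
    (ht₀ : Real.exp (Real.exp 1) < t₀) (hH : 0 < H) (hA : 0 < A)
    (hβ : β = 1 / 6 + Real.log (Real.log t₀) / Real.log t₀) (hNs : 0 < Ns)
    (hNsle : (Ns : ℝ) ≤ t₀ * A) (hmono : β * H ^ 2 / t₀ ≤ Ns / A) :
    Summable (fun n : {n : ℤ // (Ns : ℝ) < |(n : ℝ) - A * t₀|} =>
        (π : ℂ) ^ (-(I * ((n : ℝ) / A : ℝ) / 2)) * Complex.Gamma ((1 / 2 + ((n : ℝ) / A : ℝ) * I) / 2) *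
          riemannZeta (1 / 2 + ((n : ℝ) / A : ℝ) * I) *
          Complex.exp ((π * ((n : ℝ) / A) / 4 - ((n : ℝ) / A - t₀) ^ 2 / (2 * H ^ 2) : ℝ) : ℂ) *
          (Real.sinc (π * A * ((n : ℝ) / A - t₀)) : ℂ)) ∧
      ‖∑' n : {n : ℤ // (Ns : ℝ) < |(n : ℝ) - A * t₀|},
          (π : ℂ) ^ (-(I * ((n : ℝ) / A : ℝ) / 2)) * Complex.Gamma ((1 / 2 + ((n : ℝ) / A : ℝ) * I) / 2) *
            riemannZeta (1 / 2 + ((n : ℝ) / A : ℝ) * I) *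
            Complex.exp ((π * ((n : ℝ) / A) / 4 - ((n : ℝ) / A - t₀) ^ 2 / (2 * H ^ 2) : ℝ) : ℂ) *
            (Real.sinc (π * A * ((n : ℝ) / A - t₀)) : ℂ)‖ ≤
        6 / (π * Ns) *
          ((t₀ + Ns / A) ^ β * Real.exp (-((Ns : ℝ) ^ 2 / (2 * A ^ 2 * H ^ 2))) +
            (2 : ℝ) ^ (2 * β - 1 / 2) * t₀ ^ β * A * H * upperIncGamma (1 / 2) ((Ns : ℝ) ^ 2 / (2 * A ^ 2 * H ^ 2)) +
            (2 : ℝ) ^ (3 * β - 1 / 2) * A * H ^ (β + 1) * upperIncGamma ((β + 1) / 2) (t₀ ^ 2 / (2 * H ^ 2))) := by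
  have hπ : 0 < π := Real.pi_pos
  have ht₀15 : 15 ≤ t₀ := fifteen_le_exp_exp_one.trans ht₀.le
  have ht₀pos : 0 < t₀ := by linarith
  have hNs' : (0 : ℝ) < Ns := by exact_mod_cast hNs
  have hlt₀ : Real.exp 1 ≤ Real.log t₀ := by
    have := Real.log_le_log (Real.exp_pos _) ht₀.le
    rwa [Real.log_exp] at this
  have he1 : (2.7182818283 : ℝ) < Real.exp 1 := Real.exp_one_gt_d9
  have hc0 : 0 < Real.log (Real.log t₀) / Real.log t₀ :=
    div_pos (Real.log_pos (by linarith)) (by linarith)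
  have hβ0 : 0 ≤ β := by rw [hβ]; positivity
  have hβ1 : -1 < β := by linarith
  -- the distance scale `a = Ns/A`, the profile and its lattice majorant
  set a : ℝ := Ns / A with ha_def
  have ha : 0 < a := by positivity
  have hat : a ≤ t₀ := by rw [ha_def, div_le_iff₀ hA]; linarith
  set P : ℝ → ℝ := fun s => 3 * (s + t₀) ^ β * Real.exp (-(s ^ 2 / (2 * H ^ 2))) with hP
  have hP0 : ∀ s, a ≤ s → 0 ≤ P s := fun s hs => by
    simp only [hP]; have : 0 ≤ s + t₀ := by linarith
    positivity
  have hPanti : AntitoneOn P (Ici a) := by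
    have hmono' : β * H ^ 2 / t₀ ≤ (2 * a) / 2 := by rw [ha_def]; linarith
    intro s hs s' _ hss'
    simp only [hP, mul_assoc]
    exact mul_le_mul_of_nonneg_left
      (profile_antitone (B := 2 * a) hβ0 ht₀pos hH hmono' (by linarith [mem_Ici.mp hs]) (ha.trans_le hs) hss')
      (by norm_num)
  have hPint : IntegrableOn P (Ioi a) := profile_integrableOn hβ1 hβ0 ht₀pos hH ha
  obtain ⟨hΦs, hΦle⟩ := tsum_lattice_le (Φ := P) (a := a) (B := 1 / A) (by positivity) hP0 hPanti hPint
  -- `Φ m = P(a + m/A) / (π Ns)`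
  set Φ : ℕ → ℝ := fun m => P (a + m * (1 / A)) / (π * Ns) with hΦdef
  have hΦ0 : ∀ m, 0 ≤ Φ m := fun m => by
    simp only [hΦdef]
    have hm : (0 : ℝ) ≤ m * (1 / A) := by positivity
    exact div_nonneg (hP0 _ (by linarith)) (by positivity)
  have hΦs' : Summable Φ := by simp only [hΦdef]; exact hΦs.div_const _
  set K : ℝ := (P a + (1 / A)⁻¹ * ∫ s in Ioi a, P s) / (π * Ns) with hK
  have hΦtsum : ∑' m, Φ m ≤ K := by
    simp only [hΦdef, hK]
    rw [tsum_div_const]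
    exact div_le_div_of_nonneg_right hΦle (by positivity)
  -- the sample function and the terms
  set Wf : ℝ → ℂ := fun t => (π : ℂ) ^ (-(I * t / 2)) * Complex.Gamma ((1 / 2 + t * I) / 2) *
      riemannZeta (1 / 2 + t * I) * Complex.exp ((π * t / 4 - (t - t₀) ^ 2 / (2 * H ^ 2) : ℝ) : ℂ) with hWf
  set F : ℤ → ℂ := fun n => Wf ((n : ℝ) / A) * (Real.sinc (π * A * ((n : ℝ) / A - t₀)) : ℂ) with hF
  -- `‖Wf(t₀ + s)‖ ≤ P s` and `‖Wf(t₀ − s)‖ ≤ P s` for `s ≥ 0`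
  have hζt₀ : ∀ u : ℝ, t₀ ≤ u → ‖riemannZeta (1 / 2 + u * I)‖ ≤ Aζ * u ^ (1 / 6 : ℝ) * Real.log u :=
    fun u hu => hζ u (by linarith)
  have hWright : ∀ s : ℝ, 0 ≤ s → ‖Wf (s + t₀)‖ ≤ P s := by
    intro s hs
    have h10 := platt2017_lemmaA10 (h := H) hAζ ht₀ hs hζt₀
    simp only [hWf, hP, hβ]
    have e : ((π * (s + t₀) / 4 - (s + t₀ - t₀) ^ 2 / (2 * H ^ 2) : ℝ) : ℂ) =
        ((π * (s + t₀) / 4 - s ^ 2 / (2 * H ^ 2) : ℝ) : ℂ) := by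
      congr 1; ring
    rw [e]
    exact h10
  have hWleft : ∀ s : ℝ, 0 ≤ s → ‖Wf (t₀ - s)‖ ≤ P s := by
    intro s hs
    have hL := norm_Lambda_reflected_le hAζ ht₀ hs hζ
    simp only [hWf, hP, hβ]
    rw [norm_mul, norm_mul, norm_mul, norm_pi_cpow_neg_I_mul, one_mul, Complex.norm_exp,
      Complex.ofReal_re, sub_eq_add_neg (π * (t₀ - s) / 4), Real.exp_add]
    have e : (t₀ - s - t₀) ^ 2 = s ^ 2 := by ring
    rw [e]
    have hE := Real.exp_pos (-(s ^ 2 / (2 * H ^ 2)))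
    calc ‖Complex.Gamma ((1 / 2 + ((t₀ - s : ℝ) : ℂ) * I) / 2)‖ *
          ‖riemannZeta (1 / 2 + ((t₀ - s : ℝ) : ℂ) * I)‖ *
          (Real.exp (π * (t₀ - s) / 4) * Real.exp (-(s ^ 2 / (2 * H ^ 2))))
        = (‖Complex.Gamma ((1 / 2 + ((t₀ - s : ℝ) : ℂ) * I) / 2)‖ * Real.exp (π * (t₀ - s) / 4) *
            ‖riemannZeta (1 / 2 + ((t₀ - s : ℝ) : ℂ) * I)‖) * Real.exp (-(s ^ 2 / (2 * H ^ 2))) := by ring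
      _ ≤ 3 * (s + t₀) ^ (1 / 6 + Real.log (Real.log t₀) / Real.log t₀) *
            Real.exp (-(s ^ 2 / (2 * H ^ 2))) := mul_le_mul_of_nonneg_right hL hE.le
  -- termwise: `‖F n‖ ≤ P(|n − At₀|/A) / (π Ns)` for `|n − At₀| > Ns`
  have hterm : ∀ n : ℤ, (Ns : ℝ) < |(n : ℝ) - A * t₀| → ‖F n‖ ≤ P (|(n : ℝ) - A * t₀| / A) / (π * Ns) := by
    intro n hn
    have hd0 : 0 < |(n : ℝ) - A * t₀| := hNs'.trans hn
    have hsinc : ‖(Real.sinc (π * A * ((n : ℝ) / A - t₀)) : ℂ)‖ ≤ 1 / (π * Ns) := by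
      rw [Complex.norm_real, Real.norm_eq_abs]
      have heq : π * A * ((n : ℝ) / A - t₀) = π * ((n : ℝ) - A * t₀) := by field_simp
      rw [heq]
      refine (abs_sinc_le_one_div_abs (mul_ne_zero hπ.ne' (abs_pos.mp hd0))).trans ?_
      rw [abs_mul, abs_of_pos hπ]
      exact div_le_div_of_nonneg_left (by norm_num) (by positivity) (by nlinarith [hn.le])
    have hW : ‖Wf ((n : ℝ) / A)‖ ≤ P (|(n : ℝ) - A * t₀| / A) := by
      rcases le_or_gt (A * t₀) (n : ℝ) with hge | hlt
      · -- right of `t₀`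
        have hs : 0 ≤ ((n : ℝ) - A * t₀) / A := by apply div_nonneg <;> linarith
        have e : (n : ℝ) / A = ((n : ℝ) - A * t₀) / A + t₀ := by field_simp; ring
        rw [abs_of_nonneg (by linarith), e]
        exact hWright _ hs
      · -- left of `t₀`
        have hs : 0 ≤ (A * t₀ - (n : ℝ)) / A := by apply div_nonneg <;> linarith
        have e : (n : ℝ) / A = t₀ - (A * t₀ - (n : ℝ)) / A := by field_simp; ring
        rw [abs_of_neg (by linarith), neg_sub, e]
        exact hWleft _ hs
    simp only [hF]
    rw [norm_mul]
    calc ‖Wf ((n : ℝ) / A)‖ * ‖(Real.sinc (π * A * ((n : ℝ) / A - t₀)) : ℂ)‖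
        ≤ P (|(n : ℝ) - A * t₀| / A) * (1 / (π * Ns)) :=
          mul_le_mul hW hsinc (norm_nonneg _) (hP0 _ (by
            rw [ha_def]; exact div_le_div_of_nonneg_right hn.le hA.le))
      _ = P (|(n : ℝ) - A * t₀| / A) / (π * Ns) := by ring
  -- partial sums over the right tail
  have hright : ∀ T : Finset ℤ, (∀ n ∈ T, (Ns : ℝ) < |(n : ℝ) - A * t₀| ∧ A * t₀ ≤ (n : ℝ)) →
      ∑ n ∈ T, ‖F n‖ ≤ K := by
    intro T hT
    set n₀ : ℤ := ⌊A * t₀ + Ns⌋ + 1 with hn₀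
    have hn₀gt : A * t₀ + Ns < (n₀ : ℝ) := by
      rw [hn₀]; push_cast; exact Int.lt_floor_add_one _
    have hn₀le : ∀ n ∈ T, n₀ ≤ n := fun n hn => by
      have h1 := (hT n hn).1
      rw [abs_of_nonneg (by linarith [(hT n hn).2])] at h1
      have h2 : ⌊A * t₀ + Ns⌋ < n := Int.floor_lt.mpr (by linarith)
      rw [hn₀]; omega
    let φ : ℤ → ℕ := fun n => (n - n₀).toNat
    have hφcast : ∀ n ∈ T, ((φ n : ℕ) : ℝ) = (n : ℝ) - n₀ := fun n hn => by
      have h0 : 0 ≤ n - n₀ := sub_nonneg.mpr (hn₀le n hn)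
      have : ((n - n₀).toNat : ℤ) = n - n₀ := Int.toNat_of_nonneg h0
      simp only [φ]
      exact_mod_cast this
    have hinj : Set.InjOn φ ↑T := by
      intro n hn m hm hnm
      have h1 : ((n - n₀).toNat : ℤ) = n - n₀ := Int.toNat_of_nonneg (sub_nonneg.mpr (hn₀le n hn))
      have h2 : ((m - n₀).toNat : ℤ) = m - n₀ := Int.toNat_of_nonneg (sub_nonneg.mpr (hn₀le m hm))
      have : (φ n : ℤ) = (φ m : ℤ) := by simp only [hnm]
      simp only [φ] at this
      rw [h1, h2] at this
      linarith
    refine (sum_le_tsum_of_inj hΦs' hΦ0 (fun n => ‖F n‖) T φ hinj (fun n hn => ?_)).trans hΦtsum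
    refine (hterm n (hT n hn).1).trans ?_
    simp only [hΦdef]
    apply div_le_div_of_nonneg_right _ (by positivity)
    have hφ0 : (0 : ℝ) ≤ (φ n : ℝ) * (1 / A) := by positivity
    have hle : a + (φ n : ℝ) * (1 / A) ≤ |(n : ℝ) - A * t₀| / A := by
      rw [abs_of_nonneg (by linarith [(hT n hn).2]), hφcast n hn, ha_def]
      have e : (Ns : ℝ) / A + ((n : ℝ) - n₀) * (1 / A) = ((Ns : ℝ) + ((n : ℝ) - n₀)) / A := by ring
      rw [e]
      exact div_le_div_of_nonneg_right (by linarith) hA.le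
    exact hPanti (mem_Ici.mpr (by linarith)) (mem_Ici.mpr (by linarith)) hle
  -- partial sums over the left tail
  have hleft : ∀ T : Finset ℤ, (∀ n ∈ T, (Ns : ℝ) < |(n : ℝ) - A * t₀| ∧ (n : ℝ) < A * t₀) →
      ∑ n ∈ T, ‖F n‖ ≤ K := by
    intro T hT
    set n₁ : ℤ := ⌈A * t₀ - Ns⌉ - 1 with hn₁
    have hn₁lt : (n₁ : ℝ) < A * t₀ - Ns := by
      rw [hn₁]; push_cast; linarith [Int.ceil_lt_add_one (A * t₀ - Ns)]
    have hn₁ge : ∀ n ∈ T, n ≤ n₁ := fun n hn => by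
      have h1 := (hT n hn).1
      rw [abs_of_neg (by linarith [(hT n hn).2]), neg_sub] at h1
      have h2 : n < ⌈A * t₀ - Ns⌉ := Int.lt_ceil.mpr (by linarith)
      rw [hn₁]; omega
    let φ : ℤ → ℕ := fun n => (n₁ - n).toNat
    have hφcast : ∀ n ∈ T, ((φ n : ℕ) : ℝ) = (n₁ : ℝ) - n := fun n hn => by
      have h0 : 0 ≤ n₁ - n := sub_nonneg.mpr (hn₁ge n hn)
      have : ((n₁ - n).toNat : ℤ) = n₁ - n := Int.toNat_of_nonneg h0
      simp only [φ]
      exact_mod_cast this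
    have hinj : Set.InjOn φ ↑T := by
      intro n hn m hm hnm
      have h1 : ((n₁ - n).toNat : ℤ) = n₁ - n := Int.toNat_of_nonneg (sub_nonneg.mpr (hn₁ge n hn))
      have h2 : ((n₁ - m).toNat : ℤ) = n₁ - m := Int.toNat_of_nonneg (sub_nonneg.mpr (hn₁ge m hm))
      have : (φ n : ℤ) = (φ m : ℤ) := by simp only [hnm]
      simp only [φ] at this
      rw [h1, h2] at this
      linarith
    refine (sum_le_tsum_of_inj hΦs' hΦ0 (fun n => ‖F n‖) T φ hinj (fun n hn => ?_)).trans hΦtsum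
    refine (hterm n (hT n hn).1).trans ?_
    simp only [hΦdef]
    apply div_le_div_of_nonneg_right _ (by positivity)
    have hφ0 : (0 : ℝ) ≤ (φ n : ℝ) * (1 / A) := by positivity
    have hle : a + (φ n : ℝ) * (1 / A) ≤ |(n : ℝ) - A * t₀| / A := by
      rw [abs_of_neg (by linarith [(hT n hn).2]), neg_sub, hφcast n hn, ha_def]
      have e : (Ns : ℝ) / A + ((n₁ : ℝ) - n) * (1 / A) = ((Ns : ℝ) + ((n₁ : ℝ) - n)) / A := by ring
      rw [e]
      exact div_le_div_of_nonneg_right (by linarith) hA.le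
    exact hPanti (mem_Ici.mpr (by linarith)) (mem_Ici.mpr (by linarith)) hle
  -- all partial sums over the two tails
  have hpart : ∀ T : Finset ℤ, (∀ n ∈ T, (Ns : ℝ) < |(n : ℝ) - A * t₀|) → ∑ n ∈ T, ‖F n‖ ≤ 2 * K := by
    intro T hT
    rw [← Finset.sum_filter_add_sum_filter_not T (fun n : ℤ => A * t₀ ≤ (n : ℝ))]
    have hR := hright (T.filter fun n : ℤ => A * t₀ ≤ (n : ℝ)) (fun n hn => by
      rw [Finset.mem_filter] at hn; exact ⟨hT n hn.1, hn.2⟩)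
    have hL := hleft (T.filter fun n : ℤ => ¬ A * t₀ ≤ (n : ℝ)) (fun n hn => by
      rw [Finset.mem_filter] at hn; exact ⟨hT n hn.1, lt_of_not_ge hn.2⟩)
    linarith
  obtain ⟨hsum, hle⟩ := summable_and_tsum_subtype_le (Q := fun n : ℤ => (Ns : ℝ) < |(n : ℝ) - A * t₀|)
    (f := fun n => ‖F n‖) (fun n _ => norm_nonneg _) hpart
  refine ⟨Summable.of_norm hsum, ((norm_tsum_le_tsum_norm hsum).trans hle).trans ?_⟩
  -- `2K ≤ (6/(π Ns)) (X + Y + Z)`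
  set Γ₁ : ℝ := upperIncGamma (1 / 2) ((Ns : ℝ) ^ 2 / (2 * A ^ 2 * H ^ 2)) with hΓ₁
  set Γ₂ : ℝ := upperIncGamma ((β + 1) / 2) (t₀ ^ 2 / (2 * H ^ 2)) with hΓ₂
  have hΓ₁0 : 0 ≤ Γ₁ := by
    rw [hΓ₁]; unfold upperIncGamma
    exact setIntegral_nonneg measurableSet_Ioi fun s hs => by
      have : 0 < s := lt_trans (by positivity) hs
      positivity
  have hΓ₂0 : 0 ≤ Γ₂ := by
    rw [hΓ₂]; unfold upperIncGamma
    exact setIntegral_nonneg measurableSet_Ioi fun s hs => by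
      have : 0 < s := lt_trans (by positivity) hs
      positivity
  have harg : a ^ 2 / (2 * H ^ 2) = (Ns : ℝ) ^ 2 / (2 * A ^ 2 * H ^ 2) := by
    rw [ha_def]; field_simp
  have hInt := integral_profile_le hβ1 hβ0 ht₀pos hH ha hat
  rw [harg] at hInt
  have hPa : P a = 3 * ((t₀ + Ns / A) ^ β * Real.exp (-((Ns : ℝ) ^ 2 / (2 * A ^ 2 * H ^ 2)))) := by
    simp only [hP]
    rw [mul_assoc]
    congr 2
    · rw [ha_def, add_comm]
    · congr 1; rw [← harg]
  -- exponent bookkeeping: `2^β 2^{-1/2} ≤ 2^{2β-1/2}`, `2^β 2^{(β-1)/2} ≤ 2^{3β-1/2}`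
  have h2a : (2 : ℝ) ^ β * (2 : ℝ) ^ (-(1 / 2 : ℝ)) ≤ (2 : ℝ) ^ (2 * β - 1 / 2) := by
    rw [← Real.rpow_add two_pos]
    exact Real.rpow_le_rpow_of_exponent_le (by norm_num) (by linarith)
  have h2b : (2 : ℝ) ^ β * (2 : ℝ) ^ ((β - 1) / 2) ≤ (2 : ℝ) ^ (3 * β - 1 / 2) := by
    rw [← Real.rpow_add two_pos]
    exact Real.rpow_le_rpow_of_exponent_le (by norm_num) (by linarith)
  have h2t : (2 * t₀) ^ β = (2 : ℝ) ^ β * t₀ ^ β := Real.mul_rpow (by norm_num) ht₀pos.le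
  have hHβ : H ^ (β + 1) = H ^ β * H := by rw [Real.rpow_add hH, Real.rpow_one]
  rw [h2t] at hInt
  have ht₀β : 0 ≤ t₀ ^ β := Real.rpow_nonneg ht₀pos.le β
  have hHβ0 : 0 ≤ H ^ (β + 1) := Real.rpow_nonneg hH.le _
  -- `A ∫ P ≤ 3 (Y + Z)`
  have hAInt : A * ∫ s in Ioi a, P s ≤
      3 * ((2 : ℝ) ^ (2 * β - 1 / 2) * t₀ ^ β * A * H * Γ₁ + (2 : ℝ) ^ (3 * β - 1 / 2) * A * H ^ (β + 1) * Γ₂) := by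
    have step1 : A * ∫ s in Ioi a, P s ≤ A * (3 * ((2 : ℝ) ^ β * t₀ ^ β * ((2 : ℝ) ^ (-(1 / 2 : ℝ)) * H * Γ₁) +
        (2 : ℝ) ^ β * ((2 : ℝ) ^ ((β - 1) / 2) * H ^ (β + 1) * Γ₂))) :=
      mul_le_mul_of_nonneg_left hInt hA.le
    refine step1.trans ?_
    have hY : (2 : ℝ) ^ β * t₀ ^ β * ((2 : ℝ) ^ (-(1 / 2 : ℝ)) * H * Γ₁) ≤
        (2 : ℝ) ^ (2 * β - 1 / 2) * t₀ ^ β * H * Γ₁ := by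
      have := mul_le_mul_of_nonneg_right h2a (by positivity : (0 : ℝ) ≤ t₀ ^ β * H * Γ₁)
      calc (2 : ℝ) ^ β * t₀ ^ β * ((2 : ℝ) ^ (-(1 / 2 : ℝ)) * H * Γ₁)
          = (2 : ℝ) ^ β * (2 : ℝ) ^ (-(1 / 2 : ℝ)) * (t₀ ^ β * H * Γ₁) := by ring
        _ ≤ (2 : ℝ) ^ (2 * β - 1 / 2) * (t₀ ^ β * H * Γ₁) := this
        _ = (2 : ℝ) ^ (2 * β - 1 / 2) * t₀ ^ β * H * Γ₁ := by ring
    have hZ : (2 : ℝ) ^ β * ((2 : ℝ) ^ ((β - 1) / 2) * H ^ (β + 1) * Γ₂) ≤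
        (2 : ℝ) ^ (3 * β - 1 / 2) * H ^ (β + 1) * Γ₂ := by
      have := mul_le_mul_of_nonneg_right h2b (by positivity : (0 : ℝ) ≤ H ^ (β + 1) * Γ₂)
      calc (2 : ℝ) ^ β * ((2 : ℝ) ^ ((β - 1) / 2) * H ^ (β + 1) * Γ₂)
          = (2 : ℝ) ^ β * (2 : ℝ) ^ ((β - 1) / 2) * (H ^ (β + 1) * Γ₂) := by ring
        _ ≤ (2 : ℝ) ^ (3 * β - 1 / 2) * (H ^ (β + 1) * Γ₂) := this
        _ = (2 : ℝ) ^ (3 * β - 1 / 2) * H ^ (β + 1) * Γ₂ := by ring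
    have hsum2 := mul_le_mul_of_nonneg_left (add_le_add hY hZ) (by positivity : (0 : ℝ) ≤ 3 * A)
    calc A * (3 * ((2 : ℝ) ^ β * t₀ ^ β * ((2 : ℝ) ^ (-(1 / 2 : ℝ)) * H * Γ₁) +
          (2 : ℝ) ^ β * ((2 : ℝ) ^ ((β - 1) / 2) * H ^ (β + 1) * Γ₂)))
        = 3 * A * ((2 : ℝ) ^ β * t₀ ^ β * ((2 : ℝ) ^ (-(1 / 2 : ℝ)) * H * Γ₁) +
          (2 : ℝ) ^ β * ((2 : ℝ) ^ ((β - 1) / 2) * H ^ (β + 1) * Γ₂)) := by ring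
      _ ≤ 3 * A * ((2 : ℝ) ^ (2 * β - 1 / 2) * t₀ ^ β * H * Γ₁ + (2 : ℝ) ^ (3 * β - 1 / 2) * H ^ (β + 1) * Γ₂) :=
          hsum2
      _ = 3 * ((2 : ℝ) ^ (2 * β - 1 / 2) * t₀ ^ β * A * H * Γ₁ + (2 : ℝ) ^ (3 * β - 1 / 2) * A * H ^ (β + 1) * Γ₂) := by
          ring
  have hKval : 2 * K = 2 * (P a + A * ∫ s in Ioi a, P s) / (π * Ns) := by
    simp only [hK, one_div, inv_inv]; ring
  rw [hKval, hPa]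
  rw [div_le_iff₀ (by positivity : (0 : ℝ) < π * Ns)]
  have hπNs : 0 < π * Ns := by positivity
  have e6 : 6 / (π * ↑Ns) *
      ((t₀ + ↑Ns / A) ^ β * Real.exp (-((Ns : ℝ) ^ 2 / (2 * A ^ 2 * H ^ 2))) +
        (2 : ℝ) ^ (2 * β - 1 / 2) * t₀ ^ β * A * H * Γ₁ + (2 : ℝ) ^ (3 * β - 1 / 2) * A * H ^ (β + 1) * Γ₂) *
      (π * ↑Ns) =
      6 * ((t₀ + ↑Ns / A) ^ β * Real.exp (-((Ns : ℝ) ^ 2 / (2 * A ^ 2 * H ^ 2))) +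
        (2 : ℝ) ^ (2 * β - 1 / 2) * t₀ ^ β * A * H * Γ₁ + (2 : ℝ) ^ (3 * β - 1 / 2) * A * H ^ (β + 1) * Γ₂) := by
    field_simp
  rw [e6]
  have hX0 : 0 ≤ (t₀ + ↑Ns / A) ^ β * Real.exp (-((Ns : ℝ) ^ 2 / (2 * A ^ 2 * H ^ 2))) := by positivity
  linarith [hAInt]



open Platt2017 in
/-- **Platt 2017, Lemma C.3 (p. 2465) with the printed constant `6A/(πN_s)`**, for `A ≥ 1` (Platt's
`A` «is a little over 190», §5 p. 2456): from `platt2017_lemmaC3` (`6/(πN_s)`) since the bracket is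
non-negative. [cite: Platt2017, Lemma C.3 p. 2465] -/
theorem platt2017_lemmaC3_printed {Aζ t₀ H A β : ℝ} {Ns : ℕ} (hAζ : Aζ ≤ 3 / 4)
    (hζ : ∀ u : ℝ, 3 ≤ u → ‖riemannZeta (1 / 2 + u * I)‖ ≤ Aζ * u ^ (1 / 6 : ℝ) * Real.log u)
    (ht₀ : Real.exp (Real.exp 1) < t₀) (hH : 0 < H) (hA : 1 ≤ A)
    (hβ : β = 1 / 6 + Real.log (Real.log t₀) / Real.log t₀) (hNs : 0 < Ns)
    (hNsle : (Ns : ℝ) ≤ t₀ * A) (hmono : β * H ^ 2 / t₀ ≤ Ns / A) :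
    Summable (fun n : {n : ℤ // (Ns : ℝ) < |(n : ℝ) - A * t₀|} =>
        (π : ℂ) ^ (-(I * ((n : ℝ) / A : ℝ) / 2)) * Complex.Gamma ((1 / 2 + ((n : ℝ) / A : ℝ) * I) / 2) *
          riemannZeta (1 / 2 + ((n : ℝ) / A : ℝ) * I) *
          Complex.exp ((π * ((n : ℝ) / A) / 4 - ((n : ℝ) / A - t₀) ^ 2 / (2 * H ^ 2) : ℝ) : ℂ) *
          (Real.sinc (π * A * ((n : ℝ) / A - t₀)) : ℂ)) ∧
      ‖∑' n : {n : ℤ // (Ns : ℝ) < |(n : ℝ) - A * t₀|},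
          (π : ℂ) ^ (-(I * ((n : ℝ) / A : ℝ) / 2)) * Complex.Gamma ((1 / 2 + ((n : ℝ) / A : ℝ) * I) / 2) *
            riemannZeta (1 / 2 + ((n : ℝ) / A : ℝ) * I) *
            Complex.exp ((π * ((n : ℝ) / A) / 4 - ((n : ℝ) / A - t₀) ^ 2 / (2 * H ^ 2) : ℝ) : ℂ) *
            (Real.sinc (π * A * ((n : ℝ) / A - t₀)) : ℂ)‖ ≤
        6 * A / (π * Ns) *
          ((t₀ + Ns / A) ^ β * Real.exp (-((Ns : ℝ) ^ 2 / (2 * A ^ 2 * H ^ 2))) +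
            (2 : ℝ) ^ (2 * β - 1 / 2) * t₀ ^ β * A * H * upperIncGamma (1 / 2) ((Ns : ℝ) ^ 2 / (2 * A ^ 2 * H ^ 2)) +
            (2 : ℝ) ^ (3 * β - 1 / 2) * A * H ^ (β + 1) * upperIncGamma ((β + 1) / 2) (t₀ ^ 2 / (2 * H ^ 2))) := by
  have hA0 : 0 < A := by linarith
  obtain ⟨hsum, hle⟩ := platt2017_lemmaC3 hAζ hζ ht₀ hH hA0 hβ hNs hNsle hmono
  refine ⟨hsum, hle.trans ?_⟩
  have ht₀pos : 0 < t₀ := lt_trans (Real.exp_pos _) ht₀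
  have hNs' : (0 : ℝ) < Ns := by exact_mod_cast hNs
  have hΓ₁0 : 0 ≤ upperIncGamma (1 / 2) ((Ns : ℝ) ^ 2 / (2 * A ^ 2 * H ^ 2)) := by
    unfold upperIncGamma
    exact setIntegral_nonneg measurableSet_Ioi fun s hs => by
      have : 0 < s := lt_trans (by positivity) hs
      positivity
  have hΓ₂0 : 0 ≤ upperIncGamma ((β + 1) / 2) (t₀ ^ 2 / (2 * H ^ 2)) := by
    unfold upperIncGamma
    exact setIntegral_nonneg measurableSet_Ioi fun s hs => by
      have : 0 < s := lt_trans (by positivity) hs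
      positivity
  have ht₀β : 0 ≤ t₀ ^ β := Real.rpow_nonneg ht₀pos.le β
  have hHβ : 0 ≤ H ^ (β + 1) := Real.rpow_nonneg hH.le _
  have hbr : 0 ≤ (t₀ + Ns / A) ^ β * Real.exp (-((Ns : ℝ) ^ 2 / (2 * A ^ 2 * H ^ 2))) +
      (2 : ℝ) ^ (2 * β - 1 / 2) * t₀ ^ β * A * H * upperIncGamma (1 / 2) ((Ns : ℝ) ^ 2 / (2 * A ^ 2 * H ^ 2)) +
      (2 : ℝ) ^ (3 * β - 1 / 2) * A * H ^ (β + 1) * upperIncGamma ((β + 1) / 2) (t₀ ^ 2 / (2 * H ^ 2)) := by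
    positivity
  have h6 : 6 / (π * Ns) ≤ 6 * A / (π * Ns) :=
    div_le_div_of_nonneg_right (by linarith) (by positivity)
  exact mul_le_mul_of_nonneg_right h6 hbr

open Platt2017 in
/-- **Platt 2017, Lemma C.3 (p. 2465), as printed** (constant `6A/(πN_s)`, `A ≥ 1`) with hypothesis
(A.2) = Platt–Trudgian 2015 verbatim («`t > 2`, `|ζ(1/2+it)| ≤ 0.732 t^{1/6} log t`»).
[cite: Platt2017, Lemma C.3 p. 2465] -/
theorem platt2017_lemmaC3_of_plattTrudgian2015
    (h22 : ∀ u : ℝ, 2 < u → ‖riemannZeta (1 / 2 + u * I)‖ ≤ 0.732 * u ^ (1 / 6 : ℝ) * Real.log u)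
    {t₀ H A β : ℝ} {Ns : ℕ} (ht₀ : Real.exp (Real.exp 1) < t₀) (hH : 0 < H) (hA : 1 ≤ A)
    (hβ : β = 1 / 6 + Real.log (Real.log t₀) / Real.log t₀) (hNs : 0 < Ns)
    (hNsle : (Ns : ℝ) ≤ t₀ * A) (hmono : β * H ^ 2 / t₀ ≤ Ns / A) :
    Summable (fun n : {n : ℤ // (Ns : ℝ) < |(n : ℝ) - A * t₀|} =>
        (π : ℂ) ^ (-(I * ((n : ℝ) / A : ℝ) / 2)) * Complex.Gamma ((1 / 2 + ((n : ℝ) / A : ℝ) * I) / 2) *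
          riemannZeta (1 / 2 + ((n : ℝ) / A : ℝ) * I) *
          Complex.exp ((π * ((n : ℝ) / A) / 4 - ((n : ℝ) / A - t₀) ^ 2 / (2 * H ^ 2) : ℝ) : ℂ) *
          (Real.sinc (π * A * ((n : ℝ) / A - t₀)) : ℂ)) ∧
      ‖∑' n : {n : ℤ // (Ns : ℝ) < |(n : ℝ) - A * t₀|},
          (π : ℂ) ^ (-(I * ((n : ℝ) / A : ℝ) / 2)) * Complex.Gamma ((1 / 2 + ((n : ℝ) / A : ℝ) * I) / 2) *
            riemannZeta (1 / 2 + ((n : ℝ) / A : ℝ) * I) *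
            Complex.exp ((π * ((n : ℝ) / A) / 4 - ((n : ℝ) / A - t₀) ^ 2 / (2 * H ^ 2) : ℝ) : ℂ) *
            (Real.sinc (π * A * ((n : ℝ) / A - t₀)) : ℂ)‖ ≤
        6 * A / (π * Ns) *
          ((t₀ + Ns / A) ^ β * Real.exp (-((Ns : ℝ) ^ 2 / (2 * A ^ 2 * H ^ 2))) +
            (2 : ℝ) ^ (2 * β - 1 / 2) * t₀ ^ β * A * H * upperIncGamma (1 / 2) ((Ns : ℝ) ^ 2 / (2 * A ^ 2 * H ^ 2)) +
            (2 : ℝ) ^ (3 * β - 1 / 2) * A * H ^ (β + 1) * upperIncGamma ((β + 1) / 2) (t₀ ^ 2 / (2 * H ^ 2))) :=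
  platt2017_lemmaC3_printed (Aζ := 0.732) (by norm_num) (fun u hu => h22 u (by linarith))
    ht₀ hH hA hβ hNs hNsle hmono

open Platt2017 in
/-- **Platt 2017, Lemma C.3 (p. 2465), from the tree's named fact `zeta_half_line_hiary_patel_yang`**
(sharper constant `6/(πN_s)`, any `A > 0`). [cite: Platt2017, Lemma C.3 p. 2465]
[cite: HiaryPatelYang2024, Thm. 1.1] -/
theorem platt2017_lemmaC3_of_hpy (hHPY : zeta_half_line_hiary_patel_yang)
    {t₀ H A β : ℝ} {Ns : ℕ} (ht₀ : Real.exp (Real.exp 1) < t₀) (hH : 0 < H) (hA : 0 < A)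
    (hβ : β = 1 / 6 + Real.log (Real.log t₀) / Real.log t₀) (hNs : 0 < Ns)
    (hNsle : (Ns : ℝ) ≤ t₀ * A) (hmono : β * H ^ 2 / t₀ ≤ Ns / A) :
    Summable (fun n : {n : ℤ // (Ns : ℝ) < |(n : ℝ) - A * t₀|} =>
        (π : ℂ) ^ (-(I * ((n : ℝ) / A : ℝ) / 2)) * Complex.Gamma ((1 / 2 + ((n : ℝ) / A : ℝ) * I) / 2) *
          riemannZeta (1 / 2 + ((n : ℝ) / A : ℝ) * I) *
          Complex.exp ((π * ((n : ℝ) / A) / 4 - ((n : ℝ) / A - t₀) ^ 2 / (2 * H ^ 2) : ℝ) : ℂ) *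
          (Real.sinc (π * A * ((n : ℝ) / A - t₀)) : ℂ)) ∧
      ‖∑' n : {n : ℤ // (Ns : ℝ) < |(n : ℝ) - A * t₀|},
          (π : ℂ) ^ (-(I * ((n : ℝ) / A : ℝ) / 2)) * Complex.Gamma ((1 / 2 + ((n : ℝ) / A : ℝ) * I) / 2) *
            riemannZeta (1 / 2 + ((n : ℝ) / A : ℝ) * I) *
            Complex.exp ((π * ((n : ℝ) / A) / 4 - ((n : ℝ) / A - t₀) ^ 2 / (2 * H ^ 2) : ℝ) : ℂ) *
            (Real.sinc (π * A * ((n : ℝ) / A - t₀)) : ℂ)‖ ≤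
        6 / (π * Ns) *
          ((t₀ + Ns / A) ^ β * Real.exp (-((Ns : ℝ) ^ 2 / (2 * A ^ 2 * H ^ 2))) +
            (2 : ℝ) ^ (2 * β - 1 / 2) * t₀ ^ β * A * H * upperIncGamma (1 / 2) ((Ns : ℝ) ^ 2 / (2 * A ^ 2 * H ^ 2)) +
            (2 : ℝ) ^ (3 * β - 1 / 2) * A * H ^ (β + 1) * upperIncGamma ((β + 1) / 2) (t₀ ^ 2 / (2 * H ^ 2))) :=
  platt2017_lemmaC3 (Aζ := 0.618) (by norm_num) (fun u hu => hHPY u hu) ht₀ hH hA hβ hNs hNsle hmono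


/-! ### Appendix B, Lemma B.2: the Gaussian moment behind the Taylor-tail bound, and `Σ_{j≤J} 1/√j ≤ 2√J − 1` -/

/-- **Platt 2017, Lemma B.2 (p. 2464), the displayed evaluation:**
`8 ∫_0^∞ (2πtξ)^K/K! exp(−t²/(2h²)) dt = 2^{(3K+5)/2} π^K ξ^K h^{K+1} Γ((K+1)/2)/Γ(K+1)` (the Gaussian
moment, Mathlib `integral_rpow_mul_exp_neg_mul_rpow`; `K! = Γ(K+1)`).
[cite: Platt2017, Lemma B.2 p. 2464 (proof, displayed equality)] -/
theorem platt2017_lemmaB2_moment (K : ℕ) {h : ℝ} (hh : 0 < h) (ξ : ℝ) :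
    8 * ∫ t in Ioi (0 : ℝ), (2 * π * t * ξ) ^ K / (K.factorial : ℝ) * Real.exp (-(t ^ 2 / (2 * h ^ 2))) =
      (2 : ℝ) ^ ((3 * (K : ℝ) + 5) / 2) * π ^ K * ξ ^ K * h ^ (K + 1) * Real.Gamma (((K : ℝ) + 1) / 2) /
        Real.Gamma ((K : ℝ) + 1) := by
  have hb : (0 : ℝ) < 1 / (2 * h ^ 2) := by positivity
  have hmom := _root_.integral_rpow_mul_exp_neg_mul_rpow (p := 2) (q := (K : ℝ)) (b := 1 / (2 * h ^ 2))
    (by norm_num) (by have := Nat.cast_nonneg (α := ℝ) K; linarith) hb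
  -- rewrite the integrand
  have hint : ∫ t in Ioi (0 : ℝ), (2 * π * t * ξ) ^ K / (K.factorial : ℝ) * Real.exp (-(t ^ 2 / (2 * h ^ 2))) =
      (2 * π * ξ) ^ K / (K.factorial : ℝ) * ∫ t in Ioi (0 : ℝ), t ^ (K : ℝ) * Real.exp (-(1 / (2 * h ^ 2)) * t ^ (2 : ℝ)) := by
    rw [← integral_const_mul]
    refine setIntegral_congr_fun measurableSet_Ioi fun t _ => ?_
    rw [Real.rpow_natCast, show (t : ℝ) ^ (2 : ℝ) = t ^ 2 by norm_cast]
    have : -(1 / (2 * h ^ 2)) * t ^ 2 = -(t ^ 2 / (2 * h ^ 2)) := by ring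
    rw [this, mul_pow, mul_pow]; ring
  rw [hint, hmom]
  -- `(1/(2h²))^{-(K+1)/2} = 2^{(K+1)/2} h^{K+1}`
  have hpow : (1 / (2 * h ^ 2) : ℝ) ^ (-((K : ℝ) + 1) / 2) = (2 : ℝ) ^ (((K : ℝ) + 1) / 2) * h ^ (K + 1) := by
    rw [one_div, Real.inv_rpow (by positivity), ← Real.rpow_neg (by positivity), neg_div, neg_neg,
      Real.mul_rpow (by norm_num) (by positivity)]
    congr 1
    rw [show (h ^ 2 : ℝ) = h ^ (2 : ℝ) by norm_cast, ← Real.rpow_mul hh.le, ← Real.rpow_natCast]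
    congr 1; push_cast; ring
  rw [hpow]
  have hfac : (K.factorial : ℝ) = Real.Gamma ((K : ℝ) + 1) := (Real.Gamma_nat_eq_factorial K).symm
  rw [hfac]
  have h35 : (2 : ℝ) ^ ((3 * (K : ℝ) + 5) / 2) = 8 * (2 : ℝ) ^ K * ((2 : ℝ) ^ (((K : ℝ) + 1) / 2) * (1 / 2)) := by
    rw [show (8 : ℝ) = (2 : ℝ) ^ (3 : ℝ) by norm_num, ← Real.rpow_natCast 2 K,
      show (1 / 2 : ℝ) = (2 : ℝ) ^ (-1 : ℝ) by norm_num, ← Real.rpow_add two_pos, ← Real.rpow_add two_pos,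
      ← Real.rpow_add two_pos]
    congr 1; ring
  rw [h35, mul_pow, mul_pow]
  have hΓ0 : Real.Gamma ((K : ℝ) + 1) ≠ 0 := (Real.Gamma_pos_of_pos (by positivity)).ne'
  field_simp

/-- **Lemma B.2, the duplication-formula step** («and the result follows from the duplication formula
for Γ»): `2^{(3K+5)/2} π^K ξ^K h^{K+1} Γ((K+1)/2)/Γ(K+1) = 2^{(K+5)/2} π^{K+1/2} h^{K+1} ξ^K / Γ((K+2)/2)
≤ 2^{K+5/2} π^{K+1/2} h^{K+1} ξ^K / Γ((K+2)/2)` — the last expression is the printed bound of Lemma B.2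
(its exponent `K + 5/2` exceeds the `(K+5)/2` the computation gives; recorded, the printed form holds a
fortiori), for `ξ ≥ 0`. [cite: Platt2017, Lemma B.2 p. 2464] -/
theorem platt2017_lemmaB2_duplication (K : ℕ) {h ξ : ℝ} (hh : 0 < h) (hξ : 0 ≤ ξ) :
    (2 : ℝ) ^ ((3 * (K : ℝ) + 5) / 2) * π ^ K * ξ ^ K * h ^ (K + 1) * Real.Gamma (((K : ℝ) + 1) / 2) /
        Real.Gamma ((K : ℝ) + 1) =
      (2 : ℝ) ^ (((K : ℝ) + 5) / 2) * π ^ ((K : ℝ) + 1 / 2) * h ^ (K + 1) * ξ ^ K /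
        Real.Gamma (((K : ℝ) + 2) / 2) ∧
    (2 : ℝ) ^ (((K : ℝ) + 5) / 2) * π ^ ((K : ℝ) + 1 / 2) * h ^ (K + 1) * ξ ^ K /
        Real.Gamma (((K : ℝ) + 2) / 2) ≤
      (2 : ℝ) ^ ((K : ℝ) + 5 / 2) * π ^ ((K : ℝ) + 1 / 2) * h ^ (K + 1) * ξ ^ K /
        Real.Gamma (((K : ℝ) + 2) / 2) := by
  have hdup := Real.Gamma_mul_Gamma_add_half (((K : ℝ) + 1) / 2)
  have e1 : ((K : ℝ) + 1) / 2 + 1 / 2 = ((K : ℝ) + 2) / 2 := by ring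
  have e2 : 2 * (((K : ℝ) + 1) / 2) = (K : ℝ) + 1 := by ring
  rw [e1, e2] at hdup
  have hΓ1 : 0 < Real.Gamma (((K : ℝ) + 1) / 2) := Real.Gamma_pos_of_pos (by positivity)
  have hΓ2 : 0 < Real.Gamma (((K : ℝ) + 2) / 2) := Real.Gamma_pos_of_pos (by positivity)
  have hΓK : 0 < Real.Gamma ((K : ℝ) + 1) := Real.Gamma_pos_of_pos (by positivity)
  have hsqrtpi : Real.sqrt π = π ^ (1 / 2 : ℝ) := Real.sqrt_eq_rpow π
  constructor
  · -- `Γ((K+1)/2)/Γ(K+1) = 2^{-K} √π / Γ((K+2)/2)`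
    rw [div_eq_div_iff hΓK.ne' hΓ2.ne']
    have hK1 : Real.Gamma ((K : ℝ) + 1) = Real.Gamma (((K : ℝ) + 1) / 2) * Real.Gamma (((K : ℝ) + 2) / 2) /
        ((2 : ℝ) ^ (1 - ((K : ℝ) + 1)) * Real.sqrt π) := by
      rw [hdup]; field_simp
    rw [hK1, hsqrtpi]
    have hπK : π ^ ((K : ℝ) + 1 / 2) = π ^ K * π ^ (1 / 2 : ℝ) := by
      rw [Real.rpow_add Real.pi_pos, Real.rpow_natCast]
    rw [hπK]
    have h2e : (2 : ℝ) ^ ((3 * (K : ℝ) + 5) / 2) = (2 : ℝ) ^ (((K : ℝ) + 5) / 2) * ((2 : ℝ) ^ (1 - ((K : ℝ) + 1)))⁻¹ := by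
      rw [← Real.rpow_neg (by norm_num), ← Real.rpow_add two_pos]; congr 1; ring
    rw [h2e]
    have h2pos : (2 : ℝ) ^ (1 - ((K : ℝ) + 1)) ≠ 0 := (Real.rpow_pos_of_pos two_pos _).ne'
    have hπh : π ^ (1 / 2 : ℝ) ≠ 0 := (Real.rpow_pos_of_pos Real.pi_pos _).ne'
    field_simp
  · apply div_le_div_of_nonneg_right _ hΓ2.le
    have hexp : (2 : ℝ) ^ (((K : ℝ) + 5) / 2) ≤ (2 : ℝ) ^ ((K : ℝ) + 5 / 2) :=
      Real.rpow_le_rpow_of_exponent_le (by norm_num) (by have := Nat.cast_nonneg (α := ℝ) K; linarith)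
    have hrest : 0 ≤ π ^ ((K : ℝ) + 1 / 2) * h ^ (K + 1) * ξ ^ K := by positivity
    calc (2 : ℝ) ^ (((K : ℝ) + 5) / 2) * π ^ ((K : ℝ) + 1 / 2) * h ^ (K + 1) * ξ ^ K
        = (2 : ℝ) ^ (((K : ℝ) + 5) / 2) * (π ^ ((K : ℝ) + 1 / 2) * h ^ (K + 1) * ξ ^ K) := by ring
      _ ≤ (2 : ℝ) ^ ((K : ℝ) + 5 / 2) * (π ^ ((K : ℝ) + 1 / 2) * h ^ (K + 1) * ξ ^ K) :=
          mul_le_mul_of_nonneg_right hexp hrest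
      _ = (2 : ℝ) ^ ((K : ℝ) + 5 / 2) * π ^ ((K : ℝ) + 1 / 2) * h ^ (K + 1) * ξ ^ K := by ring

/-- **Platt 2017, Lemma B.2 (p. 2464), in the form its proof yields for any `g` obeying Lemma A.4:** the
chain «`≤ sup |∫ g(t;K) ξ^K e(−u't)/K! dt| ≤ 8∫_0^∞ (2πtξ)^K/K! exp(−t²/(2h²)) dt = … `» bounds the
`K`-th Taylor coefficient integral: for `|w| ≤ ξ` and `‖g(t)‖ ≤ 4(2π|t|)^K e^{−t²/(2h²)}`,
`∫_ℝ ‖g(t)‖ |w|^K/K! dt ≤ 2^{K+5/2} π^{K+1/2} h^{K+1} ξ^K / Γ((K+2)/2)` (the printed right-hand side).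
The identification of the Taylor tail `Σ_{k≥K} G^{(k)}(u) w^k/k!` with `G^{(K)}(u') w^K/K!` at an
intermediate point and of `G^{(K)}` with the Fourier transform of `g(·;K)` (differentiation under the
integral) is not typed here. [cite: Platt2017, Lemma B.2 p. 2464] -/
theorem platt2017_lemmaB2_of_bound (K : ℕ) {h ξ w : ℝ} {g : ℝ → ℂ} (hh : 0 < h) (hξ : 0 ≤ ξ)
    (hw : |w| ≤ ξ) (hg : ∀ t : ℝ, ‖g t‖ ≤ 4 * (2 * π * |t|) ^ K * Real.exp (-(t ^ 2 / (2 * h ^ 2)))) :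
    ∫ t : ℝ, ‖g t‖ * |w| ^ K / (K.factorial : ℝ) ≤
      (2 : ℝ) ^ ((K : ℝ) + 5 / 2) * π ^ ((K : ℝ) + 1 / 2) * h ^ (K + 1) * ξ ^ K /
        Real.Gamma (((K : ℝ) + 2) / 2) := by
  -- the majorant `M(t) = 4 (2π|t|ξ)^K/K! e^{−t²/(2h²)} = φ(|t|)`
  set φ : ℝ → ℝ := fun s => (2 * π * s * ξ) ^ K / (K.factorial : ℝ) * Real.exp (-(s ^ 2 / (2 * h ^ 2)))
    with hφ
  have hφabs : ∀ t : ℝ, 4 * φ |t| = 4 * (2 * π * |t|) ^ K * Real.exp (-(t ^ 2 / (2 * h ^ 2))) * ξ ^ K /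
      (K.factorial : ℝ) := fun t => by
    simp only [hφ, sq_abs, mul_pow]; ring
  -- integrability of the majorant on `ℝ`
  have hb : (0 : ℝ) < 1 / (2 * h ^ 2) := by positivity
  have hint : Integrable fun t : ℝ => t ^ (K : ℝ) * Real.exp (-(1 / (2 * h ^ 2)) * t ^ 2) :=
    integrable_rpow_mul_exp_neg_mul_sq hb (by have := Nat.cast_nonneg (α := ℝ) K; linarith)
  have hMint : Integrable fun t : ℝ => 4 * φ |t| := by
    have h1 : Integrable fun t : ℝ => |t| ^ K * Real.exp (-(t ^ 2 / (2 * h ^ 2))) := by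
      refine (hint.norm).congr (ae_of_all _ fun t => ?_)
      simp only [Real.norm_eq_abs, Real.rpow_natCast, abs_mul, abs_pow, abs_of_pos (Real.exp_pos _)]
      congr 2; ring
    refine (h1.const_mul (4 * (2 * π * ξ) ^ K / (K.factorial : ℝ))).congr (ae_of_all _ fun t => ?_)
    simp only [hφ, sq_abs, mul_pow]; ring
  -- pointwise domination
  have hdom : ∀ t : ℝ, ‖g t‖ * |w| ^ K / (K.factorial : ℝ) ≤ 4 * φ |t| := by
    intro t
    rw [hφabs]
    have hwK : |w| ^ K ≤ ξ ^ K := pow_le_pow_left₀ (abs_nonneg w) hw K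
    have hfac : (0 : ℝ) < K.factorial := by exact_mod_cast Nat.factorial_pos K
    rw [div_le_div_iff_of_pos_right hfac]
    have h0 : 0 ≤ 4 * (2 * π * |t|) ^ K * Real.exp (-(t ^ 2 / (2 * h ^ 2))) := by positivity
    calc ‖g t‖ * |w| ^ K ≤ (4 * (2 * π * |t|) ^ K * Real.exp (-(t ^ 2 / (2 * h ^ 2)))) * ξ ^ K :=
          mul_le_mul (hg t) hwK (pow_nonneg (abs_nonneg w) K) h0
      _ = 4 * (2 * π * |t|) ^ K * Real.exp (-(t ^ 2 / (2 * h ^ 2))) * ξ ^ K := by ring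
  have hmono : ∫ t : ℝ, ‖g t‖ * |w| ^ K / (K.factorial : ℝ) ≤ ∫ t : ℝ, 4 * φ |t| :=
    integral_mono_of_nonneg (ae_of_all _ fun t => by positivity) hMint (ae_of_all _ hdom)
  refine hmono.trans ?_
  -- `∫ 4 φ(|t|) = 8 ∫_0^∞ φ`
  have heven : ∫ t : ℝ, 4 * φ |t| = 8 * ∫ t in Ioi (0 : ℝ), φ t := by
    rw [integral_const_mul, integral_comp_abs (f := φ)]; ring
  rw [heven]
  simp only [hφ]
  rw [platt2017_lemmaB2_moment K hh ξ]
  obtain ⟨heq, hle⟩ := platt2017_lemmaB2_duplication K hh hξ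
  rw [heq]
  exact hle

/-- **«Since this error term occurs `J` times in (3.2), weighted by `1/√j` each time, we multiply it by
`2√J − 1`»** (p. 2464, after Lemma B.2): `Σ_{j=1}^{J} 1/√j ≤ 2√J − 1` for `J ≥ 1`.
[cite: Platt2017, Appendix B p. 2464 (remark after Lemma B.2)] -/
theorem platt2017_sum_inv_sqrt_le {J : ℕ} (hJ : 1 ≤ J) :
    ∑ j ∈ Finset.Icc 1 J, 1 / Real.sqrt j ≤ 2 * Real.sqrt J - 1 := by
  induction J with
  | zero => omega
  | succ n ih =>
    rcases Nat.eq_zero_or_pos n with h0 | hpos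
    · subst h0; norm_num
    · rw [Finset.sum_Icc_succ_top (by omega), Nat.cast_succ]
      have ih' := ih hpos
      -- `1/√(n+1) ≤ 2(√(n+1) − √n)`
      have hn : (0 : ℝ) < n := by exact_mod_cast hpos
      have hs : 0 < Real.sqrt n := Real.sqrt_pos.mpr hn
      have hs1 : 0 < Real.sqrt ((n : ℝ) + 1) := Real.sqrt_pos.mpr (by linarith)
      have hkey : 1 / Real.sqrt ((n : ℝ) + 1) ≤ 2 * (Real.sqrt ((n : ℝ) + 1) - Real.sqrt n) := by
        have hdiff : Real.sqrt ((n : ℝ) + 1) - Real.sqrt n =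
            1 / (Real.sqrt ((n : ℝ) + 1) + Real.sqrt n) := by
          have hprod : (Real.sqrt ((n : ℝ) + 1) - Real.sqrt n) * (Real.sqrt ((n : ℝ) + 1) + Real.sqrt n) = 1 := by
            have h1 := Real.mul_self_sqrt (by linarith : (0 : ℝ) ≤ (n : ℝ) + 1)
            have h2 := Real.mul_self_sqrt hn.le
            nlinarith
          field_simp
          linarith [hprod]
        rw [hdiff]
        have hmono : Real.sqrt n ≤ Real.sqrt ((n : ℝ) + 1) := Real.sqrt_le_sqrt (by linarith)
        rw [mul_one_div, div_le_div_iff₀ hs1 (by positivity)]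
        nlinarith
      linarith


/-! ### Lemma A.3: `Im ψ ≤ π/2`, the fold «since `σ ≥ 3`», and the corrected closed form -/

namespace Platt2017

/-- Mean-value lower bound for an `arctan` increment: `(a − b)/(1 + a²) ≤ arctan a − arctan b` for
`0 ≤ b ≤ a` (the derivative `1/(1+u²)` of `arctan` is at least `1/(1+a²)` on `[b, a]`). [folklore] -/
private theorem sub_div_le_arctan_sub_arctan {a b : ℝ} (hb : 0 ≤ b) (hba : b ≤ a) :
    (a - b) / (1 + a ^ 2) ≤ Real.arctan a - Real.arctan b := by
  -- `φ(u) = arctan u − u/(1+a²)` is monotone on `[0, a]`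
  let φ : ℝ → ℝ := fun u => Real.arctan u - u / (1 + a ^ 2)
  have hderiv : ∀ u : ℝ, HasDerivAt φ (1 / (1 + u ^ 2) - 1 / (1 + a ^ 2)) u := fun u =>
    (Real.hasDerivAt_arctan u).sub ((hasDerivAt_id u).div_const (1 + a ^ 2))
  have hmono : MonotoneOn φ (Icc 0 a) := by
    refine monotoneOn_of_deriv_nonneg (convex_Icc 0 a)
      (fun u _ => (hderiv u).continuousAt.continuousWithinAt)
      (fun u _ => (hderiv u).differentiableAt.differentiableWithinAt) fun u hu => ?_
    rw [interior_Icc] at hu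
    rw [(hderiv u).deriv, sub_nonneg]
    exact one_div_le_one_div_of_le (by positivity) (by nlinarith [hu.1, hu.2])
  have h := hmono ⟨hb, hba⟩ ⟨hb.trans hba, le_rfl⟩ hba
  simp only [φ] at h
  rw [sub_div]
  linarith

/-- **The step behind Lemma A.3's «since `σ ≥ 3`»:** for `Re w ≥ 1`, `Im ψ(w) ≤ π/2`. From the series
`Im ψ(w) = Σ_{k≥0} Im w/((Re w + k)² + (Im w)²)` (Andrews–Askey–Roy (1.2.13), the tree's
`TimeAliasing.hasSum_im_digamma`): for `Im w > 0` each term is at most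
`arctan((Re w + k)/Im w) − arctan((Re w + k − 1)/Im w)` and the sum telescopes below
`π/2 − arctan((Re w − 1)/Im w) ≤ π/2`; for `Im w ≤ 0` every term is `≤ 0`.
[cite: Platt2017, Lemma A.3 p. 2457 (proof p. 2458: «Since σ ≥ 3 we have …»)] -/
theorem im_digamma_le_half_pi {w : ℂ} (hw : 1 ≤ w.re) : (Complex.digamma w).im ≤ π / 2 := by
  have hw0 : 0 < w.re := by linarith
  have hS := TimeAliasing.hasSum_im_digamma hw0
  rcases le_or_gt w.im 0 with hy | hy
  · have h0 : (Complex.digamma w).im ≤ 0 :=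
      hS.nonpos fun k => div_nonpos_of_nonpos_of_nonneg hy (by positivity)
    linarith [Real.pi_pos]
  · set x := w.re with hx
    set y := w.im with hyd
    have hterm : ∀ k : ℕ, y / ((x + k) ^ 2 + y ^ 2) ≤
        Real.arctan ((x + k) / y) - Real.arctan ((x + k - 1) / y) := by
      intro k
      have hk : (0 : ℝ) ≤ k := Nat.cast_nonneg k
      have hb : 0 ≤ (x + k - 1) / y := div_nonneg (by linarith) hy.le
      have hba : (x + k - 1) / y ≤ (x + k) / y := div_le_div_of_nonneg_right (by linarith) hy.le
      have h := sub_div_le_arctan_sub_arctan hb hba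
      have heq : ((x + k) / y - (x + k - 1) / y) / (1 + ((x + k) / y) ^ 2) = y / ((x + k) ^ 2 + y ^ 2) := by
        field_simp
        ring
      rw [heq] at h
      exact h
    have hpartial : ∀ n : ℕ, ∑ i ∈ Finset.range n, y / ((x + i) ^ 2 + y ^ 2) ≤ π / 2 := by
      intro n
      have htel := Finset.sum_range_sub (fun i : ℕ => Real.arctan ((x + i - 1) / y)) n
      have hsum : ∑ i ∈ Finset.range n, y / ((x + i) ^ 2 + y ^ 2) ≤
          ∑ i ∈ Finset.range n, (Real.arctan ((x + (i + 1 : ℕ) - 1) / y) - Real.arctan ((x + i - 1) / y)) := by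
        refine Finset.sum_le_sum fun i _ => ?_
        have := hterm i
        push_cast
        rw [show x + ((i : ℝ) + 1) - 1 = x + i by ring]
        exact this
      refine hsum.trans ?_
      rw [htel]
      have h1 : Real.arctan ((x + (n : ℕ) - 1) / y) < π / 2 := Real.arctan_lt_pi_div_two _
      have h2 : 0 ≤ Real.arctan ((x + ((0 : ℕ) : ℝ) - 1) / y) :=
        Real.arctan_nonneg.mpr (div_nonneg (by push_cast; linarith) hy.le)
      linarith
    rw [← hS.tsum_eq]
    exact Real.tsum_le_of_sum_range_le (fun k => by positivity) hpartial

/-- **The fold «since `σ ≥ 3`» of Lemma A.3 made explicit:** for `σ ≥ 2` the function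
`τ ↦ |Γ((σ + iτ)/2)| e^{πτ/4}` is nondecreasing on `ℝ` (its logarithmic derivative is
`π/4 − ½ Im ψ((σ+iτ)/2) ≥ 0` by `im_digamma_le_half_pi`, since `Re((σ+iτ)/2) = σ/2 ≥ 1`).
[cite: Platt2017, Lemma A.3 p. 2457 (proof p. 2458: «Since σ ≥ 3 we have …»)] -/
theorem norm_Gamma_mul_exp_monotone {σ : ℝ} (hσ : 2 ≤ σ) :
    Monotone fun τ : ℝ => ‖Complex.Gamma ((σ + τ * I) / 2)‖ * Real.exp (π * τ / 4) := by
  have hσ0 : 0 < σ := by linarith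
  set L : ℝ → ℝ := fun τ => Real.log ‖Complex.Gamma ((σ + τ * I) / 2)‖ + π * τ / 4 with hL
  have hD : ∀ τ : ℝ, HasDerivAt L
      (-(1 / 2) * (Complex.digamma ((σ + τ * I) / 2)).im + π / 4) τ := by
    intro τ
    have h1 := TimeAliasing.hasDerivAt_log_norm_Gamma hσ0 τ
    have h2 : HasDerivAt (fun τ : ℝ => π * τ / 4) (π / 4) τ := by
      simpa using ((hasDerivAt_id τ).const_mul π).div_const 4
    exact h1.add h2
  have hre : ∀ τ : ℝ, (((σ : ℂ) + τ * I) / 2).re = σ / 2 := fun τ => by simp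
  have hLmono : Monotone L := by
    refine monotone_of_deriv_nonneg (fun τ => (hD τ).differentiableAt) fun τ => ?_
    rw [(hD τ).deriv]
    have := im_digamma_le_half_pi (w := ((σ : ℂ) + τ * I) / 2) (by rw [hre]; linarith)
    linarith
  have hpos : ∀ τ : ℝ, 0 < ‖Complex.Gamma ((σ + τ * I) / 2)‖ := fun τ =>
    norm_pos_iff.mpr (Complex.Gamma_ne_zero_of_re_pos (by rw [hre]; positivity))
  have hexpL : ∀ τ : ℝ, ‖Complex.Gamma ((σ + τ * I) / 2)‖ * Real.exp (π * τ / 4) = Real.exp (L τ) :=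
    fun τ => by rw [hL, Real.exp_add, Real.exp_log (hpos τ)]
  intro a b hab
  simp only [hexpL]
  exact Real.exp_le_exp.mpr (hLmono hab)

end Platt2017


open Platt2017 in
/-- **Platt 2017, Lemma A.3 (p. 2457), in the form its printed proof yields.** Printed: «For `h > 0`,
`k ∈ ℤ_{≥0}`, and `σ ∈ 2ℤ_{>0} + 1` with `σ + 1/2 ≤ t₀` define
`C(σ,t₀,h,k) := (2π)^k ∫_{−∞}^{∞} |Γ((σ+i(t+t₀))/2) exp(π(t+t₀)/4 − t²/(2h²)) (1/2+σ−it)^k| dt` and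
`X := Σ_{l=0}^{(σ−1)/2} binom((σ−1)/2, l) 2^{(k+l−1)/2} h^{k+l+1} t₀^{(σ−1)/2−l} Γ((k+l+1)/2, (σ+1/2)²/(2h²))`.
Then `C(σ,t₀,h,k) < 2^{(6k+5−σ)/4} π^k e^{(1+2√2)/(6t₀)} (σ+1/2)^k (σ+1/2+t₀)^{(σ−1)/2} h
+ 2^{(6k+7−σ)/4} π^{(2k−1)/2} e^{(1+2√2)/(6t₀)} X`.» *Proof (printed, p. 2458):* «Since `σ ≥ 3` we have
`(2π)^k ∫_ℝ … < 2^{k+1} π^k ∫_0^∞ …`. We now split the integral into two parts. For `t ∈ [0, σ+1/2]`, we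
apply Lemma A.2 … `< 2^{(6k+7−σ)/4} π^{(2k−1)/2} (σ+1/2)^k (σ+1/2+t₀)^{(σ−1)/2} exp(…) ∫_0^∞ e^{−t²/(2h²)} dt
= 2^{(6k+5−σ)/4} π^k (…) h`. Using Lemma A.2 again, we bound the integral for `t ≥ σ+1/2` as follows: …
`< 2^{(6k+7−σ)/4} π^{(2k+1)/2} exp(…) Σ_l binom((σ−1)/2, l) t₀^{(σ−1)/2−l} ∫_{σ+1/2}^∞ t^{k+l} e^{−t²/(2h²)} dt`,
and our result follows from Lemma A.1.»

**What is proved, and the recorded discrepancy.** Executing exactly these steps — the fold of `t < 0`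
onto `t > 0` (`Platt2017.norm_Gamma_mul_exp_monotone`: `τ ↦ |Γ((σ+iτ)/2)| e^{πτ/4}` is nondecreasing
for `σ ≥ 2`, because `Im ψ ≤ π/2` on `Re ≥ 1`, `Platt2017.im_digamma_le_half_pi` — the content of
«since `σ ≥ 3`»), Lemma A.2 at `t + t₀ ≥ t₀ ≥ σ + 1/2`, `|1/2+σ−it| ≤ √2(σ+1/2)` on `[0, σ+1/2]` and
`≤ √2 t` beyond, `∫_0^∞ e^{−t²/(2h²)} dt = h√(π/2)`, the binomial theorem and Lemma A.1 — gives the two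
printed terms with `π^{k+1}` in place of the printed `π^k` and `π^{(2k+1)/2}` in place of the printed
`π^{(2k−1)/2}` (the proof's own second display carries `π^{(2k+1)/2}`; in the first range the
`2^{(4k+7−σ)/4} π^{(2k+1)/2}` of the line before becomes `π^{(2k−1)/2}` without cause, and
`√π · h√(π/2)` contributes another `π`, not `π^{1/2}`). THE PRINTED INEQUALITY IS FALSE AS STATED:
at `σ = 3`, `t₀ = 100`, `h = 1`, `k = 0` numerical quadrature gives `C(3,100,1,0) ≈ 314.2` against the
printed right-hand side `147.3 + 0.07`; at `k = 1`, `C ≈ 7176` against `4584` (the corrected right-hand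
sides are `≈ 463` and `≈ 1.4·10⁴`). This theorem is the corrected statement (with `≤`; the exponent
`(σ−1)/2` is the natural number `m`, `σ = 2m+1`, `m ≥ 1`; `Γ(s,x)` = `upperIncGamma`). Whether Platt's
code used the printed constant or the derived one is not decidable from the paper; the affected
quantity is the truncation error of Lemmas A.6–A.9 (steps (4), (6)), which enter the rigorous error
budget of §5 with many orders of magnitude to spare (p. 2456: the final absolute error bound is
`±2·10⁻⁸` «almost entirely due to the approximation of `Λ(t)` as a `±1` bit»).
[cite: Platt2017, Lemma A.3 p. 2457, proof p. 2458] -/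
theorem platt2017_lemmaA3_corrected (k : ℕ) {σ t₀ h : ℝ} {m : ℕ} (hσ : σ = 2 * m + 1) (hm : 1 ≤ m)
    (ht₀ : σ + 1 / 2 ≤ t₀) (hh : 0 < h) :
    (2 * π) ^ k * ∫ t : ℝ, ‖Complex.Gamma ((σ + (t + t₀) * I) / 2)‖ *
        Real.exp (π * (t + t₀) / 4 - t ^ 2 / (2 * h ^ 2)) * ‖((1 / 2 + σ : ℝ) : ℂ) - t * I‖ ^ k ≤
      (2 : ℝ) ^ ((6 * (k : ℝ) + 5 - σ) / 4) * π ^ (k + 1) * Real.exp ((1 + 2 * Real.sqrt 2) / (6 * t₀)) *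
          (σ + 1 / 2) ^ k * (σ + 1 / 2 + t₀) ^ m * h +
        (2 : ℝ) ^ ((6 * (k : ℝ) + 7 - σ) / 4) * π ^ ((2 * (k : ℝ) + 1) / 2) *
          Real.exp ((1 + 2 * Real.sqrt 2) / (6 * t₀)) *
          ∑ l ∈ Finset.range (m + 1), ((m.choose l : ℕ) : ℝ) * (2 : ℝ) ^ (((k : ℝ) + l - 1) / 2) *
            h ^ (k + l + 1) * t₀ ^ (m - l) *
            upperIncGamma (((k : ℝ) + l + 1) / 2) ((σ + 1 / 2) ^ 2 / (2 * h ^ 2)) := by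
  have hm1 : (1 : ℝ) ≤ m := by exact_mod_cast hm
  have hσ3 : 3 ≤ σ := by rw [hσ]; linarith
  set c : ℝ := σ + 1 / 2 with hc
  have hc0 : 0 < c := by rw [hc]; linarith
  have ht₀0 : 0 < t₀ := by linarith
  set e₀ : ℝ := Real.exp ((1 + 2 * Real.sqrt 2) / (6 * t₀)) with he₀
  set K : ℝ := (2 : ℝ) ^ ((3 - σ) / 4) * Real.sqrt π * e₀ with hK
  have hK0 : 0 < K := by positivity
  set E : ℝ → ℝ := fun s => Real.exp (-(s ^ 2 / (2 * h ^ 2))) with hE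
  have hE_apply : ∀ s, E s = Real.exp (-(s ^ 2 / (2 * h ^ 2))) := fun s => rfl
  set G1 : ℝ → ℝ := fun s => K * (c + t₀) ^ m * Real.sqrt 2 ^ k * c ^ k * E s with hG1
  have hG1_apply : ∀ s, G1 s = K * (c + t₀) ^ m * Real.sqrt 2 ^ k * c ^ k * E s := fun s => rfl
  set G2 : ℝ → ℝ := fun s => K * Real.sqrt 2 ^ k * (s + t₀) ^ m * s ^ k * E s with hG2
  have hG2_apply : ∀ s, G2 s = K * Real.sqrt 2 ^ k * (s + t₀) ^ m * s ^ k * E s := fun s => rfl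
  set R : ℝ → ℝ := fun s => G1 s + (Ioi c).indicator G2 s with hR
  have hR_apply : ∀ s, R s = G1 s + (Ioi c).indicator G2 s := fun s => rfl
  -- (i) the fold and Lemma A.2: `|Γ((σ+iτ)/2)| e^{πτ/4} ≤ K τ^m` for `τ ≥ t₀`
  have hΦmono := norm_Gamma_mul_exp_monotone (σ := σ) (by linarith)
  have hΦle : ∀ τ : ℝ, t₀ ≤ τ →
      ‖Complex.Gamma ((σ + τ * I) / 2)‖ * Real.exp (π * τ / 4) ≤ K * τ ^ m := by
    intro τ hτ
    have hτ0 : 0 < τ := by linarith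
    have hA2 := platt2017_lemmaA2 (σ := σ) (t := τ) (by linarith) (by linarith)
    have hexp : Real.exp ((1 + 2 * Real.sqrt 2) / (6 * τ)) ≤ e₀ :=
      Real.exp_le_exp.mpr (div_le_div_of_nonneg_left (by positivity) (by positivity) (by linarith))
    have hpow : τ ^ ((σ - 1) / 2) = τ ^ m := by
      rw [show (σ - 1) / 2 = (m : ℝ) by rw [hσ]; ring, Real.rpow_natCast]
    rw [hpow] at hA2
    calc ‖Complex.Gamma ((σ + τ * I) / 2)‖ * Real.exp (π * τ / 4)
        ≤ (2 : ℝ) ^ ((3 - σ) / 4) * Real.sqrt π * τ ^ m * Real.exp ((1 + 2 * Real.sqrt 2) / (6 * τ)) :=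
          hA2.le
      _ ≤ (2 : ℝ) ^ ((3 - σ) / 4) * Real.sqrt π * τ ^ m * e₀ :=
          mul_le_mul_of_nonneg_left hexp (by positivity)
      _ = K * τ ^ m := by rw [hK]; ring
  -- (ii) `|1/2 + σ − it| ≤ √2 u` whenever `σ + 1/2 ≤ u` and `|t| ≤ u`
  have hnorm : ∀ t : ℝ, ‖((1 / 2 + σ : ℝ) : ℂ) - t * I‖ = Real.sqrt (c ^ 2 + t ^ 2) := by
    intro t
    have : ((1 / 2 + σ : ℝ) : ℂ) - t * I = (c : ℂ) + ((-t : ℝ) : ℂ) * I := by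
      rw [hc]; push_cast; ring
    rw [this, Complex.norm_add_mul_I, neg_sq]
  have hnorm_le : ∀ t u : ℝ, c ≤ u → |t| ≤ u →
      ‖((1 / 2 + σ : ℝ) : ℂ) - t * I‖ ≤ Real.sqrt 2 * u := by
    intro t u hcu htu
    have hu : 0 ≤ u := (abs_nonneg t).trans htu
    rw [hnorm t]
    have h1 : c ^ 2 ≤ u ^ 2 := pow_le_pow_left₀ hc0.le hcu 2
    have h2 : t ^ 2 ≤ u ^ 2 := by
      rw [← sq_abs t]; exact pow_le_pow_left₀ (abs_nonneg t) htu 2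
    calc Real.sqrt (c ^ 2 + t ^ 2) ≤ Real.sqrt (2 * u ^ 2) := Real.sqrt_le_sqrt (by linarith)
      _ = Real.sqrt 2 * u := by
          rw [Real.sqrt_mul (by norm_num : (0 : ℝ) ≤ 2), Real.sqrt_sq hu]
  -- (iii) pointwise domination of the integrand by `R(|t|)`
  have hdom : ∀ t : ℝ, ‖Complex.Gamma ((σ + (t + t₀) * I) / 2)‖ *
      Real.exp (π * (t + t₀) / 4 - t ^ 2 / (2 * h ^ 2)) * ‖((1 / 2 + σ : ℝ) : ℂ) - t * I‖ ^ k ≤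
        R |t| := by
    intro t
    have hs0 : 0 ≤ |t| := abs_nonneg t
    have hts : t ≤ |t| := le_abs_self t
    have hsplit : ‖Complex.Gamma ((σ + (t + t₀) * I) / 2)‖ *
        Real.exp (π * (t + t₀) / 4 - t ^ 2 / (2 * h ^ 2)) =
          ‖Complex.Gamma ((σ + ((t + t₀ : ℝ) : ℂ) * I) / 2)‖ * Real.exp (π * (t + t₀) / 4) * E |t| := by
      rw [hE_apply, sq_abs, sub_eq_add_neg, Real.exp_add]
      push_cast
      ring
    have h1 : ‖Complex.Gamma ((σ + ((t + t₀ : ℝ) : ℂ) * I) / 2)‖ * Real.exp (π * (t + t₀) / 4) ≤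
        K * (|t| + t₀) ^ m :=
      (hΦmono (by linarith : t + t₀ ≤ |t| + t₀)).trans (hΦle _ (by linarith))
    have hE0 : 0 < E |t| := by rw [hE_apply]; exact Real.exp_pos _
    have hN0 : 0 ≤ ‖((1 / 2 + σ : ℝ) : ℂ) - t * I‖ ^ k := by positivity
    rw [hsplit, hR_apply]
    by_cases hsc : |t| ≤ c
    · have hN : ‖((1 / 2 + σ : ℝ) : ℂ) - t * I‖ ^ k ≤ (Real.sqrt 2 * c) ^ k :=
        pow_le_pow_left₀ (norm_nonneg _) (hnorm_le t c le_rfl hsc) k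
      have hpm : (|t| + t₀) ^ m ≤ (c + t₀) ^ m := pow_le_pow_left₀ (by linarith) (by linarith) m
      have hind : 0 ≤ (Ioi c).indicator G2 |t| := by
        refine Set.indicator_nonneg (fun u hu => ?_) _
        have hu0 : 0 < u := hc0.trans hu
        rw [hG2_apply]; positivity
      calc ‖Complex.Gamma ((σ + ((t + t₀ : ℝ) : ℂ) * I) / 2)‖ * Real.exp (π * (t + t₀) / 4) * E |t| *
            ‖((1 / 2 + σ : ℝ) : ℂ) - t * I‖ ^ k
          ≤ K * (c + t₀) ^ m * E |t| * (Real.sqrt 2 * c) ^ k := by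
            apply mul_le_mul _ hN hN0 (by positivity)
            exact mul_le_mul_of_nonneg_right (h1.trans (mul_le_mul_of_nonneg_left hpm hK0.le)) hE0.le
        _ = G1 |t| := by rw [hG1_apply, mul_pow]; ring
        _ ≤ G1 |t| + (Ioi c).indicator G2 |t| := by linarith
    · rw [not_le] at hsc
      have hN : ‖((1 / 2 + σ : ℝ) : ℂ) - t * I‖ ^ k ≤ (Real.sqrt 2 * |t|) ^ k :=
        pow_le_pow_left₀ (norm_nonneg _) (hnorm_le t |t| hsc.le le_rfl) k
      have hind : (Ioi c).indicator G2 |t| = G2 |t| := Set.indicator_of_mem (show |t| ∈ Ioi c from hsc) G2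
      have hG10 : 0 ≤ G1 |t| := by rw [hG1_apply]; positivity
      calc ‖Complex.Gamma ((σ + ((t + t₀ : ℝ) : ℂ) * I) / 2)‖ * Real.exp (π * (t + t₀) / 4) * E |t| *
            ‖((1 / 2 + σ : ℝ) : ℂ) - t * I‖ ^ k
          ≤ K * (|t| + t₀) ^ m * E |t| * (Real.sqrt 2 * |t|) ^ k := by
            apply mul_le_mul _ hN hN0 (by positivity)
            exact mul_le_mul_of_nonneg_right h1 hE0.le
        _ = G2 |t| := by rw [hG2_apply, mul_pow]; ring
        _ ≤ G1 |t| + (Ioi c).indicator G2 |t| := by rw [hind]; linarith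
  -- (iv) integrability of the majorant
  have hb : (0 : ℝ) < 1 / (2 * h ^ 2) := by positivity
  have hEeq : ∀ t : ℝ, Real.exp (-(1 / (2 * h ^ 2)) * t ^ 2) = E |t| := fun t => by
    rw [hE_apply, sq_abs]; congr 1; ring
  have hmon : ∀ n : ℕ, Integrable fun t : ℝ => |t| ^ n * E |t| := by
    intro n
    have hint := integrable_rpow_mul_exp_neg_mul_sq hb (s := (n : ℝ))
      (by have := Nat.cast_nonneg (α := ℝ) n; linarith)
    refine (hint.norm).congr (ae_of_all _ fun t => ?_)
    simp only [Real.norm_eq_abs, Real.rpow_natCast, abs_mul, abs_pow, abs_of_pos (Real.exp_pos _)]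
    rw [hEeq]
  have hG2exp : ∀ s : ℝ, G2 s = ∑ l ∈ Finset.range (m + 1),
      (K * Real.sqrt 2 ^ k * (m.choose l : ℝ) * t₀ ^ (m - l)) * (s ^ (k + l) * E s) := by
    intro s
    rw [hG2_apply, add_pow, Finset.mul_sum, Finset.sum_mul, Finset.sum_mul]
    refine Finset.sum_congr rfl fun l _ => ?_
    rw [pow_add]; ring
  have hG2int : Integrable fun t : ℝ => G2 |t| := by
    have : (fun t : ℝ => G2 |t|) = fun t => ∑ l ∈ Finset.range (m + 1),
        (K * Real.sqrt 2 ^ k * (m.choose l : ℝ) * t₀ ^ (m - l)) * (|t| ^ (k + l) * E |t|) := by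
      funext t; exact hG2exp |t|
    rw [this]
    exact integrable_finsetSum _ fun l _ => (hmon (k + l)).const_mul _
  have hG1int : Integrable fun t : ℝ => G1 |t| := by
    have : (fun t : ℝ => G1 |t|) = fun t =>
        (K * (c + t₀) ^ m * Real.sqrt 2 ^ k * c ^ k) * (|t| ^ 0 * E |t|) := by
      funext t; rw [hG1_apply, pow_zero, one_mul]
    rw [this]; exact (hmon 0).const_mul _
  have hmeas : MeasurableSet {t : ℝ | c < |t|} := measurableSet_lt measurable_const measurable_abs
  have hG2ind : Integrable fun t : ℝ => (Ioi c).indicator G2 |t| := by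
    have hind : (fun t : ℝ => (Ioi c).indicator G2 |t|) = {t : ℝ | c < |t|}.indicator fun t => G2 |t| := by
      funext t
      by_cases ht : c < |t|
      · rw [Set.indicator_of_mem (show |t| ∈ Ioi c from ht),
          Set.indicator_of_mem (show t ∈ {t : ℝ | c < |t|} from ht)]
      · rw [Set.indicator_of_notMem (show |t| ∉ Ioi c from ht),
          Set.indicator_of_notMem (show t ∉ {t : ℝ | c < |t|} from ht)]
    rw [hind]; exact hG2int.indicator hmeas
  have hRint : Integrable fun t : ℝ => R |t| := hG1int.add hG2ind
  -- (v) the integral inequality and the fold `∫_ℝ R(|t|) = 2 ∫_0^∞ R`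
  have hI0 : ∀ t : ℝ, 0 ≤ ‖Complex.Gamma ((σ + (t + t₀) * I) / 2)‖ *
      Real.exp (π * (t + t₀) / 4 - t ^ 2 / (2 * h ^ 2)) * ‖((1 / 2 + σ : ℝ) : ℂ) - t * I‖ ^ k :=
    fun t => by positivity
  have hmono : ∫ t : ℝ, ‖Complex.Gamma ((σ + (t + t₀) * I) / 2)‖ *
      Real.exp (π * (t + t₀) / 4 - t ^ 2 / (2 * h ^ 2)) * ‖((1 / 2 + σ : ℝ) : ℂ) - t * I‖ ^ k ≤
        ∫ t : ℝ, R |t| :=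
    integral_mono_of_nonneg (ae_of_all _ hI0) hRint (ae_of_all _ hdom)
  have hfold : ∫ t : ℝ, R |t| = 2 * ∫ s in Ioi (0 : ℝ), R s := integral_comp_abs
  have hG1on : IntegrableOn G1 (Ioi 0) :=
    hG1int.integrableOn.congr_fun (fun s hs => by
      show G1 |s| = G1 s; rw [abs_of_pos (Set.mem_Ioi.mp hs)]) measurableSet_Ioi
  have hG2indon : IntegrableOn (fun s => (Ioi c).indicator G2 s) (Ioi 0) :=
    hG2ind.integrableOn.congr_fun (fun s hs => by
      show (Ioi c).indicator G2 |s| = (Ioi c).indicator G2 s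
      rw [abs_of_pos (Set.mem_Ioi.mp hs)]) measurableSet_Ioi
  have hsplitR : ∫ s in Ioi (0 : ℝ), R s = (∫ s in Ioi (0 : ℝ), G1 s) + ∫ s in Ioi c, G2 s := by
    simp only [hR_apply]
    rw [integral_add hG1on hG2indon, setIntegral_indicator measurableSet_Ioi,
      show Ioi (0 : ℝ) ∩ Ioi c = Ioi c from Set.inter_eq_right.mpr (Set.Ioi_subset_Ioi hc0.le)]
  -- (vi) the first range: the Gaussian integral
  have hsq : Real.sqrt (π / (1 / (2 * h ^ 2))) = Real.sqrt 2 * Real.sqrt π * h := by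
    rw [show π / (1 / (2 * h ^ 2)) = 2 * (π * h ^ 2) by rw [div_div_eq_mul_div, div_one]; ring,
      Real.sqrt_mul (by norm_num : (0 : ℝ) ≤ 2), Real.sqrt_mul Real.pi_pos.le, Real.sqrt_sq hh.le]
    ring
  have hgauss : ∫ s in Ioi (0 : ℝ), E s = Real.sqrt 2 * Real.sqrt π * h / 2 := by
    rw [← hsq, ← integral_gaussian_Ioi (1 / (2 * h ^ 2))]
    refine setIntegral_congr_fun measurableSet_Ioi fun s _ => ?_
    rw [hE_apply]; congr 1; ring
  have hG1val : ∫ s in Ioi (0 : ℝ), G1 s =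
      K * (c + t₀) ^ m * Real.sqrt 2 ^ k * c ^ k * (Real.sqrt 2 * Real.sqrt π * h / 2) := by
    simp only [hG1_apply]
    rw [integral_const_mul, hgauss]
  -- (vii) the second range: binomial theorem and Lemma A.1
  have hmonIoi : ∀ n : ℕ, IntegrableOn (fun s : ℝ => s ^ n * E s) (Ioi c) := by
    intro n
    refine ((hmon n).integrableOn (s := Ioi c)).congr_fun (fun s hs => ?_) measurableSet_Ioi
    have hs0 : 0 < s := hc0.trans hs
    simp only [abs_of_pos hs0]
  have hA1 : ∀ n : ℕ, ∫ s in Ioi c, s ^ n * E s =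
      (2 : ℝ) ^ (((n : ℝ) - 1) / 2) * h ^ ((n : ℝ) + 1) *
        upperIncGamma (((n : ℝ) + 1) / 2) (c ^ 2 / (2 * h ^ 2)) := by
    intro n
    rw [← platt2017_lemmaA1 (κ := (n : ℝ)) (by have := Nat.cast_nonneg (α := ℝ) n; linarith) hc0 hh]
    refine setIntegral_congr_fun measurableSet_Ioi fun s _ => ?_
    rw [hE_apply, Real.rpow_natCast]
  have hG2val : ∫ s in Ioi c, G2 s = ∑ l ∈ Finset.range (m + 1),
      (K * Real.sqrt 2 ^ k * (m.choose l : ℝ) * t₀ ^ (m - l)) *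
        ((2 : ℝ) ^ ((((k + l : ℕ) : ℝ) - 1) / 2) * h ^ (((k + l : ℕ) : ℝ) + 1) *
          upperIncGamma ((((k + l : ℕ) : ℝ) + 1) / 2) (c ^ 2 / (2 * h ^ 2))) := by
    rw [show (∫ s in Ioi c, G2 s) = ∫ s in Ioi c, ∑ l ∈ Finset.range (m + 1),
        (K * Real.sqrt 2 ^ k * (m.choose l : ℝ) * t₀ ^ (m - l)) * (s ^ (k + l) * E s) from
      setIntegral_congr_fun measurableSet_Ioi fun s _ => hG2exp s]
    rw [integral_finsetSum _ fun l _ => (hmonIoi (k + l)).const_mul _]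
    refine Finset.sum_congr rfl fun l _ => ?_
    rw [integral_const_mul, hA1 (k + l)]
  -- (viii) assembling the constants
  have hmain := hmono.trans_eq (hfold.trans (by rw [hsplitR, hG1val, hG2val]))
  have P2a : (2 : ℝ) ^ k * (2 : ℝ) ^ ((3 - σ) / 4) * Real.sqrt 2 ^ k * Real.sqrt 2 =
      (2 : ℝ) ^ ((6 * (k : ℝ) + 5 - σ) / 4) := by
    rw [Real.sqrt_eq_rpow, ← Real.rpow_natCast 2 k, ← Real.rpow_natCast ((2 : ℝ) ^ (1 / 2 : ℝ)) k,
      ← Real.rpow_mul (by norm_num : (0 : ℝ) ≤ 2), ← Real.rpow_add two_pos, ← Real.rpow_add two_pos,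
      ← Real.rpow_add two_pos]
    congr 1; ring
  have P2b : (2 : ℝ) ^ k * 2 * (2 : ℝ) ^ ((3 - σ) / 4) * Real.sqrt 2 ^ k =
      (2 : ℝ) ^ ((6 * (k : ℝ) + 7 - σ) / 4) := by
    rw [show (2 : ℝ) ^ k * 2 = (2 : ℝ) ^ (k + 1) by ring, Real.sqrt_eq_rpow, ← Real.rpow_natCast 2 (k + 1),
      ← Real.rpow_natCast ((2 : ℝ) ^ (1 / 2 : ℝ)) k, ← Real.rpow_mul (by norm_num : (0 : ℝ) ≤ 2),
      ← Real.rpow_add two_pos, ← Real.rpow_add two_pos]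
    congr 1; push_cast; ring
  have Pπa : π ^ k * Real.sqrt π * Real.sqrt π = π ^ (k + 1) := by
    rw [mul_assoc, Real.mul_self_sqrt Real.pi_pos.le, pow_succ]
  have Pπb : π ^ k * Real.sqrt π = π ^ ((2 * (k : ℝ) + 1) / 2) := by
    rw [Real.sqrt_eq_rpow, ← Real.rpow_natCast π k, ← Real.rpow_add Real.pi_pos]
    congr 1; ring
  have hterm1 : (2 * π) ^ k * (2 * (K * (c + t₀) ^ m * Real.sqrt 2 ^ k * c ^ k *
      (Real.sqrt 2 * Real.sqrt π * h / 2))) =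
      (2 : ℝ) ^ ((6 * (k : ℝ) + 5 - σ) / 4) * π ^ (k + 1) * e₀ * c ^ k * (c + t₀) ^ m * h := by
    rw [mul_pow, hK]
    linear_combination (π ^ k * Real.sqrt π * Real.sqrt π * e₀ * (c + t₀) ^ m * c ^ k * h) * P2a +
      ((2 : ℝ) ^ ((6 * (k : ℝ) + 5 - σ) / 4) * e₀ * (c + t₀) ^ m * c ^ k * h) * Pπa
  have hterm2 : ∀ (l : ℕ) (Γv : ℝ), (2 * π) ^ k * (2 * ((K * Real.sqrt 2 ^ k * (m.choose l : ℝ) * t₀ ^ (m - l)) *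
      ((2 : ℝ) ^ (((k : ℝ) + l - 1) / 2) * h ^ ((k : ℝ) + l + 1) * Γv))) =
      (2 : ℝ) ^ ((6 * (k : ℝ) + 7 - σ) / 4) * π ^ ((2 * (k : ℝ) + 1) / 2) * e₀ *
        (((m.choose l : ℕ) : ℝ) * (2 : ℝ) ^ (((k : ℝ) + l - 1) / 2) * h ^ (k + l + 1) * t₀ ^ (m - l) * Γv) := by
    intro l Γv
    have hh' : h ^ ((k : ℝ) + l + 1) = h ^ (k + l + 1) := by
      rw [show (k : ℝ) + l + 1 = ((k + l + 1 : ℕ) : ℝ) by push_cast; ring, Real.rpow_natCast]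
    rw [hh', mul_pow, hK]
    linear_combination (π ^ k * Real.sqrt π * e₀ * (m.choose l : ℝ) * t₀ ^ (m - l) *
        (2 : ℝ) ^ (((k : ℝ) + l - 1) / 2) * h ^ (k + l + 1) * Γv) * P2b +
      ((2 : ℝ) ^ ((6 * (k : ℝ) + 7 - σ) / 4) * e₀ * (m.choose l : ℝ) * t₀ ^ (m - l) *
        (2 : ℝ) ^ (((k : ℝ) + l - 1) / 2) * h ^ (k + l + 1) * Γv) * Pπb
  have h2πk : 0 ≤ (2 * π) ^ k := by positivity
  refine (mul_le_mul_of_nonneg_left hmain h2πk).trans (le_of_eq ?_)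
  rw [mul_add, mul_add, Finset.mul_sum, Finset.mul_sum, hterm1, Finset.mul_sum]
  push_cast
  congr 1
  exact Finset.sum_congr rfl fun l _ => hterm2 l _

end Literature.NumberTheory.LFunctions

end
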